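import Literature.MathematicalPhysics.QuantumFieldTheory.BalabanImbrieJaffe1984to88.BIJ88NeumannRandomWalkSmallFieldTorus
import Mathlib.Analysis.CStarAlgebra.Matrix

/-!
# `BalabanImbrieJaffe1984to88.BIJ88NeumannRandomWalkL2Torus` — [6] Lemma 2.1 (2.15) ⇒ *"the L₂-norm of the operator R given by (2.11) is
# small for M large enough, so the series in the representation (2.12) is convergent in this norm"* FOR `G_k(Ω,u)` ON THE TORUS, FOR EVERY
# `M`-ALIGNED BLOCK UNION `Ω`, together with the `‖·‖_{2,2}` factor bound of (2.21) and the convergence of the walk expansion (2.13)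

T. Bałaban, *Regularity and decay of lattice Green's functions*, Comm. Math. Phys. **89** (1983) 571–597 [Balaban1983RegularityDecay]
(= [6] of Bałaban–Imbrie–Jaffe, *CMP* **114** (1988) [BalabanImbrieJaffe1988], whose (2.27)/(2.30) *"η-lattice propagators G_k(Ω,u) defined on
subsets Ω ⊂ T_η with Neumann boundary conditions … a straightforward application of the random walk expansion of [6]"* are the objects here),
§2 pp. 575–578.

statement-level skeleton of published theorems with citation tags; proofs where landed; nothing here is a claim about the Yang–Mills mass gap

PDF held: `paper:balaban1983-cmp89-regularity-decay` (journal page = PDF page + 570), pp. 573–579 [PDF 3–9] re-read this session from the text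
layer (`lit read … --pages 1-10`).

CITATION HEADER (lean-in-tree rule).  Part of the lit-balaban TYPED SKELETON (HOME `run/shared/lean/pub/lit-balaban/`), PHASE-2 proof seat
p31 gen 27 (unit `lit-balaban-p31`; TAKING line HOME/STATUS.md 2026-08-25T04:26:09Z, free-target protocol G.5-34(d); successor item of the
gen-26 chain `BIJ88NeumannCubePartitionTorus` → `BIJ88NeumannCommutator210Torus` → `BIJ88NeumannRandomWalkSmallFieldTorus`).  WHAT IS
REPRODUCED, as MODEL-INSTANCE CELLS (no head changes): rows **B4.Lem2.1** (Lemma 2.1 (2.15)), **B4.Eq2.12** ((2.12)–(2.13)) and **B4.Eq2.18**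
((2.18)–(2.22): the `‖·‖_{2,2}` factors of (2.21)) of `HOME/lit-balaban-r01/ROWS-B4.md` (owner r01; heads proved on the B4 carriers —
`B4Lemma21RegularWindow`, `B4Eq221L2FactorRegion`/`B4Eq221HjRegion`, `B4Ineq110LpChain`), and rows **C2.Eq2.30** / **C2.Claim@265** of
`HOME/lit-balaban-r18/ROWS-C2.md` (owner r18: the scope words «α, β hypotheses kept for general M-aligned Ω ⊊ T» of v2.131 are discharged here
in the `L₂`-norm).  Kind: theorems + four definitions with bodies (`l2n`, `mOne`, `IsMAligned`, `mBlock`, `fac`); NO `Prop`-valued fact.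

THE PRINTED TEXT (verbatim, text layer).  p. 575: *"We have assumed that Ω^{(k)} is a sum of large blocks, i.e. blocks of the size M on the unit
lattice, thus Ω is a sum of the corresponding large blocks of the size M on η-lattice T_η. For each j ∈ Z^d, let us define the set □_j = Ω ∩ {a sum
of large blocks for which the point Mj is one of the vertices}."*  p. 576, after (2.7): *"where we have used the fact that the normal derivative of
h_j to the boundary of □_j is equal to 0."*  p. 577: *"Lemma 2.1. Let a set □ be an arbitrary sum of unit blocks, but such that it is a sum of at
most few large blocks, and let A be as in the theorem. Then for e sufficiently small we have ‖G_k(□,A)f‖₂, ‖D^η_{A,μ}G_k(□,A)f‖₂, … ≦ c₂‖f‖₂.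
(2.15) Let us notice that Lemma 2.1 implies that the L₂-norm of the operator R given by (2.11) is small for M large enough, so the series in the
representation (2.12) is convergent in this norm."*  p. 578, (2.21): *"… Π_{i=n₀+1}^{n}‖K_{ω_i}G_k(□_{ω_i},A_{ω_i})h_{ω_i}‖_{2,2}‖f‖₂ ≦ …"*,
p. 579: *"Here ‖T‖_{q,p} denotes a norm of an operator T: L^p → L^q."*  [BalabanImbrieJaffe1985] p. 326 (for §7): *"The propagators arising from
Δ_k(u_k), under the restriction (7.3.1) on the gauge field, also satisfy the regularity and decay estimates of [7]. In order to remain within the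
framework of this reference, we remark that by change of gauge u_k can be transformed in a local region Λ into a configuration of the form
exp[ie_kηA], where A is smooth and small."*

## What this file proves (0 `sorry`, standard axioms)

Gen 26 discharged the two analytic inputs of (2.12)/(2.13) for `Ω = T^{(0)}` (the whole torus) in the `ℓ^∞ → ℓ^∞` norm under plaquette
smallness.  For a GENERAL region the rows of `K_i` near `∂Ω` need derivative control at Neumann boundary rows, which the print itself takes from
the `L₂` bounds of Lemma 2.1 (arbitrary block unions) rather than from Lemma 2.2 (parallelepipeds only, p. 579 l. 1–4).  This file follows that
`L₂` route on the torus of record, for every `Ω` that is a union of the `M`-blocks of the cube grid («a sum of the corresponding large blocks»):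
* §0 `l2n` = `‖f‖₂` (via `EuclideanSpace`), Minkowski, Cauchy–Schwarz, and the bridge to Mathlib's `‖·‖_{2→2}` (scope `Matrix.Norms.L2Operator`):
  `l2_opNorm_le_of_l2n_le`, `l2n_mulVec_le`, `l2_opNorm_diagonal_le`.
* §1 **LEMMA 2.1 (2.15) ON THE TORUS AT SMALL FIELDS** for EVERY `k`-block union `Q` and every `U(1)` field small on `Q` in the coercivity sense
  (in-block bond variables `|u_b − 1| ≤ T` on `Q*`, block transports `|u(Γ^{(k)}_{x_k,x}) − 1| ≤ δ` on `Q`, `2(L^k−1)L^k·d·T² + 2δ² ≤ ½`):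
  **`l2n_gBox_mulVec_le`** `‖G_k(Q,u)f‖₂ ≤ m₁⁻¹‖f‖₂` and **`energy_gBox_mulVec_le`** `Σ_{b∈Q*}|(D_uG_k(Q,u)f)(b)|² + aΣ|Q_kG_k(Q,u)f|² ≤ m₁⁻¹‖f‖₂²`
  (`m₁ = mOne = min(c²/4L^{2k}, a/4L^{kd})`, p34's `coercive_region` + `H_QG_k(Q,u) = 1_Q`), `sqrt_energy_gBox_le`, `norm_l2_gBox_le`
  (`‖G_k(Q,u)‖_{2→2} ≤ m₁⁻¹`); for the operator of record (`a = α_kL^{kd}`, `c = ε⁻¹`) `inv_mOne_le` (`m₁⁻¹ ≤ 4(L^kε)²/min(1,a/2)`) and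
  `norm_l2_gBox_le_spacing`.
* §2 **`M`-ALIGNED REGIONS**: `IsMAligned k M₀ Ω` (with `x ∈ Ω` the whole grid block `{⌊y_μ/M⌋ = ⌊x_μ/M⌋}` lies in `Ω`; `mBlock`, `isMAligned_mBlock`,
  `isMAligned_univ`, `IsMAligned.union`), `IsMAligned.isBlockUnion` (so `G_k(Ω,u)` and gen 25's localization datum apply); the one-dimensional
  factors `fac` of `h_i` and **`fac_eq_fac_succ_mod`** (the profile is flat across every point of `Mℤ`), `hT_eq_zero_of_far`, and the boundary
  flatness **`hT_shift_eq_of_not_mem` / `hT_unshift_eq_of_not_mem`**: for `x ∈ Ω ∩ □_i` and a neighbour `x ± e_μ ∉ Ω ∩ □_i`, `h_i(x ± e_μ) = h_i(x)`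
  — whence **`lapNh_inter_cube_eq`** (the Neumann Laplacian of `h_i` on `Ω ∩ □_i`, file 2's `lapNh`, is the FULL second difference at every row)
  and **`abs_lapNh_inter_cube_le`** `|Δ^{η,N}_{Ω∩□_i}h_i| ≤ c²d·3sup|h″|/M²` («|Δ^ηh_j| ≦ O(M⁻²)»; without the alignment a one-sided term
  `O(L^k/M)` would survive at `∂Ω`, cf. file 2's `lapNh_dir_of_mem_of_not_mem`).
* §3 THE `L₂` SIZES OF THE THREE TERMS OF (2.10): **`l2n_gradTerm_le`** `≤ 2d|c|δ₁(Σ_{Q*}|D_uφ|²)^{1/2}` (only bonds of `Q*`, each at its two ends: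
  `sum_sum_ite_bond_eq`), `l2n_lapNh_mul_le` `≤ Λ‖φ‖₂`, **`l2n_blockTerm_le`** `≤ |a|δ₃L^{−kd}‖φ‖₂` (Cauchy–Schwarz over a block,
  `sum_sum_blockK_eq`).
* §4 **`l2n_kLet_mulVec_le`** ((2.10) in `L₂`, generic sizes), **`l2n_kLet_gBox_mulVec_le`** ((2.21)'s factor from (2.15), generic), the sizes of
  [6]'s torus cut-offs `hT_sizes`, and **`norm_l2_letter_le`**: `∃ C = C(d,a) > 0`, for every torus of the series, every `1 ≤ k ≤ m + K`, every cube
  size of file 1 (`CubeSize`), every `M`-aligned `k`-block union `Ω ⊆ T^{(0)}`, every `U(1)` field small ON `Ω` in the coercivity sense and every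
  window: **`‖K_iG_k(Ω ∩ □_i,u)‖_{2→2} ≤ C/M₀`, UNIFORMLY IN `k`** (no plaquette condition; the operator of record `H = (χD_u)ᴴ(χD_u) + α_kL^{kd}Q_kᴴQ_k`).
* §5 **`norm_l2_rOp_le`** (generic: `‖R‖_{2→2} ≤ m₀β` from row multiplicity `m₀` and `Σ_i h_i² = 1`), **`norm_l2_rOp_cubes_le`** (`‖R‖_{2→2} ≤ 2^dC/M₀`),
  **`hasSum_gZero_mul_pow_l2`**: `∃ M₁(d,a)`, `M₀ ≥ M₁ ⇒ ‖R‖_{2→2} < 1` and **(2.12) `HasSum (n ↦ G₀Rⁿ) (G_k(Ω,u))`**, and **`hasSum_piece_l2`**: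
  **(2.13) `HasSum (piece …) (G_k(Ω,u))` over all walks of [6]'s cubes**, for EVERY `M`-aligned `Ω` (p13's `hasSum_walkTerm` in the complete
  normed ring `(kernels, ‖·‖_{2→2})`; the `HasSum`s are taken in the product topology of the kernels — Mathlib's `Matrix.Norms.L2Operator`
  instances keep it — so they are the same propositions as gen 25/26's).

* §6 (v1.1, append-only): the remaining members of (2.15) as operator bounds — **`norm_l2_dN_gBox_le`** `‖(χ_QD_u)G_k(Q,u)‖_{2→2} ≤ m₁^{−1/2}`,
  **`norm_l2_gBox_dN_conjTranspose_le`** `‖G_k(Q,u)(χ_QD_u)ᴴ‖_{2→2} ≤ m₁^{−1/2}` (duality, `G` Hermitian), **`norm_l2_dN_gBox_dN_conjTranspose_le`**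
  `‖(χ_QD_u)G_k(Q,u)(χ_QD_u)ᴴ‖_{2→2} ≤ 1` for EVERY field (no smallness: `G = GHG`, `H ≥ DᴴD`); `IsMAligned.inter`, **`isMAligned_cube`** (the windows
  `□_i` are `M`-aligned); and **`hasSum_piece_univ_l2`**: (2.13) for `G_k(T^{(0)},u)` in gen 26's shape (`fun i => □_i`, target `gBox … univ`) under
  coercivity smallness only, every `d`, every `L`.
* §7 (v1.1, append-only): **THE SAME WITH NO GAUGE CONDITION, UNDER THE SMALL-PLAQUETTE HYPOTHESIS** `|u(∂p) − 1| ≤ θ` on the torus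
  ([BalabanImbrieJaffe1985] (7.3.1); [6]'s *"A as in the theorem"*): the `L₂ → L₂` norm is invariant under the unitary gauge conjugation
  (**`norm_l2_mulOp_sandwich`**, `hasSum_of_hasSum_mulOp_sandwich`; gen 25 §5 covariance of every operator of the expansion, [BalabanImbrieJaffe1988]
  p. 265) and p34's blockwise centred axial gauge `smallField_blockGauge` supplies the coercivity hypotheses, so **`norm_l2_gBox_le_smallPlaquette`**
  ((2.15), every block union), **`norm_l2_letter_le_smallPlaquette`**, **`norm_l2_rOp_cubes_le_smallPlaquette`**,
  **`hasSum_gZero_mul_pow_l2_smallPlaquette`** ((2.12)) and **`hasSum_piece_l2_smallPlaquette`** ((2.13)) hold for `u` ITSELF, every `M`-aligned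
  `Ω`, with the hypothesis list of p34's `decay_kernel_smallPlaquette_region_uniform` (`θ`-threshold depending on `(d, L^k)` only,
  `2(L^k−1) + 4 < |T^{(0)}|`); `hasSum_piece_univ_l2_smallPlaquette` = gen 26's `hasSum_piece_torus` conclusion for every `d`, every `L`, from the
  plaquette hypothesis alone.
* §8 (v1.1, append-only): **LOCALITY OF THE WALK TERMS IN `u`** ([BalabanImbrieJaffe1988] p. 264 *"the convergence and locality properties of
  the random walk expansion"*): `aLet_congr`, `kLet_congr`, `bLet_congr`, `bprod_bLet_congr`, **`piece_congr`** (`T_ω[u] = T_ω[u′]` when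
  `u = u′` on `⋃_{i∈ω} Q_i*`; from p34's `gBox_congr`/`nOp_congr`), `piece_cubes_congr` (for [6]'s cubes: the bonds of `Ω` inside the visited
  windows) — every level, every field, every localization datum.

HONEST SCOPE.  (i) Norm: `L² → L²` only («convergent in this norm»); no sup-norm or Hölder statement for general `Ω` (those need the `R₀`
restriction and the mixed `L^p` chain (2.18)–(2.21), r01's `B4Ineq110LpChain` on the B4 carrier; not done here).  (ii) `Ω` must be `M`-aligned
(a union of grid `M`-blocks, `M = L^kM₀` fine sites) — exactly the print's standing assumption p. 575; for a `k`-block union that is not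
`M`-aligned the boundary term of `lapNh` is genuinely `O(L^k/M)`.  (iii) Smallness = the coercivity hypotheses of p34's `coercive_region`
(in-block bond variables and block transports) in §1–§6; §7 (v1.1) gives the gauge-invariant form under small plaquette variables, whose `θ`-threshold
degrades like `(d^{3/2}L^{2k})^{−1}` (p34's HONEST SCOPE (ii)) — it is NOT `k`-uniform in `θ`, unlike the constants `C`, `M₁`; the third and fourth
members of (2.15) (`G_kD^{η*}`, `D G D^*`) are proved in §6 (v1.1) as operator bounds (not needed for (2.12)).
(iv) Level `j = 0` torus for the operator of record in §4–§5 (as in the whole `BIJ88Neumann…` series); §1–§3 and the generic §4/§5 lemmas are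
stated for every level `j`, every `a > 0`, `c ≠ 0`.  (v) Constants: `C = 12d(D₁/√q + D₂/q + aD₁/q) + 1`, `q = min(1, a/2)`, `D₁ = sup|h′|`,
`D₂ = sup|h″|` of r01's profile; `M₁ = ⌈2^dC⌉ + 1` resp. `max(…, ⌈3^dC⌉ + 1)`; not optimised.  (vi) `Ã_j` of [6] not modelled (as in gen 25:
(2.27) of [BalabanImbrieJaffe1988] uses `u` itself).

Carrier and vocabulary BY NAME: gen 25 `BIJ88NeumannRandomWalkTorus` (`mulR`, `aLet`, `kLet`, `bLet`, `piece`, `gZero`, `rOp`,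
`gBox_mul_one_sub_rOp`, `kLet_mulVec`-free algebra), file 1 `BIJ88NeumannCubePartitionTorus` (`half`, `nLab`, `Lab`, `CubeSize`, `ctr`, `Near`,
`cube`, `hT`, `sum_hT_sq`, `abs_hT_le_one`, `near_of_hT_ne_zero`, `abs_hT_sub_le`, `isBlockUnion_cube`, `isLocalization_cubes`,
`card_filter_mem_inter_cube_le`, `card_filter_labAdj_le`, `letters_mul_eq_zero_of_not_labAdj`, `per3_hprof_add_period`), file 2
`BIJ88NeumannCommutator210Torus` (`gradTerm`, `lapNh`, `blockTerm`, `kLet_mulVec`, `kLet_mulVec_eq_zero_of_not_mem`, `norm_blockTerm_le`),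
gen 26 `BIJ88NeumannRandomWalkSmallFieldTorus` (`abs_hT_second_diff_le`), p34 `BIJ88NeumannPropagatorSmallFieldRegion` (`coercive_region`,
`re_form_nOp_self`, `nOp_mulVec_gBox_mulVec`, `gBox_mulVec_eq_zero_of_not_mem`), gen 15 `BIJ88NeumannPropagator227Torus` (`gBox`, `nOp`, `proj`,
`proj_mulVec`), p13 `BIJ88RandomWalk242` (`hasSum_walkTerm`), r01 `B4RandomWalk213` (`hasSum_of_norm_lt_one`), r01 `B4PartitionUnity22`
(`hprof`, `D1`, `D2`), p35 `B1TorusCubeCover` (`per3`), `B1.aSeq_pos/aSeq_le/aSeq_eq`, Mathlib `Matrix.Norms.L2Operator`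
(`l2_opNorm_def`, `l2_opNorm_mulVec`, `l2_opNorm_diagonal`, `instL2OpNormedRing`).  Nothing of another seat re-declared.

v1.1 (same seat, same day; v1 = p392726 ✓ 88b1d430ba2c): APPEND-ONLY §6–§8 (see above) + these header paragraphs; no v1 declaration changed;
§7–§8 use BY NAME gen 15 `BIJ88DeltaLoc234Torus` (`mulOp`, `conjTranspose_mul_mulOp`, `gBox_gaugeAct`), gen 25 §5 (`kLet_gaugeAct`, `rOp_gaugeAct`,
`gZero_mul_pow_rOp_gaugeAct`, `piece_gaugeAct`), p34 `BIJ88NeumannPropagatorSmallPlaquetteRegion` (`smallField_blockGauge` — p27 gen 34's blockwise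
gauge —, `gBox_congr`, `nOp_congr`), p30 `BIJ85CentredAxialGauge.centredGauge`, Mathlib `l2_opNorm_conjTranspose` — all already in this file's
import cone.
Unit `lit-balaban-p31` (literature-prover-lit-balaban-p31-g27-0), 2026-08-25.  NOT summit progress.

## References
* [Balaban1983RegularityDecay] T. Bałaban, Comm. Math. Phys. 89 (1983) 571–597, §2: p. 575 ¶1, (2.6)–(2.7) p. 576, (2.10)–(2.13), Lemma 2.1
  (2.15) p. 577, (2.21) p. 578.
* [BalabanImbrieJaffe1985] T. Bałaban, J. Imbrie, A. Jaffe, Comm. Math. Phys. 97 (1985) 299–329, (2.7) p. 303, (5.1.2)–(5.1.3) p. 313,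
  (7.3.1)–(7.3.2) p. 326.
* [BalabanImbrieJaffe1988] T. Bałaban, J. Imbrie, A. Jaffe, Comm. Math. Phys. 114 (1988) 257–315, p. 262 («To localize the dependence on u»),
  (2.27)/(2.30) p. 263, p. 264 («the convergence and locality properties of the random walk expansion»), p. 265 (gauge covariance of the
  operators of the expansion).
* [Balaban1982Higgs1] T. Bałaban, Comm. Math. Phys. 85 (1982) 603–626, (2.15) p. 609 (the sequence `a_k`).
-/

open scoped BigOperators Matrix ComplexConjugate
open Finset Matrix

namespace Literature.MathematicalPhysics.QuantumFieldTheory.BalabanImbrieJaffe1984to88.BIJ88NeumannRandomWalkL2Torus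

open Literature.MathematicalPhysics.QuantumFieldTheory.Balaban1983to89
open BIJ88Sect3Statements (U1 toC cfg covD starB mem_starB norm_toC)
open BIJ85BlockAveragesTorus BIJ85BlockAveragesTorusK
open BIJ85BlockKPoincare (val_blkIter)
open BIJ88NeumannNoZeroModesTorus BIJ88NeumannPropagator227Torus
open BIJ88NeumannRandomWalkTorus BIJ88NeumannCubePartitionTorus BIJ88NeumannCommutator210Torus
open BIJ88NeumannPropagatorSmallFieldRegion (coercive_region re_form_nOp_self nOp_mulVec_gBox_mulVec gBox_mulVec_eq_zero_of_not_mem)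
open BIJ88NeumannRandomWalkSmallFieldTorus (abs_hT_second_diff_le)
open B4PartitionUnity22 (hprof hprof_eq_one hprof_eq_zero contDiff_hprof hasCompactSupport_hprof D1 D2 D1_nonneg D2_nonneg)
open B1TorusCubeCover (per3 per3_hprof_mem_Icc hprof_zero_of_one_le)
open B4RandomWalk213 (bprod hasSum_of_norm_lt_one norm_mul_bprod_le)
open BIJ88RandomWalk242 (Walk walkTerm hasSum_walkTerm)

noncomputable section

variable {P : Params} {j : ℕ}

/-! ## §0 The `ℓ²` norm of record: `‖f‖₂ = (Σ_x |f(x)|²)^{1/2}` on the sites of the torus and the `ℓ² → ℓ²` operator norm of a kernel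
(Mathlib scope `Matrix.Norms.L2Operator`) -/

section L2Glue

variable {m : Type*} [Fintype m] [DecidableEq m]

/-- The `L₂`-norm `‖f‖₂ = (Σ_x|f(x)|²)^{1/2}` of a lattice function (the norm of Lemma 2.1 (2.15), counting measure; the `η^d`-weights of the
print's `L²(□)` cancel in every `L² → L²` bound). [cite: Balaban1983RegularityDecay, (2.15) p.577] -/
def l2n (f : m → ℂ) : ℝ := ‖(WithLp.toLp 2 f : EuclideanSpace ℂ m)‖

omit [DecidableEq m] in
/-- kernel: `‖f‖₂² = Σ_x |f(x)|²`. [cite: Balaban1983RegularityDecay, (2.15) p.577] -/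
theorem l2n_sq (f : m → ℂ) : l2n f ^ 2 = ∑ x, ‖f x‖ ^ 2 := by
  unfold l2n; rw [EuclideanSpace.norm_sq_eq]

omit [DecidableEq m] in
/-- kernel: `‖f‖₂ = √(Σ_x |f(x)|²)`. [cite: Balaban1983RegularityDecay, (2.15) p.577] -/
theorem l2n_eq_sqrt (f : m → ℂ) : l2n f = Real.sqrt (∑ x, ‖f x‖ ^ 2) := by
  unfold l2n; rw [EuclideanSpace.norm_eq]

omit [DecidableEq m] in
/-- kernel: `‖f‖₂ ≥ 0`. [cite: Balaban1983RegularityDecay, (2.15) p.577] -/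
theorem l2n_nonneg (f : m → ℂ) : 0 ≤ l2n f := norm_nonneg _

omit [DecidableEq m] in
/-- kernel: Minkowski, `‖f + g‖₂ ≤ ‖f‖₂ + ‖g‖₂`. [cite: Balaban1983RegularityDecay, (2.15) p.577] -/
theorem l2n_add_le (f g : m → ℂ) : l2n (f + g) ≤ l2n f + l2n g := by
  unfold l2n; rw [WithLp.toLp_add]; exact norm_add_le _ _

omit [DecidableEq m] in
/-- kernel: `‖f − g‖₂ ≤ ‖f‖₂ + ‖g‖₂`. [cite: Balaban1983RegularityDecay, (2.15) p.577] -/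
theorem l2n_sub_le (f g : m → ℂ) : l2n (f - g) ≤ l2n f + l2n g := by
  unfold l2n; rw [WithLp.toLp_sub]; exact norm_sub_le _ _

omit [DecidableEq m] in
/-- kernel: `|f(x)| ≤ ‖f‖₂`. [cite: Balaban1983RegularityDecay, (2.15) p.577] -/
theorem norm_apply_le_l2n (f : m → ℂ) (x : m) : ‖f x‖ ≤ l2n f := by
  have h : ‖f x‖ ^ 2 ≤ l2n f ^ 2 := by
    rw [l2n_sq]; exact Finset.single_le_sum (f := fun y => ‖f y‖ ^ 2) (fun _ _ => sq_nonneg _) (Finset.mem_univ x)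
  exact (abs_le_of_sq_le_sq' h (l2n_nonneg f)).2

omit [DecidableEq m] in
/-- kernel: a quadratic bound gives a bound of `ℓ²` norms, `Σ|f|² ≤ C²Σ|g|² ⇒ ‖f‖₂ ≤ C‖g‖₂`. [cite: Balaban1983RegularityDecay, (2.15) p.577] -/
theorem l2n_le_of_sq_le {f g : m → ℂ} {C : ℝ} (hC : 0 ≤ C) (h : ∑ x, ‖f x‖ ^ 2 ≤ C ^ 2 * ∑ x, ‖g x‖ ^ 2) : l2n f ≤ C * l2n g := by
  have h2 : l2n f ^ 2 ≤ (C * l2n g) ^ 2 := by rw [mul_pow, l2n_sq, l2n_sq]; exact h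
  exact (abs_le_of_sq_le_sq' h2 (mul_nonneg hC (l2n_nonneg g))).2

omit [DecidableEq m] in
/-- kernel: pointwise domination `|f(x)| ≤ c·|g(x)|` gives `‖f‖₂ ≤ c‖g‖₂`. [cite: Balaban1983RegularityDecay, (2.15) p.577] -/
theorem l2n_le_of_pointwise {f g : m → ℂ} {c : ℝ} (hc : 0 ≤ c) (h : ∀ x, ‖f x‖ ≤ c * ‖g x‖) : l2n f ≤ c * l2n g := by
  refine l2n_le_of_sq_le hc ?_
  rw [Finset.mul_sum]
  exact Finset.sum_le_sum fun x _ => by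
    rw [← mul_pow]; exact pow_le_pow_left₀ (norm_nonneg _) (h x) 2

open scoped Matrix.Norms.L2Operator

/-- kernel: **the `L² → L²` operator norm from a quadratic-form bound** — if `‖Af‖₂ ≤ C‖f‖₂` for every `f`, then `‖A‖_{2→2} ≤ C`
(the norm `‖·‖_{2,2}` of (2.21) p. 578). [cite: Balaban1983RegularityDecay, (2.21) p.578] -/
theorem l2_opNorm_le_of_l2n_le {A : Matrix m m ℂ} {C : ℝ} (hC : 0 ≤ C) (h : ∀ f : m → ℂ, l2n (A *ᵥ f) ≤ C * l2n f) : ‖A‖ ≤ C := by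
  rw [l2_opNorm_def]
  refine ContinuousLinearMap.opNorm_le_bound _ hC fun v => ?_
  have h1 := h (WithLp.ofLp v)
  unfold l2n at h1
  exact h1

/-- kernel: conversely `‖Af‖₂ ≤ ‖A‖_{2→2}‖f‖₂`. [cite: Balaban1983RegularityDecay, (2.21) p.578] -/
theorem l2n_mulVec_le (A : Matrix m m ℂ) (f : m → ℂ) : l2n (A *ᵥ f) ≤ ‖A‖ * l2n f := by
  have h := l2_opNorm_mulVec A (WithLp.toLp 2 f)
  unfold l2n
  exact h

/-- kernel: a diagonal kernel with entries of modulus `≤ 1` has `‖·‖_{2→2} ≤ 1` (the cut-offs `h_j`, `0 ≤ h_j ≤ 1`).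
[cite: Balaban1983RegularityDecay, (2.2) p.575] -/
theorem l2_opNorm_diagonal_le {v : m → ℂ} {C : ℝ} (hC : 0 ≤ C) (h : ∀ x, ‖v x‖ ≤ C) : ‖(diagonal v : Matrix m m ℂ)‖ ≤ C := by
  rw [l2_opNorm_diagonal]
  exact pi_norm_le_iff_of_nonneg hC |>.2 h

omit [DecidableEq m] in
/-- kernel, Cauchy–Schwarz on a finite set: `|Σ_{i∈s} a_i|² ≤ |s|·Σ_{i∈s}|a_i|²`. [folklore] -/
private theorem norm_sum_sq_le_card_mul {ι : Type*} (s : Finset ι) (a : ι → ℂ) :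
    ‖∑ i ∈ s, a i‖ ^ 2 ≤ s.card * ∑ i ∈ s, ‖a i‖ ^ 2 :=
  calc ‖∑ i ∈ s, a i‖ ^ 2 ≤ (∑ i ∈ s, ‖a i‖) ^ 2 := pow_le_pow_left₀ (norm_nonneg _) (norm_sum_le _ _) 2
    _ ≤ s.card * ∑ i ∈ s, ‖a i‖ ^ 2 := sq_sum_le_card_mul_sum_sq

omit [DecidableEq m] in
/-- kernel, Cauchy–Schwarz: `|Σ_x conj(φ(x))ψ(x)| ≤ ‖φ‖₂‖ψ‖₂`. [folklore] -/
private theorem norm_star_dotProduct_le (φ ψ : m → ℂ) : ‖star φ ⬝ᵥ ψ‖ ≤ l2n φ * l2n ψ := by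
  have h := norm_inner_le_norm (𝕜 := ℂ) (WithLp.toLp 2 φ : EuclideanSpace ℂ m) (WithLp.toLp 2 ψ)
  unfold l2n
  refine le_trans (le_of_eq ?_) h
  rw [EuclideanSpace.inner_toLp_toLp, dotProduct_comm]

end L2Glue

/-! ## §1 Lemma 2.1 (2.15) ON THE TORUS AT SMALL FIELDS: `‖G_k(Q,u)f‖₂ ≤ m₁⁻¹‖f‖₂` and the energy bound
`Σ_{b∈Q*}|(D_uG_k(Q,u)f)(b)|² ≤ m₁⁻¹‖f‖₂²` for EVERY `k`-block union `Q` (p34's coercivity of the Neumann form + `H_QG_k(Q,u) = 1_Q`) -/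

section Lemma21

variable {k : ℕ}

/-- The coercivity constant of the Neumann form on a `k`-block union at small fields (p34's `coercive_region`):
`m₁ = min(c²/(4L^{2k}), a/(4L^{kd}))`. [cite: BalabanImbrieJaffe1985, (7.3.2) p.326] -/
def mOne (P : Params) (a c : ℝ) (k : ℕ) : ℝ := min (c ^ 2 / (4 * ((P.L : ℝ) ^ k) ^ 2)) (a / (4 * (P.L : ℝ) ^ (k * P.d)))

/-- `m₁ > 0` for `c ≠ 0`, `a > 0`. [cite: BalabanImbrieJaffe1985, (7.3.2) p.326] -/
theorem mOne_pos {a c : ℝ} (hc : c ≠ 0) (ha : 0 < a) (k : ℕ) : 0 < mOne P a c k := by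
  unfold mOne
  have h1 : 0 < (P.L : ℝ) ^ k := pow_pos P.cast_L_pos _
  have h2 : 0 < (P.L : ℝ) ^ (k * P.d) := pow_pos P.cast_L_pos _
  have h3 : 0 < c ^ 2 := by positivity
  exact lt_min (by positivity) (by positivity)

/-- **LEMMA 2.1 (2.15), FIRST MEMBER, ON THE TORUS: `‖G_k(Q,u)f‖₂ ≤ m₁⁻¹‖f‖₂`** for every union `Q` of `k`-blocks and every `U(1)` field
small on `Q` in the coercivity sense (in-block bond variables `|u_b − 1| ≤ T` on `Q*`, block transports `|u(Γ^{(k)}_{x_k,x}) − 1| ≤ δ` on `Q`,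
`2(L^k−1)L^k·d·T² + 2δ² ≤ ½`) — printed *"Let a set □ be an arbitrary sum of unit blocks … Then for e sufficiently small we have
‖G_k(□,A)f‖₂, … ≦ c₂‖f‖₂. (2.15)"*; here from `m₁‖φ‖₂² ≤ Re⟨φ, H_Qφ⟩ = Re⟨φ, 1_Qf⟩ ≤ ‖φ‖₂‖f‖₂`, `φ = G_k(Q,u)f`.
[cite: Balaban1983RegularityDecay, (2.15) p.577] -/
theorem l2n_gBox_mulVec_le (hk : j + k ≤ P.m + P.K) {a c : ℝ} (hc : c ≠ 0) (ha : 0 < a) (U : GaugeField P j U1)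
    {Q : Finset (Balaban1983to89.Site P j)} (hQ : IsBlockUnion k Q) {T δ : ℝ}
    (hInt : ∀ b ∈ starB Q, blkIter k b.src = blkIter k b.tgt → ‖toC (U b) - 1‖ ≤ T)
    (hTree : ∀ x ∈ Q, ‖holCK U k x - 1‖ ≤ δ)
    (hsmall : 2 * (((P.L : ℝ) ^ k - 1) * (P.L : ℝ) ^ k) * P.d * T ^ 2 + 2 * δ ^ 2 ≤ 1 / 2) (f : Balaban1983to89.Site P j → ℂ) :
    l2n (gBox a c U k Q *ᵥ f) ≤ (mOne P a c k)⁻¹ * l2n f := by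
  set φ := gBox a c U k Q *ᵥ f with hφ
  have hm := mOne_pos (P := P) hc ha k
  have hsupp : ∀ x, x ∉ Q → φ x = 0 := fun x hx => gBox_mulVec_eq_zero_of_not_mem hk hc ha U hQ f hx
  have hco := coercive_region hk hQ U hInt hTree hsmall c ha φ hsupp
  have heq : nOp a c U k Q *ᵥ φ = proj Q *ᵥ f := nOp_mulVec_gBox_mulVec hk hc ha U hQ f
  rw [heq] at hco
  -- `Re⟨φ, 1_Q f⟩ ≤ ‖φ‖₂‖1_Qf‖₂ ≤ ‖φ‖₂‖f‖₂`
  have hcs : (star φ ⬝ᵥ (proj Q *ᵥ f)).re ≤ l2n φ * l2n f := by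
    refine (Complex.re_le_norm _).trans ((norm_star_dotProduct_le φ _).trans (mul_le_mul_of_nonneg_left ?_ (l2n_nonneg φ)))
    refine (l2n_le_of_pointwise zero_le_one fun x => ?_).trans (by rw [one_mul])
    rw [proj_mulVec, one_mul]; split_ifs <;> simp
  have hS : mOne P a c k * l2n φ ^ 2 ≤ l2n φ * l2n f := by
    rw [l2n_sq]; unfold mOne; exact hco.trans hcs
  -- divide by `‖φ‖₂` (or `φ = 0`)
  by_cases h0 : l2n φ = 0
  · rw [h0]; exact mul_nonneg (inv_nonneg.2 hm.le) (l2n_nonneg f)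
  · have hpos : 0 < l2n φ := lt_of_le_of_ne (l2n_nonneg φ) (Ne.symm h0)
    have h1 : mOne P a c k * l2n φ ≤ l2n f := by
      have h2 : (mOne P a c k * l2n φ) * l2n φ ≤ l2n f * l2n φ := by nlinarith [hS]
      exact le_of_mul_le_mul_right h2 hpos
    calc l2n φ = (mOne P a c k)⁻¹ * (mOne P a c k * l2n φ) := by field_simp
      _ ≤ (mOne P a c k)⁻¹ * l2n f := mul_le_mul_of_nonneg_left h1 (inv_nonneg.2 hm.le)

/-- **LEMMA 2.1 (2.15), SECOND MEMBER (ENERGY FORM), ON THE TORUS**: `Σ_{b∈Q*}|(D_uG_k(Q,u)f)(b)|² + a·Σ_{B^k(y)⊆Q}|(Q_k(u)G_k(Q,u)f)(y)|²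
≤ m₁⁻¹‖f‖₂²` under the same smallness — the printed `‖D^η_{A,μ}G_k(□,A)f‖₂ ≦ c₂‖f‖₂` of (2.15), all bonds of `□*` at once, boundary bonds
included (from `Re⟨φ, H_Qφ⟩ = Σ_{Q*}|D_uφ|² + a Σ|Q_kφ|²`, `φ = G_k(Q,u)f`). [cite: Balaban1983RegularityDecay, (2.15) p.577] -/
theorem energy_gBox_mulVec_le (hk : j + k ≤ P.m + P.K) {a c : ℝ} (hc : c ≠ 0) (ha : 0 < a) (U : GaugeField P j U1)
    {Q : Finset (Balaban1983to89.Site P j)} (hQ : IsBlockUnion k Q) {T δ : ℝ}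
    (hInt : ∀ b ∈ starB Q, blkIter k b.src = blkIter k b.tgt → ‖toC (U b) - 1‖ ≤ T)
    (hTree : ∀ x ∈ Q, ‖holCK U k x - 1‖ ≤ δ)
    (hsmall : 2 * (((P.L : ℝ) ^ k - 1) * (P.L : ℝ) ^ k) * P.d * T ^ 2 + 2 * δ ^ 2 ≤ 1 / 2) (f : Balaban1983to89.Site P j → ℂ) :
    ∑ b ∈ starB Q, ‖covD c (cfg U) (gBox a c U k Q *ᵥ f) b‖ ^ 2
        + a * ∑ y ∈ innerK k Q, ‖qCovK U k (gBox a c U k Q *ᵥ f) y‖ ^ 2 ≤ (mOne P a c k)⁻¹ * l2n f ^ 2 := by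
  set φ := gBox a c U k Q *ᵥ f with hφ
  have hm := mOne_pos (P := P) hc ha k
  have heq : nOp a c U k Q *ᵥ φ = proj Q *ᵥ f := nOp_mulVec_gBox_mulVec hk hc ha U hQ f
  rw [← re_form_nOp_self, heq]
  have hcs : (star φ ⬝ᵥ (proj Q *ᵥ f)).re ≤ l2n φ * l2n f := by
    refine (Complex.re_le_norm _).trans ((norm_star_dotProduct_le φ _).trans (mul_le_mul_of_nonneg_left ?_ (l2n_nonneg φ)))
    refine (l2n_le_of_pointwise zero_le_one fun x => ?_).trans (by rw [one_mul])
    rw [proj_mulVec, one_mul]; split_ifs <;> simp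
  have hG := l2n_gBox_mulVec_le hk hc ha U hQ hInt hTree hsmall f
  calc (star φ ⬝ᵥ (proj Q *ᵥ f)).re ≤ l2n φ * l2n f := hcs
    _ ≤ (mOne P a c k)⁻¹ * l2n f * l2n f := mul_le_mul_of_nonneg_right hG (l2n_nonneg f)
    _ = (mOne P a c k)⁻¹ * l2n f ^ 2 := by ring

/-- **`‖D_uG_k(Q,u)f‖_{ℓ²(Q*)} ≤ m₁^{−1/2}‖f‖₂`** (square root of the energy bound). [cite: Balaban1983RegularityDecay, (2.15) p.577] -/
theorem sqrt_energy_gBox_le (hk : j + k ≤ P.m + P.K) {a c : ℝ} (hc : c ≠ 0) (ha : 0 < a) (U : GaugeField P j U1)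
    {Q : Finset (Balaban1983to89.Site P j)} (hQ : IsBlockUnion k Q) {T δ : ℝ}
    (hInt : ∀ b ∈ starB Q, blkIter k b.src = blkIter k b.tgt → ‖toC (U b) - 1‖ ≤ T)
    (hTree : ∀ x ∈ Q, ‖holCK U k x - 1‖ ≤ δ)
    (hsmall : 2 * (((P.L : ℝ) ^ k - 1) * (P.L : ℝ) ^ k) * P.d * T ^ 2 + 2 * δ ^ 2 ≤ 1 / 2) (f : Balaban1983to89.Site P j → ℂ) :
    Real.sqrt (∑ b ∈ starB Q, ‖covD c (cfg U) (gBox a c U k Q *ᵥ f) b‖ ^ 2) ≤ Real.sqrt ((mOne P a c k)⁻¹) * l2n f := by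
  have h := energy_gBox_mulVec_le hk hc ha U hQ hInt hTree hsmall f
  have hQ0 : 0 ≤ a * ∑ y ∈ innerK k Q, ‖qCovK U k (gBox a c U k Q *ᵥ f) y‖ ^ 2 :=
    mul_nonneg ha.le (Finset.sum_nonneg fun _ _ => sq_nonneg _)
  have h1 : ∑ b ∈ starB Q, ‖covD c (cfg U) (gBox a c U k Q *ᵥ f) b‖ ^ 2 ≤ (mOne P a c k)⁻¹ * l2n f ^ 2 := by linarith
  calc Real.sqrt _ ≤ Real.sqrt ((mOne P a c k)⁻¹ * l2n f ^ 2) := Real.sqrt_le_sqrt h1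
    _ = Real.sqrt ((mOne P a c k)⁻¹) * l2n f := by rw [Real.sqrt_mul (inv_nonneg.2 (mOne_pos hc ha k).le), Real.sqrt_sq (l2n_nonneg f)]

end Lemma21

/-! ## §2 `M`-ALIGNED BLOCK UNIONS `Ω` («Ω is a sum of the corresponding large blocks of the size M», p. 575) and the vanishing of the normal
difference of `h_i` across `∂(Ω ∩ □_i)` («the normal derivative of h_j to the boundary of □_j is equal to 0», p. 576): the Neumann Laplacian
term of (2.10) is the full second difference `O(M⁻²)` at every row -/

section Aligned

variable {k M₀ : ℕ}

/-- **`Ω` IS A SUM OF LARGE BLOCKS OF THE CUBE GRID** («Ω is a sum of the corresponding large blocks of the size M on η-lattice T_η», p. 575):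
with a site `x` the region contains the whole `M`-block `{y : ⌊y_μ/M⌋ = ⌊x_μ/M⌋ ∀μ}` of the grid `Mℤ^d` through the cube centres `Mi`
(`M = L^kM₀` fine sites, `half`). [cite: Balaban1983RegularityDecay, §2 p.575] -/
def IsMAligned (k M₀ : ℕ) (Ω : Finset (Balaban1983to89.Site P j)) : Prop :=
  ∀ x ∈ Ω, ∀ y : Balaban1983to89.Site P j, (∀ μ, (y μ).val / half P k M₀ = (x μ).val / half P k M₀) → y ∈ Ω

/-- The `M`-block of the grid through `x`. [cite: Balaban1983RegularityDecay, §2 p.575] -/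
def mBlock (k M₀ : ℕ) (x : Balaban1983to89.Site P j) : Finset (Balaban1983to89.Site P j) :=
  univ.filter fun y => ∀ μ, (y μ).val / half P k M₀ = (x μ).val / half P k M₀

/-- kernel: membership in an `M`-block. [cite: Balaban1983RegularityDecay, §2 p.575] -/
theorem mem_mBlock {x y : Balaban1983to89.Site P j} : y ∈ mBlock k M₀ x ↔ ∀ μ, (y μ).val / half P k M₀ = (x μ).val / half P k M₀ := by
  simp [mBlock]

/-- non-vacuity: a single large block is `M`-aligned. [cite: Balaban1983RegularityDecay, §2 p.575] -/
theorem isMAligned_mBlock (x : Balaban1983to89.Site P j) : IsMAligned k M₀ (mBlock k M₀ x) := by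
  intro x' hx' y hy
  rw [mem_mBlock] at hx' ⊢
  exact fun μ => (hy μ).trans (hx' μ)

/-- non-vacuity: the whole torus is `M`-aligned (gen 26's case `Ω = T`). [cite: Balaban1983RegularityDecay, §2 p.575] -/
theorem isMAligned_univ : IsMAligned k M₀ (univ : Finset (Balaban1983to89.Site P j)) := fun _ _ _ _ => mem_univ _

/-- unions of `M`-aligned regions are `M`-aligned («a sum of … large blocks»). [cite: Balaban1983RegularityDecay, §2 p.575] -/
theorem IsMAligned.union {Ω₁ Ω₂ : Finset (Balaban1983to89.Site P j)} (h₁ : IsMAligned k M₀ Ω₁) (h₂ : IsMAligned k M₀ Ω₂) :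
    IsMAligned k M₀ (Ω₁ ∪ Ω₂) := by
  intro x hx y hy
  rcases mem_union.1 hx with hx | hx
  · exact mem_union.2 (Or.inl (h₁ x hx y hy))
  · exact mem_union.2 (Or.inr (h₂ x hx y hy))

/-- **an `M`-aligned region is a union of `k`-blocks** (`L^k ∣ M`; standing range `j + k ≤ m + K`: `(x_k)_μ = ⌊x_μ/L^k⌋`), so the Neumann
propagator `G_k(Ω,u)` of record and gen 25's localization datum apply. [cite: Balaban1983RegularityDecay, §2 p.575] -/
theorem IsMAligned.isBlockUnion (hk : j + k ≤ P.m + P.K) {Ω : Finset (Balaban1983to89.Site P j)} (hΩ : IsMAligned k M₀ Ω) :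
    IsBlockUnion k Ω := by
  intro x hx y hy
  refine hΩ x hx y fun μ => ?_
  have h1 : (blkIter k y μ).val = (blkIter k x μ).val := by rw [mem_blockK.1 hy]
  rw [val_blkIter k hk y μ, val_blkIter k hk x μ] at h1
  unfold half
  rw [← Nat.div_div_eq_div_mul, ← Nat.div_div_eq_div_mul, h1]

/-! ### The one-dimensional factors of `h_i` across a grid hyperplane -/

/-- the `μ`-th factor `h_per(v/M − i_μ)` of `h_i` at a coordinate value `v`. [cite: Balaban1983RegularityDecay, (2.2) p.575] -/
def fac (k M₀ : ℕ) (i : Lab P j k M₀) (μ : Fin P.d) (v : ℕ) : ℝ :=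
  per3 hprof (nLab P j k M₀) (((v : ℕ) : ℝ) / half P k M₀ - ((i μ : ℕ) : ℝ))

/-- kernel: `h_i(x) = Π_μ fac_μ(x_μ)`. [cite: Balaban1983RegularityDecay, (2.2) p.575] -/
theorem hT_eq_prod_fac (i : Lab P j k M₀) (x : Balaban1983to89.Site P j) : hT k M₀ i x = ∏ μ, fac k M₀ i μ (x μ).val := rfl

/-- kernel: two sites differing only in coordinate `μ`, with equal `μ`-factors, carry the same value of `h_i`.
[cite: Balaban1983RegularityDecay, (2.2) p.575] -/
theorem hT_eq_of_coord (i : Lab P j k M₀) {x y : Balaban1983to89.Site P j} {μ : Fin P.d}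
    (hμ : fac k M₀ i μ (y μ).val = fac k M₀ i μ (x μ).val) (hne : ∀ ν, ν ≠ μ → y ν = x ν) : hT k M₀ i y = hT k M₀ i x := by
  rw [hT_eq_prod_fac, hT_eq_prod_fac]
  refine Finset.prod_congr rfl fun ν _ => ?_
  by_cases hν : ν = μ
  · subst hν; exact hμ
  · rw [hne ν hν]

/-- kernel: the periodised profile at an integer minus `1/M` equals its value at the integer (`M ≥ 3`): r01's profile does not see a
shift by `t ∈ [0, ⅜]` at the integers (`h = 1` on `[−⅜,⅜]`, `h = 0` off `]−⅝,⅝[`; r01's `B4Eq220PartitionSizes.hprof_int_sub_eq` on the B4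
side, re-derived locally to keep the import closure of this file inside the BIJ series). [cite: Balaban1983RegularityDecay, (2.2) p.575] -/
theorem per3_int_sub_inv_eq {Nn : ℕ} {M : ℝ} (hM : 3 ≤ M) (r : ℤ) : per3 hprof Nn ((r : ℝ) - 1 / M) = per3 hprof Nn r := by
  have hM0 : 0 < M := by linarith
  have ht0 : (0 : ℝ) ≤ 1 / M := by positivity
  have ht : 1 / M ≤ 3 / 8 := by rw [div_le_div_iff₀ hM0 (by norm_num)]; linarith
  have key : ∀ s : ℤ, hprof ((s : ℝ) - 1 / M) = hprof s := by
    intro s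
    by_cases hs : s = 0
    · subst hs
      rw [Int.cast_zero, zero_sub, hprof_eq_one (by rw [abs_neg, abs_of_nonneg ht0]; exact ht), hprof_eq_one (by norm_num)]
    · have h1 : (1 : ℝ) ≤ |(s : ℝ)| := by
        rw [← Int.cast_abs]; exact_mod_cast Int.one_le_abs hs
      rw [hprof_zero_of_one_le _ h1, hprof_eq_zero]
      have := abs_sub_abs_le_abs_sub (s : ℝ) (1 / M)
      rw [abs_of_nonneg ht0] at this
      linarith
  unfold per3
  have e1 : (r : ℝ) - 1 / M - Nn = ((r - Nn : ℤ) : ℝ) - 1 / M := by push_cast; ring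
  have e2 : (r : ℝ) - 1 / M + Nn = ((r + Nn : ℤ) : ℝ) - 1 / M := by push_cast; ring
  have e3 : (r : ℝ) - Nn = ((r - Nn : ℤ) : ℝ) := by push_cast; ring
  have e4 : (r : ℝ) + Nn = ((r + Nn : ℤ) : ℝ) := by push_cast; ring
  rw [e1, e2, e3, e4, key r, key, key]

/-- **THE `μ`-FACTOR OF `h_i` IS THE SAME ON BOTH SIDES OF A GRID HYPERPLANE**: if `M ∣ w + 1` then `fac_μ(w) = fac_μ((w+1) mod |T|)` — the
profile is flat (`= 1` or `= 0`) in a neighbourhood of every point of `Mℤ` («the normal derivative of h_j to the boundary of □_j is equal to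
0», p. 576; r01/p35's `B4Eq221HjRegion.hZ_add_e1_eq_of_dvd` on the `ℤ^d` carrier). [cite: Balaban1983RegularityDecay, (2.6) p.576] -/
theorem fac_eq_fac_succ_mod (hC : CubeSize P j k M₀) (i : Lab P j k M₀) (μ : Fin P.d) {w : ℕ} (hw : w < P.sitesPerDir j)
    (hdvd : half P k M₀ ∣ w + 1) : fac k M₀ i μ w = fac k M₀ i μ ((w + 1) % P.sitesPerDir j) := by
  obtain ⟨q, hq⟩ := hdvd
  have hh : 0 < half P k M₀ := hC.pos_half
  have hhR : (0 : ℝ) < half P k M₀ := by exact_mod_cast hh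
  have hM3 : (3 : ℝ) ≤ half P k M₀ := by exact_mod_cast (le_trans hC.three_le (Nat.le_mul_of_pos_left M₀ (pow_pos P.L_pos k)))
  have hS := nLab_mul_half hC
  have hN := hC.two_le
  unfold fac
  -- `w/M − i = (q − i) − 1/M`
  have ew : (((w : ℕ) : ℝ)) / half P k M₀ - ((i μ : ℕ) : ℝ) = (((q : ℤ) - (i μ : ℕ) : ℤ) : ℝ) - 1 / half P k M₀ := by
    have : ((w : ℕ) : ℝ) = (half P k M₀ : ℝ) * q - 1 := by
      have h1 : ((w + 1 : ℕ) : ℝ) = ((half P k M₀ * q : ℕ) : ℝ) := by rw [hq]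
      push_cast at h1; linarith
    rw [this]; push_cast; field_simp; ring
  rw [ew, per3_int_sub_inv_eq hM3]
  by_cases hqN : w + 1 < P.sitesPerDir j
  · -- no wrap: `(w+1)/M − i = q − i`
    rw [Nat.mod_eq_of_lt hqN, hq]
    congr 1; push_cast; field_simp
  · -- wrap: `w + 1 = |T|`, `q = N`, value at `0`: periodicity
    have hwS : w + 1 = P.sitesPerDir j := by omega
    rw [hwS, Nat.mod_self]
    have hqN' : q = nLab P j k M₀ := by
      have : half P k M₀ * q = half P k M₀ * nLab P j k M₀ := by rw [← hq, hwS, ← hS, Nat.mul_comm]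
      exact Nat.eq_of_mul_eq_mul_left hh this
    subst hqN'
    have hi := (i μ).isLt
    have e : ((((nLab P j k M₀ : ℕ) : ℤ) - (i μ : ℕ) : ℤ) : ℝ) = (-((i μ : ℕ) : ℝ)) + (nLab P j k M₀ : ℝ) := by push_cast; ring
    have hiR : ((i μ : ℕ) : ℝ) < nLab P j k M₀ := by exact_mod_cast hi
    have hi0 : (0 : ℝ) ≤ ((i μ : ℕ) : ℝ) := by positivity
    have hN2 : (2 : ℝ) ≤ nLab P j k M₀ := by exact_mod_cast hN
    rw [e, per3_hprof_add_period hN (by linarith) (by linarith)]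
    congr 1; push_cast; simp

/-! ### The cut-offs of [6]'s torus partition are flat across `∂(Ω ∩ □_i)` -/

/-- kernel: `(x + e_μ)_μ = x_μ + 1`. [folklore] -/
private theorem shift_apply_self (x : Balaban1983to89.Site P j) (μ : Fin P.d) : x.shift μ μ = x μ + 1 := by
  simp [Balaban1983to89.Site.shift]

/-- kernel: `(x + e_μ)_ν = x_ν` for `ν ≠ μ`. [folklore] -/
private theorem shift_apply_ne (x : Balaban1983to89.Site P j) {μ ν : Fin P.d} (h : ν ≠ μ) : x.shift μ ν = x ν := by
  simp [Balaban1983to89.Site.shift, Function.update_of_ne h]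

/-- `(x − e_μ) + e_μ = x`. [folklore] -/
private theorem shift_unshift (x : Balaban1983to89.Site P j) (μ : Fin P.d) : (x.unshift μ).shift μ = x :=
  (LatticeFieldCalculus.shiftEquiv (P := P) (j := j) μ).apply_symm_apply x

/-- `(x + e_μ) − e_μ = x`. [folklore] -/
private theorem unshift_shift (x : Balaban1983to89.Site P j) (μ : Fin P.d) : (x.shift μ).unshift μ = x :=
  (LatticeFieldCalculus.shiftEquiv (P := P) (j := j) μ).symm_apply_apply x

/-- kernel: the coordinate value of `x + e_μ` is `(x_μ + 1) mod |T|`. [folklore] -/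
private theorem val_shift (hC : CubeSize P j k M₀) (x : Balaban1983to89.Site P j) (μ : Fin P.d) :
    ((x.shift μ) μ).val = ((x μ).val + 1) % P.sitesPerDir j := by
  have h6 : 1 < P.sitesPerDir j := by
    have := hC.two_mul_half_le; have := hC.pos_half; omega
  haveI : Fact (1 < P.sitesPerDir j) := ⟨h6⟩
  rw [shift_apply_self, ZMod.val_add, ZMod.val_one]

/-- **`h_i` VANISHES FAR FROM THE CENTRE IN ONE COORDINATE**: if `x_μ = Mi_μ + z (mod |T|)` with `⌊⅝M⌋ < |z|` and `|z| + ⌊⅝M⌋ < |T|`, then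
`h_i(x) = 0` (support of `h_i`, file 1's `near_of_hT_ne_zero`). [cite: Balaban1983RegularityDecay, (2.2) p.575] -/
theorem hT_eq_zero_of_far (hC : CubeSize P j k M₀) {i : Lab P j k M₀} {x : Balaban1983to89.Site P j} {μ : Fin P.d} {z : ℤ}
    (hz : x μ = ((ctr k M₀ i μ + z : ℤ) : ZMod (P.sitesPerDir j))) (h1 : ((5 * half P k M₀ / 8 : ℕ) : ℤ) < |z|)
    (h2 : |z| + (5 * half P k M₀ / 8 : ℕ) < (P.sitesPerDir j : ℤ)) : hT k M₀ i x = 0 := by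
  by_contra h0
  obtain ⟨z', hz', e⟩ := near_of_hT_ne_zero hC h0 μ
  rw [Finset.mem_Icc] at hz'
  rw [hz, ZMod.intCast_eq_intCast_iff_dvd_sub] at e
  have e' : (P.sitesPerDir j : ℤ) ∣ z' - z := by convert e using 1; ring
  have habs : |z' - z| < (P.sitesPerDir j : ℤ) := by
    have := abs_sub (z' : ℤ) z
    have hz'abs : |z'| ≤ (5 * half P k M₀ / 8 : ℕ) := abs_le.2 ⟨hz'.1, hz'.2⟩
    linarith
  have h00 := Int.eq_zero_of_abs_lt_dvd e' habs
  have : z' = z := by linarith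
  subst this
  have hz'abs : |z'| ≤ (5 * half P k M₀ / 8 : ℕ) := abs_le.2 ⟨hz'.1, hz'.2⟩
  linarith

/-- **FLATNESS ACROSS THE BOUNDARY, FORWARD BOND**: for an `M`-aligned `Ω`, a site `x ∈ Ω ∩ □_i` and its neighbour `x + e_μ ∉ Ω ∩ □_i`,
`h_i(x + e_μ) = h_i(x)` — either the bond leaves the `2M`-window `□_i` (then both values vanish, `M − 1 > ⅝M`) or it crosses a face of the
grid `Mℤ`, where the profile is flat («the normal derivative of h_j to the boundary of □_j is equal to 0», p. 576).
[cite: Balaban1983RegularityDecay, (2.6) p.576] -/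
theorem hT_shift_eq_of_not_mem (hC : CubeSize P j k M₀) {Ω : Finset (Balaban1983to89.Site P j)} (hΩ : IsMAligned k M₀ Ω)
    (i : Lab P j k M₀) {x : Balaban1983to89.Site P j} {μ : Fin P.d} (hx : x ∈ Ω ∩ cube k M₀ i)
    (hy : x.shift μ ∉ Ω ∩ cube k M₀ i) : hT k M₀ i (x.shift μ) = hT k M₀ i x := by
  have hh : 0 < half P k M₀ := hC.pos_half
  have hM3 : 3 ≤ half P k M₀ := le_trans hC.three_le (Nat.le_mul_of_pos_left M₀ (pow_pos P.L_pos k))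
  have hS2 := hC.two_mul_half_le
  have hxΩ : x ∈ Ω := (mem_inter.1 hx).1
  have hxc : x ∈ cube k M₀ i := (mem_inter.1 hx).2
  have hval := val_shift hC x μ
  by_cases hyc : x.shift μ ∈ cube k M₀ i
  · -- the bond crosses a face of `Ω`: `M ∣ x_μ + 1`
    have hyΩ : x.shift μ ∉ Ω := fun h => hy (mem_inter.2 ⟨h, hyc⟩)
    have hlt : (x μ).val < P.sitesPerDir j := ZMod.val_lt _
    have hdvd : half P k M₀ ∣ (x μ).val + 1 := by
      by_cases hwrap : (x μ).val + 1 < P.sitesPerDir j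
      · by_contra hnd
        apply hyΩ (hΩ x hxΩ (x.shift μ) fun ν => ?_)
        by_cases hν : ν = μ
        · subst hν
          rw [hval, Nat.mod_eq_of_lt hwrap, Nat.succ_div, if_neg hnd, add_zero]
        · rw [shift_apply_ne x hν]
      · have : (x μ).val + 1 = P.sitesPerDir j := by omega
        rw [this]; exact hC.dvd
    refine hT_eq_of_coord i ?_ fun ν hν => shift_apply_ne x hν
    rw [hval]
    exact (fac_eq_fac_succ_mod hC i μ hlt hdvd).symm
  · -- the bond leaves the window: both ends are outside `supp h_i`
    obtain ⟨z, hz, ex⟩ := (mem_cube.1 hxc) μ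
    rw [Finset.mem_Ico] at hz
    -- `z = M − 1`
    have hzM : z = (half P k M₀ : ℤ) - 1 := by
      by_contra hne
      apply hyc
      rw [mem_cube]
      intro ν
      by_cases hν : ν = μ
      · subst hν
        refine ⟨z + 1, by rw [Finset.mem_Ico]; constructor <;> omega, ?_⟩
        rw [shift_apply_self, ex]; push_cast; ring
      · rw [shift_apply_ne x hν]; exact (mem_cube.1 hxc) ν
    have hr : 5 * half P k M₀ / 8 ≤ half P k M₀ - 2 := by omega
    have h1 : hT k M₀ i x = 0 := by
      refine hT_eq_zero_of_far hC ex ?_ ?_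
      · rw [hzM, abs_of_nonneg (by omega)]; push_cast; omega
      · rw [hzM, abs_of_nonneg (by omega)]; push_cast; omega
    have h2 : hT k M₀ i (x.shift μ) = 0 := by
      refine hT_eq_zero_of_far hC (z := z + 1) (μ := μ) ?_ ?_ ?_
      · rw [shift_apply_self, ex]; push_cast; ring
      · rw [hzM]; rw [abs_of_nonneg (by omega)]; push_cast; omega
      · rw [hzM]; rw [abs_of_nonneg (by omega)]; push_cast; omega
    rw [h1, h2]

/-- **FLATNESS ACROSS THE BOUNDARY, BACKWARD BOND**: `x ∈ Ω ∩ □_i`, `x − e_μ ∉ Ω ∩ □_i ⇒ h_i(x − e_μ) = h_i(x)`.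
[cite: Balaban1983RegularityDecay, (2.6) p.576] -/
theorem hT_unshift_eq_of_not_mem (hC : CubeSize P j k M₀) {Ω : Finset (Balaban1983to89.Site P j)} (hΩ : IsMAligned k M₀ Ω)
    (i : Lab P j k M₀) {x : Balaban1983to89.Site P j} {μ : Fin P.d} (hx : x ∈ Ω ∩ cube k M₀ i)
    (hy : x.unshift μ ∉ Ω ∩ cube k M₀ i) : hT k M₀ i (x.unshift μ) = hT k M₀ i x := by
  have hh : 0 < half P k M₀ := hC.pos_half
  have hM3 : 3 ≤ half P k M₀ := le_trans hC.three_le (Nat.le_mul_of_pos_left M₀ (pow_pos P.L_pos k))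
  have hS2 := hC.two_mul_half_le
  have hxΩ : x ∈ Ω := (mem_inter.1 hx).1
  have hxc : x ∈ cube k M₀ i := (mem_inter.1 hx).2
  set y := x.unshift μ with hydef
  have hxy : y.shift μ = x := shift_unshift x μ
  have hval : (x μ).val = ((y μ).val + 1) % P.sitesPerDir j := by rw [← val_shift hC y μ, hxy]
  have hyν : ∀ ν, ν ≠ μ → y ν = x ν := fun ν hν => by rw [← hxy, shift_apply_ne y hν]
  by_cases hyc : y ∈ cube k M₀ i
  · have hyΩ : y ∉ Ω := fun h => hy (mem_inter.2 ⟨h, hyc⟩)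
    have hlt : (y μ).val < P.sitesPerDir j := ZMod.val_lt _
    have hdvd : half P k M₀ ∣ (y μ).val + 1 := by
      by_cases hwrap : (y μ).val + 1 < P.sitesPerDir j
      · by_contra hnd
        apply hyΩ (hΩ x hxΩ y fun ν => ?_)
        by_cases hν : ν = μ
        · subst hν
          rw [hval, Nat.mod_eq_of_lt hwrap, Nat.succ_div, if_neg hnd, add_zero]
        · rw [hyν ν hν]
      · have : (y μ).val + 1 = P.sitesPerDir j := by omega
        rw [this]; exact hC.dvd
    refine hT_eq_of_coord i ?_ hyν
    rw [hval]
    exact fac_eq_fac_succ_mod hC i μ hlt hdvd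
  · obtain ⟨z, hz, ex⟩ := (mem_cube.1 hxc) μ
    rw [Finset.mem_Ico] at hz
    have hyμ : y μ = ((ctr k M₀ i μ + (z - 1) : ℤ) : ZMod (P.sitesPerDir j)) := by
      have : y μ = x μ - 1 := by simp [hydef, Balaban1983to89.Site.unshift]
      rw [this, ex]; push_cast; ring
    -- `z = −M`
    have hzM : z = -(half P k M₀ : ℤ) := by
      by_contra hne
      apply hyc
      rw [mem_cube]
      intro ν
      by_cases hν : ν = μ
      · subst hν
        exact ⟨z - 1, by rw [Finset.mem_Ico]; constructor <;> omega, hyμ⟩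
      · rw [hyν ν hν]; exact (mem_cube.1 hxc) ν
    have hr : 5 * half P k M₀ / 8 ≤ half P k M₀ - 2 := by omega
    have h1 : hT k M₀ i x = 0 := by
      refine hT_eq_zero_of_far hC ex ?_ ?_
      · rw [hzM, abs_neg, abs_of_nonneg (by omega)]; push_cast; omega
      · rw [hzM, abs_neg, abs_of_nonneg (by omega)]; push_cast; omega
    have h2 : hT k M₀ i y = 0 := by
      refine hT_eq_zero_of_far hC hyμ ?_ ?_
      · rw [hzM, show -(half P k M₀ : ℤ) - 1 = -((half P k M₀ : ℤ) + 1) by ring, abs_neg, abs_of_nonneg (by omega)]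
        push_cast; omega
      · rw [hzM, show -(half P k M₀ : ℤ) - 1 = -((half P k M₀ : ℤ) + 1) by ring, abs_neg, abs_of_nonneg (by omega)]
        push_cast; omega
    rw [h1, h2]

/-! ### Consequence for the Laplacian term of (2.10) on `Ω ∩ □_i` -/

/-- kernel: off `Q` the Laplacian term has no bonds. [cite: Balaban1983RegularityDecay, (2.10) p.576] -/
theorem lapNh_eq_zero_of_not_mem (c : ℝ) {Q : Finset (Balaban1983to89.Site P j)} (h : Balaban1983to89.Site P j → ℝ)
    {x : Balaban1983to89.Site P j} (hx : x ∉ Q) : lapNh c Q h x = 0 := by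
  unfold lapNh
  rw [Finset.sum_eq_zero fun μ _ => ?_, mul_zero]
  have h1 : (⟨x, μ⟩ : PBond P j) ∉ starB Q := fun hb => hx ((mem_starB _ _).1 hb).1
  have h2 : (⟨x.unshift μ, μ⟩ : PBond P j) ∉ starB Q := fun hb => hx (by
    have := ((mem_starB _ _).1 hb).2
    rwa [show (⟨x.unshift μ, μ⟩ : PBond P j).tgt = x from shift_unshift x μ] at this)
  rw [if_neg h1, if_neg h2, add_zero]

/-- **THE NEUMANN LAPLACIAN OF `h_i` ON `Ω ∩ □_i` IS ITS FULL LAPLACIAN** for an `M`-aligned `Ω`: at every `x ∈ Ω ∩ □_i`,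
`(Δ^{η,N}_{Ω∩□_i}h_i)(x) = c²Σ_μ (h_i(x+e_μ) − 2h_i(x) + h_i(x−e_μ))` — the missing bonds carry a vanishing difference of `h_i` (print (2.10)
writes the full `Δ^ηh_j`, having used «the normal derivative of h_j to the boundary of □_j is equal to 0»; r01/p35's
`B4Eq221HjRegion.neumann_sum_hZ_region_eq` on the `ℤ^d` carrier). [cite: Balaban1983RegularityDecay, (2.10) p.576] -/
theorem lapNh_inter_cube_eq (hC : CubeSize P j k M₀) {Ω : Finset (Balaban1983to89.Site P j)} (hΩ : IsMAligned k M₀ Ω) (c : ℝ)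
    (i : Lab P j k M₀) {x : Balaban1983to89.Site P j} (hx : x ∈ Ω ∩ cube k M₀ i) :
    lapNh c (Ω ∩ cube k M₀ i) (hT k M₀ i) x
      = c ^ 2 * ∑ μ : Fin P.d, (hT k M₀ i (x.shift μ) - 2 * hT k M₀ i x + hT k M₀ i (x.unshift μ)) := by
  unfold lapNh
  congr 1
  refine Finset.sum_congr rfl fun μ _ => ?_
  have e1 : (if (⟨x, μ⟩ : PBond P j) ∈ starB (Ω ∩ cube k M₀ i) then hT k M₀ i (x.shift μ) - hT k M₀ i x else 0)
      = hT k M₀ i (x.shift μ) - hT k M₀ i x := by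
    split_ifs with hb
    · rfl
    · have hy : x.shift μ ∉ Ω ∩ cube k M₀ i := fun hy => hb ((mem_starB _ _).2 ⟨hx, hy⟩)
      rw [hT_shift_eq_of_not_mem hC hΩ i hx hy, sub_self]
  have e2 : (if (⟨x.unshift μ, μ⟩ : PBond P j) ∈ starB (Ω ∩ cube k M₀ i) then hT k M₀ i (x.unshift μ) - hT k M₀ i x else 0)
      = hT k M₀ i (x.unshift μ) - hT k M₀ i x := by
    split_ifs with hb
    · rfl
    · have hy : x.unshift μ ∉ Ω ∩ cube k M₀ i := fun hy => hb ((mem_starB _ _).2 ⟨hy, by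
        rw [show (⟨x.unshift μ, μ⟩ : PBond P j).tgt = x from shift_unshift x μ]; exact hx⟩)
      rw [hT_unshift_eq_of_not_mem hC hΩ i hx hy, sub_self]
  rw [e1, e2]; ring

/-- **`|Δ^{η,N}_{Ω∩□_i}h_i| ≤ c²·d·3sup|h″|/M²` AT EVERY ROW** — the printed «|Δ^ηh_j| ≦ O(M⁻²)» for the Neumann-cut Laplacian of (2.10) on
an `M`-aligned region (gen 26's `abs_hT_second_diff_le` per direction; rows off `Ω ∩ □_i` carry `0`).
[cite: Balaban1983RegularityDecay, (2.12) p.577] -/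
theorem abs_lapNh_inter_cube_le (hC : CubeSize P j k M₀) {Ω : Finset (Balaban1983to89.Site P j)} (hΩ : IsMAligned k M₀ Ω) (c : ℝ)
    (i : Lab P j k M₀) (x : Balaban1983to89.Site P j) :
    |lapNh c (Ω ∩ cube k M₀ i) (hT k M₀ i) x| ≤ c ^ 2 * (P.d * (3 * D2 hprof / (half P k M₀ : ℝ) ^ 2)) := by
  have hD2 : 0 ≤ D2 hprof := D2_nonneg contDiff_hprof hasCompactSupport_hprof
  by_cases hx : x ∈ Ω ∩ cube k M₀ i
  · rw [lapNh_inter_cube_eq hC hΩ c i hx, abs_mul, abs_of_nonneg (sq_nonneg c)]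
    refine mul_le_mul_of_nonneg_left ((Finset.abs_sum_le_sum_abs _ _).trans ?_) (sq_nonneg c)
    calc ∑ μ : Fin P.d, |hT k M₀ i (x.shift μ) - 2 * hT k M₀ i x + hT k M₀ i (x.unshift μ)|
        ≤ ∑ _μ : Fin P.d, 3 * D2 hprof / (half P k M₀ : ℝ) ^ 2 := Finset.sum_le_sum fun μ _ => abs_hT_second_diff_le hC i x μ
      _ = P.d * (3 * D2 hprof / (half P k M₀ : ℝ) ^ 2) := by rw [Finset.sum_const, Finset.card_univ, Fintype.card_fin, nsmul_eq_mul]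
  · rw [lapNh_eq_zero_of_not_mem c _ hx, abs_zero]; positivity

end Aligned

/-! ## §3 THE `L²` SIZES OF THE THREE TERMS OF (2.10) (file 2's `kLet_mulVec`): gradient term against the energy `Σ_{Q*}|D_uφ|²`, Laplacian and
block terms against `‖φ‖₂` -/

section Terms

variable {k : ℕ}

/-- kernel: `|z + w|² ≤ 2|z|² + 2|w|²`. [folklore] -/
private theorem norm_add_sq_le_two (z w : ℂ) : ‖z + w‖ ^ 2 ≤ 2 * ‖z‖ ^ 2 + 2 * ‖w‖ ^ 2 := by
  have h1 : ‖z + w‖ ^ 2 ≤ (‖z‖ + ‖w‖) ^ 2 := pow_le_pow_left₀ (norm_nonneg _) (norm_add_le z w) 2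
  nlinarith [sq_nonneg (‖z‖ - ‖w‖)]

/-- kernel: `|u_b| = 1`. [cite: BalabanImbrieJaffe1988, (1.1) p.258] -/
private theorem norm_cfg (U : GaugeField P j U1) (b : PBond P j) : ‖cfg U b‖ = 1 := by
  unfold cfg; exact norm_toC _

/-- kernel: summing a bond function over the sites and directions is summing over the bonds `b = ⟨x, μ⟩`. [folklore] -/
private theorem sum_sum_ite_bond_eq (S : Finset (PBond P j)) (g : PBond P j → ℝ) :
    ∑ x : Balaban1983to89.Site P j, ∑ μ : Fin P.d, (if (⟨x, μ⟩ : PBond P j) ∈ S then g ⟨x, μ⟩ else 0) = ∑ b ∈ S, g b := by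
  classical
  have h1 : (∑ b : PBond P j, if b ∈ S then g b else 0) = ∑ b ∈ S, g b := by
    rw [← Finset.sum_filter]; congr 1; ext b; simp
  rw [← h1, ← Fintype.sum_prod_type' (f := fun (x : Balaban1983to89.Site P j) (μ : Fin P.d) =>
    if (⟨x, μ⟩ : PBond P j) ∈ S then g ⟨x, μ⟩ else 0)]
  exact Fintype.sum_equiv ⟨fun p => ⟨p.1, p.2⟩, fun b => (b.src, b.dir), fun _ => rfl, fun _ => rfl⟩ _ _ fun _ => rfl

/-- kernel: re-indexing a site sum by `x ↦ x − e_μ`. [folklore] -/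
private theorem sum_unshift_eq (μ : Fin P.d) (G : Balaban1983to89.Site P j → ℝ) :
    ∑ x : Balaban1983to89.Site P j, G (x.unshift μ) = ∑ x, G x :=
  Equiv.sum_comp (LatticeFieldCalculus.shiftEquiv (P := P) (j := j) μ).symm G

/-- kernel: **summing a function over the `k`-block of every site counts it `L^{kd}` times** (`Σ_x Σ_{x′∈B^k(x_k)} g(x′) = L^{kd}·Σ_{x′} g(x′)`).
[cite: BalabanImbrieJaffe1985, (5.1.2)–(5.1.3) p.313] -/
theorem sum_sum_blockK_eq (hk : j + k ≤ P.m + P.K) (g : Balaban1983to89.Site P j → ℝ) :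
    ∑ x : Balaban1983to89.Site P j, ∑ x' ∈ blockK k (blkIter k x), g x' = (P.L : ℝ) ^ (k * P.d) * ∑ x', g x' := by
  classical
  have h1 : ∀ x : Balaban1983to89.Site P j, ∑ x' ∈ blockK k (blkIter k x), g x' = ∑ x', (if blkIter k x' = blkIter k x then g x' else 0) := by
    intro x
    rw [← Finset.sum_filter]
    rfl
  simp_rw [h1]
  rw [Finset.sum_comm, Finset.mul_sum]
  refine Finset.sum_congr rfl fun x' _ => ?_
  have h2 : ∑ x : Balaban1983to89.Site P j, (if blkIter k x' = blkIter k x then g x' else 0)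
      = ∑ x ∈ blockK k (blkIter k x'), g x' := by
    rw [← Finset.sum_filter]
    refine Finset.sum_congr ?_ fun _ _ => rfl
    ext x; simp [mem_blockK, eq_comm]
  rw [h2, Finset.sum_const, card_blockK k hk, nsmul_eq_mul]; push_cast; ring

/-- **THE GRADIENT TERM IN `L²`: `‖Σ_{b∈st(x),b⊂Q}(∂^ηh)(b)(D_uφ)(b)‖₂ ≤ 2d|c|δ₁·(Σ_{b∈Q*}|(D_uφ)(b)|²)^{1/2}`** when
`|h(x±e_μ) − h(x)| ≤ δ₁` — only the bonds of `Q*` enter (each at its two ends), so the ENERGY of `φ` on `Q` controls it; the «|∂^ηh_j| ≦ O(M⁻¹)»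
entry of p. 577 in the `L₂`-norm. [cite: Balaban1983RegularityDecay, (2.15) p.577] -/
theorem l2n_gradTerm_le (c : ℝ) (U : GaugeField P j U1) (Q : Finset (Balaban1983to89.Site P j)) (h : Balaban1983to89.Site P j → ℝ)
    {δ₁ : ℝ} (hδ₁ : 0 ≤ δ₁) (hh : ∀ x μ, |h (x.shift μ) - h x| ≤ δ₁ ∧ |h (x.unshift μ) - h x| ≤ δ₁) (φ : Balaban1983to89.Site P j → ℂ) :
    l2n (gradTerm c U Q h φ) ≤ 2 * P.d * |c| * δ₁ * Real.sqrt (∑ b ∈ starB Q, ‖covD c (cfg U) φ b‖ ^ 2) := by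
  classical
  set E : ℝ := ∑ b ∈ starB Q, ‖covD c (cfg U) φ b‖ ^ 2 with hE
  have hE0 : 0 ≤ E := Finset.sum_nonneg fun _ _ => sq_nonneg _
  -- the two bond families of (2.10), squared, against the energy density
  set F : Fin P.d → Balaban1983to89.Site P j → ℂ := fun μ x =>
    if (⟨x, μ⟩ : PBond P j) ∈ starB Q then (c : ℂ) * ((h (x.shift μ) : ℂ) - h x) * covD c (cfg U) φ ⟨x, μ⟩ else 0 with hF
  set B : Fin P.d → Balaban1983to89.Site P j → ℂ := fun μ x =>
    if (⟨x.unshift μ, μ⟩ : PBond P j) ∈ starB Q then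
      (c : ℂ) * ((h (x.unshift μ) : ℂ) - h x) * (-(starRingEnd ℂ) (cfg U ⟨x.unshift μ, μ⟩) * covD c (cfg U) φ ⟨x.unshift μ, μ⟩) else 0 with hB
  have hgrad : ∀ x, gradTerm c U Q h φ x = ∑ μ, (F μ x + B μ x) := fun x => rfl
  have hFb : ∀ μ x, ‖F μ x‖ ^ 2 ≤ c ^ 2 * δ₁ ^ 2 * (if (⟨x, μ⟩ : PBond P j) ∈ starB Q then ‖covD c (cfg U) φ ⟨x, μ⟩‖ ^ 2 else 0) := by
    intro μ x
    simp only [hF]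
    split_ifs with hb
    · rw [norm_mul, norm_mul, Complex.norm_real, Real.norm_eq_abs, ← Complex.ofReal_sub, Complex.norm_real, Real.norm_eq_abs, mul_pow, mul_pow,
        sq_abs]
      exact mul_le_mul_of_nonneg_right (mul_le_mul_of_nonneg_left (pow_le_pow_left₀ (abs_nonneg _) (hh x μ).1 2) (sq_nonneg c)) (sq_nonneg _)
    · simp
  have hBb : ∀ μ x, ‖B μ x‖ ^ 2 ≤ c ^ 2 * δ₁ ^ 2 *
      (if (⟨x.unshift μ, μ⟩ : PBond P j) ∈ starB Q then ‖covD c (cfg U) φ ⟨x.unshift μ, μ⟩‖ ^ 2 else 0) := by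
    intro μ x
    simp only [hB]
    split_ifs with hb
    · rw [norm_mul, norm_mul, norm_mul, norm_neg, Complex.norm_conj, norm_cfg, one_mul, Complex.norm_real, Real.norm_eq_abs,
        ← Complex.ofReal_sub, Complex.norm_real, Real.norm_eq_abs, mul_pow, mul_pow, sq_abs]
      exact mul_le_mul_of_nonneg_right (mul_le_mul_of_nonneg_left (pow_le_pow_left₀ (abs_nonneg _) (hh x μ).2 2) (sq_nonneg c)) (sq_nonneg _)
    · simp
  -- pointwise: `|grad(x)|² ≤ 2d Σ_μ (|F_μ(x)|² + |B_μ(x)|²)`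
  have hpt : ∀ x, ‖gradTerm c U Q h φ x‖ ^ 2 ≤ 2 * P.d * ∑ μ, (‖F μ x‖ ^ 2 + ‖B μ x‖ ^ 2) := by
    intro x
    rw [hgrad x]
    calc ‖∑ μ, (F μ x + B μ x)‖ ^ 2 ≤ (univ : Finset (Fin P.d)).card * ∑ μ, ‖F μ x + B μ x‖ ^ 2 := norm_sum_sq_le_card_mul _ _
      _ ≤ P.d * ∑ μ, (2 * ‖F μ x‖ ^ 2 + 2 * ‖B μ x‖ ^ 2) := by
          rw [Finset.card_univ, Fintype.card_fin]
          exact mul_le_mul_of_nonneg_left (Finset.sum_le_sum fun μ _ => norm_add_sq_le_two _ _) (Nat.cast_nonneg _)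
      _ = 2 * P.d * ∑ μ, (‖F μ x‖ ^ 2 + ‖B μ x‖ ^ 2) := by
          rw [Finset.mul_sum, Finset.mul_sum]; exact Finset.sum_congr rfl fun μ _ => by ring
  -- the two bond sums are the energy
  have hsumF : ∑ x, ∑ μ, ‖F μ x‖ ^ 2 ≤ c ^ 2 * δ₁ ^ 2 * E := by
    calc ∑ x, ∑ μ, ‖F μ x‖ ^ 2
        ≤ ∑ x : Balaban1983to89.Site P j, ∑ μ : Fin P.d, c ^ 2 * δ₁ ^ 2 *
            (if (⟨x, μ⟩ : PBond P j) ∈ starB Q then ‖covD c (cfg U) φ ⟨x, μ⟩‖ ^ 2 else 0) :=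
          Finset.sum_le_sum fun x _ => Finset.sum_le_sum fun μ _ => hFb μ x
      _ = c ^ 2 * δ₁ ^ 2 * E := by
          simp_rw [← Finset.mul_sum]
          rw [hE, sum_sum_ite_bond_eq (starB Q) fun b => ‖covD c (cfg U) φ b‖ ^ 2]
  have hsumB : ∑ x, ∑ μ, ‖B μ x‖ ^ 2 ≤ c ^ 2 * δ₁ ^ 2 * E := by
    calc ∑ x, ∑ μ, ‖B μ x‖ ^ 2
        ≤ ∑ x : Balaban1983to89.Site P j, ∑ μ : Fin P.d, c ^ 2 * δ₁ ^ 2 *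
            (if (⟨x.unshift μ, μ⟩ : PBond P j) ∈ starB Q then ‖covD c (cfg U) φ ⟨x.unshift μ, μ⟩‖ ^ 2 else 0) :=
          Finset.sum_le_sum fun x _ => Finset.sum_le_sum fun μ _ => hBb μ x
      _ = c ^ 2 * δ₁ ^ 2 * ∑ x : Balaban1983to89.Site P j, ∑ μ : Fin P.d,
            (if (⟨x, μ⟩ : PBond P j) ∈ starB Q then ‖covD c (cfg U) φ ⟨x, μ⟩‖ ^ 2 else 0) := by
          simp_rw [← Finset.mul_sum]
          congr 1
          rw [Finset.sum_comm]
          conv_rhs => rw [Finset.sum_comm]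
          exact Finset.sum_congr rfl fun μ _ => sum_unshift_eq μ fun x =>
            if (⟨x, μ⟩ : PBond P j) ∈ starB Q then ‖covD c (cfg U) φ ⟨x, μ⟩‖ ^ 2 else 0
      _ = c ^ 2 * δ₁ ^ 2 * E := by rw [hE, sum_sum_ite_bond_eq (starB Q) fun b => ‖covD c (cfg U) φ b‖ ^ 2]
  -- assemble: `‖grad‖₂² ≤ 4d c²δ₁² E ≤ (2d|c|δ₁√E)²`
  have hsq : ∑ x, ‖gradTerm c U Q h φ x‖ ^ 2 ≤ 4 * P.d * (c ^ 2 * δ₁ ^ 2 * E) := by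
    calc ∑ x, ‖gradTerm c U Q h φ x‖ ^ 2 ≤ ∑ x, 2 * P.d * ∑ μ, (‖F μ x‖ ^ 2 + ‖B μ x‖ ^ 2) := Finset.sum_le_sum fun x _ => hpt x
      _ = 2 * P.d * (∑ x, ∑ μ, ‖F μ x‖ ^ 2 + ∑ x, ∑ μ, ‖B μ x‖ ^ 2) := by
          rw [← Finset.mul_sum, ← Finset.sum_add_distrib]
          congr 1; exact Finset.sum_congr rfl fun x _ => Finset.sum_add_distrib
      _ ≤ 2 * P.d * (c ^ 2 * δ₁ ^ 2 * E + c ^ 2 * δ₁ ^ 2 * E) := mul_le_mul_of_nonneg_left (add_le_add hsumF hsumB) (by positivity)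
      _ = 4 * P.d * (c ^ 2 * δ₁ ^ 2 * E) := by ring
  have hd1 : (1 : ℝ) ≤ P.d := by exact_mod_cast P.hd
  have hfin : l2n (gradTerm c U Q h φ) ^ 2 ≤ (2 * P.d * |c| * δ₁ * Real.sqrt E) ^ 2 := by
    rw [l2n_sq]
    refine hsq.trans ?_
    have hX : 0 ≤ c ^ 2 * δ₁ ^ 2 * E := by positivity
    have hd2 : (P.d : ℝ) ≤ (P.d : ℝ) ^ 2 := by nlinarith
    calc 4 * P.d * (c ^ 2 * δ₁ ^ 2 * E) ≤ 4 * (P.d : ℝ) ^ 2 * (c ^ 2 * δ₁ ^ 2 * E) := by nlinarith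
      _ = (2 * P.d * |c| * δ₁ * Real.sqrt E) ^ 2 := by
          rw [mul_pow, mul_pow, mul_pow, mul_pow, Real.sq_sqrt hE0, sq_abs]; ring
  exact (abs_le_of_sq_le_sq' hfin (by positivity)).2

/-- **THE LAPLACIAN TERM IN `L²`**: `‖(Δ^{η,N}_Qh)·φ‖₂ ≤ Λ‖φ‖₂` when `|(Δ^{η,N}_Qh)(x)| ≤ Λ` at every row — the «|Δ^ηh_j| ≦ O(M⁻²)» entry of
p. 577 in the `L₂`-norm. [cite: Balaban1983RegularityDecay, (2.15) p.577] -/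
theorem l2n_lapNh_mul_le (c : ℝ) (Q : Finset (Balaban1983to89.Site P j)) (h : Balaban1983to89.Site P j → ℝ) {Λ : ℝ} (hΛ : 0 ≤ Λ)
    (hlap : ∀ x, |lapNh c Q h x| ≤ Λ) (φ : Balaban1983to89.Site P j → ℂ) :
    l2n (fun x => (lapNh c Q h x : ℂ) * φ x) ≤ Λ * l2n φ :=
  l2n_le_of_pointwise hΛ fun x => by
    rw [norm_mul, Complex.norm_real, Real.norm_eq_abs]
    exact mul_le_mul_of_nonneg_right (hlap x) (norm_nonneg _)

/-- **THE BLOCK TERM IN `L²`**: `‖blockTerm φ‖₂ ≤ |a|·δ₃·L^{−kd}·‖φ‖₂` when the oscillation of `h` over every `k`-block is `≤ δ₃` (the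
(2.8) term `a_kL^{−2kd}conj(u(Γ))Σ_{x′∈B^k(x_k)}u(Γ′)(h(x′) − h(x))φ(x′)`: Cauchy–Schwarz over the `L^{kd}` sites of the block, each site
counted `L^{kd}` times). [cite: Balaban1983RegularityDecay, (2.8) p.576] -/
theorem l2n_blockTerm_le (hk : j + k ≤ P.m + P.K) (U : GaugeField P j U1) (Q : Finset (Balaban1983to89.Site P j))
    (h : Balaban1983to89.Site P j → ℝ) (a : ℝ) {δ₃ : ℝ} (hδ₃ : 0 ≤ δ₃)
    (hh : ∀ x, ∀ x' ∈ blockK k (blkIter k x), |h x' - h x| ≤ δ₃) (φ : Balaban1983to89.Site P j → ℂ) :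
    l2n (blockTerm U Q h a k φ) ≤ |a| * δ₃ * ((P.L : ℝ) ^ (k * P.d))⁻¹ * l2n φ := by
  classical
  set N : ℝ := (P.L : ℝ) ^ (k * P.d) with hN
  have hNpos : 0 < N := pow_pos P.cast_L_pos _
  -- pointwise: `|block(x)| ≤ |a|N⁻²δ₃ Σ_{x′∈B(x)}|φ(x′)|`
  have hpt : ∀ x, ‖blockTerm U Q h a k φ x‖ ≤ |a| * (N⁻¹ * N⁻¹) * δ₃ * ∑ x' ∈ blockK k (blkIter k x), ‖φ x'‖ := by
    intro x
    refine (norm_blockTerm_le U Q h a k φ x).trans ?_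
    rw [mul_assoc (|a| * (N⁻¹ * N⁻¹)), Finset.mul_sum (s := blockK k (blkIter k x)) (f := fun x' => ‖φ x'‖) δ₃]
    exact mul_le_mul_of_nonneg_left (Finset.sum_le_sum fun x' hx' => mul_le_mul_of_nonneg_right (hh x x' hx') (norm_nonneg _))
      (by positivity)
  -- square with Cauchy–Schwarz over the block (`L^{kd}` sites)
  have hsq : ∀ x, ‖blockTerm U Q h a k φ x‖ ^ 2
      ≤ (|a| * (N⁻¹ * N⁻¹) * δ₃) ^ 2 * (N * ∑ x' ∈ blockK k (blkIter k x), ‖φ x'‖ ^ 2) := by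
    intro x
    calc ‖blockTerm U Q h a k φ x‖ ^ 2 ≤ (|a| * (N⁻¹ * N⁻¹) * δ₃ * ∑ x' ∈ blockK k (blkIter k x), ‖φ x'‖) ^ 2 :=
          pow_le_pow_left₀ (norm_nonneg _) (hpt x) 2
      _ = (|a| * (N⁻¹ * N⁻¹) * δ₃) ^ 2 * (∑ x' ∈ blockK k (blkIter k x), ‖φ x'‖) ^ 2 := by ring
      _ ≤ (|a| * (N⁻¹ * N⁻¹) * δ₃) ^ 2 * (N * ∑ x' ∈ blockK k (blkIter k x), ‖φ x'‖ ^ 2) := by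
          refine mul_le_mul_of_nonneg_left ?_ (sq_nonneg _)
          have hcs := sq_sum_le_card_mul_sum_sq (s := blockK k (blkIter k x)) (f := fun x' => ‖φ x'‖)
          rw [card_blockK k hk] at hcs
          push_cast at hcs
          exact hcs
  refine l2n_le_of_sq_le (by positivity) ?_
  calc ∑ x, ‖blockTerm U Q h a k φ x‖ ^ 2
      ≤ ∑ x, (|a| * (N⁻¹ * N⁻¹) * δ₃) ^ 2 * (N * ∑ x' ∈ blockK k (blkIter k x), ‖φ x'‖ ^ 2) := Finset.sum_le_sum fun x _ => hsq x
    _ = (|a| * (N⁻¹ * N⁻¹) * δ₃) ^ 2 * (N * (N * ∑ x', ‖φ x'‖ ^ 2)) := by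
        rw [← Finset.mul_sum, ← Finset.mul_sum, sum_sum_blockK_eq hk]
    _ = (|a| * δ₃ * N⁻¹) ^ 2 * ∑ x', ‖φ x'‖ ^ 2 := by field_simp

end Terms

/-! ## §4 THE `‖·‖_{2,2}` LETTER BOUND: `‖K_iG_k(Q_i,u)‖_{2→2}` from the sizes of `h_i` and Lemma 2.1 — generic, then for [6]'s torus cubes with
`Q_i = Ω ∩ □_i`, `Ω` `M`-aligned: `≤ C(d, a)/M₀`, UNIFORMLY IN `k` -/

section Letter

variable {k M₀ : ℕ}

/-- **(2.10) IN THE `L₂`-NORM, GENERIC**: for a cut-off `h_i` with `|h_i(x±e_μ) − h_i(x)| ≤ δ₁`, `|(Δ^{η,N}_{Q_i}h_i)(x)| ≤ Λ` and block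
oscillation `≤ δ₃`, and every field `φ`,
`‖K_iφ‖₂ ≤ 2d|c|δ₁(Σ_{b∈Q_i*}|(D_uφ)(b)|²)^{1/2} + (Λ + |a|δ₃L^{−kd})‖φ‖₂` (file 2's three-term form `kLet_mulVec`).
[cite: Balaban1983RegularityDecay, (2.10) p.576] -/
theorem l2n_kLet_mulVec_le {J : Type*} (hk : j + k ≤ P.m + P.K) (a c : ℝ) (U : GaugeField P j U1) (Q : J → Finset (Balaban1983to89.Site P j))
    (h : J → Balaban1983to89.Site P j → ℝ) (i : J) {δ₁ Λ δ₃ : ℝ} (hδ₁ : 0 ≤ δ₁) (hΛ : 0 ≤ Λ) (hδ₃ : 0 ≤ δ₃)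
    (h1 : ∀ x μ, |h i (x.shift μ) - h i x| ≤ δ₁ ∧ |h i (x.unshift μ) - h i x| ≤ δ₁) (h2 : ∀ x, |lapNh c (Q i) (h i) x| ≤ Λ)
    (h3 : ∀ x, ∀ x' ∈ blockK k (blkIter k x), |h i x' - h i x| ≤ δ₃) (φ : Balaban1983to89.Site P j → ℂ) :
    l2n (kLet a c U k Q h i *ᵥ φ)
      ≤ 2 * P.d * |c| * δ₁ * Real.sqrt (∑ b ∈ starB (Q i), ‖covD c (cfg U) φ b‖ ^ 2) + (Λ + |a| * δ₃ * ((P.L : ℝ) ^ (k * P.d))⁻¹) * l2n φ := by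
  have e : kLet a c U k Q h i *ᵥ φ = (gradTerm c U (Q i) (h i) φ + fun x => (lapNh c (Q i) (h i) x : ℂ) * φ x) - blockTerm U (Q i) (h i) a k φ := by
    funext x; rw [Pi.sub_apply, Pi.add_apply, kLet_mulVec]
  rw [e]
  calc l2n ((gradTerm c U (Q i) (h i) φ + fun x => (lapNh c (Q i) (h i) x : ℂ) * φ x) - blockTerm U (Q i) (h i) a k φ)
      ≤ l2n (gradTerm c U (Q i) (h i) φ + fun x => (lapNh c (Q i) (h i) x : ℂ) * φ x) + l2n (blockTerm U (Q i) (h i) a k φ) := l2n_sub_le _ _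
    _ ≤ (l2n (gradTerm c U (Q i) (h i) φ) + l2n (fun x => (lapNh c (Q i) (h i) x : ℂ) * φ x)) + l2n (blockTerm U (Q i) (h i) a k φ) := by
        gcongr; exact l2n_add_le _ _
    _ ≤ (2 * P.d * |c| * δ₁ * Real.sqrt (∑ b ∈ starB (Q i), ‖covD c (cfg U) φ b‖ ^ 2) + Λ * l2n φ)
          + |a| * δ₃ * ((P.L : ℝ) ^ (k * P.d))⁻¹ * l2n φ :=
        add_le_add (add_le_add (l2n_gradTerm_le c U (Q i) (h i) hδ₁ h1 φ) (l2n_lapNh_mul_le c (Q i) (h i) hΛ h2 φ))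
          (l2n_blockTerm_le hk U (Q i) (h i) a hδ₃ h3 φ)
    _ = _ := by ring

/-- **(2.21)'s `‖·‖_{2,2}` FACTOR FROM LEMMA 2.1, GENERIC**: if moreover `Q_i` is a `k`-block union and the `U(1)` field is small on `Q_i` in
the coercivity sense, then for every source `f`
`‖K_iG_k(Q_i,u)f‖₂ ≤ (2d|c|δ₁·m₁^{−1/2} + (Λ + |a|δ₃L^{−kd})·m₁⁻¹)·‖f‖₂` — *"We apply Lemma 2.2 to the terms of the second sum also … we
estimate the second sum by … Π‖K_{ω_i}G_k(□_{ω_i},A_{ω_i})h_{ω_i}‖_{2,2}‖f‖₂"* (2.21), here through Lemma 2.1 (2.15) (§1) for an ARBITRARY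
block union. [cite: Balaban1983RegularityDecay, (2.21) p.578] -/
theorem l2n_kLet_gBox_mulVec_le {J : Type*} (hk : j + k ≤ P.m + P.K) {a c : ℝ} (hc : c ≠ 0) (ha : 0 < a) (U : GaugeField P j U1)
    (Q : J → Finset (Balaban1983to89.Site P j)) (h : J → Balaban1983to89.Site P j → ℝ) (i : J) (hQ : IsBlockUnion k (Q i)) {T δ : ℝ}
    (hInt : ∀ b ∈ starB (Q i), blkIter k b.src = blkIter k b.tgt → ‖toC (U b) - 1‖ ≤ T)
    (hTree : ∀ x ∈ Q i, ‖holCK U k x - 1‖ ≤ δ)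
    (hsmall : 2 * (((P.L : ℝ) ^ k - 1) * (P.L : ℝ) ^ k) * P.d * T ^ 2 + 2 * δ ^ 2 ≤ 1 / 2)
    {δ₁ Λ δ₃ : ℝ} (hδ₁ : 0 ≤ δ₁) (hΛ : 0 ≤ Λ) (hδ₃ : 0 ≤ δ₃)
    (h1 : ∀ x μ, |h i (x.shift μ) - h i x| ≤ δ₁ ∧ |h i (x.unshift μ) - h i x| ≤ δ₁) (h2 : ∀ x, |lapNh c (Q i) (h i) x| ≤ Λ)
    (h3 : ∀ x, ∀ x' ∈ blockK k (blkIter k x), |h i x' - h i x| ≤ δ₃) (f : Balaban1983to89.Site P j → ℂ) :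
    l2n (kLet a c U k Q h i *ᵥ (gBox a c U k (Q i) *ᵥ f))
      ≤ (2 * P.d * |c| * δ₁ * Real.sqrt ((mOne P a c k)⁻¹) + (Λ + |a| * δ₃ * ((P.L : ℝ) ^ (k * P.d))⁻¹) * (mOne P a c k)⁻¹) * l2n f := by
  have hm := mOne_pos (P := P) hc ha k
  have hK := l2n_kLet_mulVec_le hk a c U Q h i hδ₁ hΛ hδ₃ h1 h2 h3 (gBox a c U k (Q i) *ᵥ f)
  have hE := sqrt_energy_gBox_le hk hc ha U hQ hInt hTree hsmall f
  have hG := l2n_gBox_mulVec_le hk hc ha U hQ hInt hTree hsmall f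
  calc _ ≤ _ := hK
    _ ≤ 2 * P.d * |c| * δ₁ * (Real.sqrt ((mOne P a c k)⁻¹) * l2n f)
          + (Λ + |a| * δ₃ * ((P.L : ℝ) ^ (k * P.d))⁻¹) * ((mOne P a c k)⁻¹ * l2n f) := by
        gcongr
    _ = _ := by ring

/-! ### The sizes of [6]'s torus cut-offs `h_i` and the `k`-uniform bound `C(d,a)/M₀` for the operators of record -/

/-- kernel: the `ℓ¹` torus distance of the two ends of a bond is `≤ 1`. [folklore] -/
private theorem tdist_shift_le (x : Balaban1983to89.Site P j) (μ : Fin P.d) : Balaban1983to89.Site.tdist x (x.shift μ) ≤ 1 := by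
  unfold Balaban1983to89.Site.tdist
  rw [Finset.sum_eq_single μ]
  · have e : (x.shift μ) μ = x μ + 1 := by show Function.update x μ (x μ + 1) μ = _; rw [Function.update_self]
    rw [e, show x μ + 1 - x μ = 1 by ring]
    refine (min_le_right _ _).trans ?_
    rw [ZMod.val_one_eq_one_mod]
    exact Nat.mod_le 1 _
  · intro ν _ hν
    have e : (x.shift μ) ν = x ν := by show Function.update x μ (x μ + 1) ν = _; rw [Function.update_of_ne hν]
    rw [e, sub_self, ZMod.val_zero, Nat.zero_min]
  · intro h; exact absurd (Finset.mem_univ μ) h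

/-- kernel: the torus distance is symmetric. [folklore] -/
private theorem tdist_comm (x y : Balaban1983to89.Site P j) : Balaban1983to89.Site.tdist x y = Balaban1983to89.Site.tdist y x := by
  unfold Balaban1983to89.Site.tdist; exact Finset.sum_congr rfl fun μ _ => min_comm _ _

/-- kernel: two sites of one `k`-block are at `ℓ¹` distance `≤ d(L^k − 1)` (the blocks do not wrap; standing range).
[cite: BalabanImbrieJaffe1985, (5.1.2)–(5.1.3) p.313] -/
private theorem tdist_le_of_blkIter_eq (hk : j + k ≤ P.m + P.K) {x y : Balaban1983to89.Site P j} (h : blkIter k x = blkIter k y) :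
    Balaban1983to89.Site.tdist x y ≤ P.d * (P.L ^ k - 1) := by
  unfold Balaban1983to89.Site.tdist
  have hn : 0 < P.L ^ k := pow_pos P.L_pos k
  have key : ∀ μ, min (x μ - y μ).val (y μ - x μ).val ≤ P.L ^ k - 1 := by
    intro μ
    have hq : (x μ).val / P.L ^ k = (y μ).val / P.L ^ k := by
      rw [← val_blkIter k hk x μ, ← val_blkIter k hk y μ, h]
    have h1 := Nat.div_mul_le_self (x μ).val (P.L ^ k)
    have h2 : (x μ).val < (x μ).val / P.L ^ k * P.L ^ k + P.L ^ k := Nat.lt_div_mul_add hn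
    have h3 := Nat.div_mul_le_self (y μ).val (P.L ^ k)
    have h4 : (y μ).val < (y μ).val / P.L ^ k * P.L ^ k + P.L ^ k := Nat.lt_div_mul_add hn
    rw [hq] at h1 h2
    set q := (y μ).val / P.L ^ k * P.L ^ k
    by_cases hle : (y μ).val ≤ (x μ).val
    · exact (min_le_left _ _).trans (by rw [ZMod.val_sub hle]; omega)
    · exact (min_le_right _ _).trans (by rw [ZMod.val_sub (by omega)]; omega)
  calc ∑ μ, min (x μ - y μ).val (y μ - x μ).val ≤ ∑ _μ : Fin P.d, (P.L ^ k - 1) := Finset.sum_le_sum fun μ _ => key μ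
    _ = P.d * (P.L ^ k - 1) := by rw [Finset.sum_const, Finset.card_univ, Fintype.card_fin, smul_eq_mul]

/-- **THE SIZES OF [6]'s TORUS CUT-OFFS `h_i`** (files 1/4): first differences `≤ 3sup|h′|/M`, and the oscillation over a `k`-block
`≤ 3sup|h′|·dL^k/M` (`M = L^kM₀` fine sites). [cite: Balaban1983RegularityDecay, (2.10) p.576] -/
theorem hT_sizes (hC : CubeSize P j k M₀) (hk : j + k ≤ P.m + P.K) (i : Lab P j k M₀) :
    (∀ (x : Balaban1983to89.Site P j) μ, |hT k M₀ i (x.shift μ) - hT k M₀ i x| ≤ 3 * D1 hprof / half P k M₀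
        ∧ |hT k M₀ i (x.unshift μ) - hT k M₀ i x| ≤ 3 * D1 hprof / half P k M₀)
    ∧ (∀ (x : Balaban1983to89.Site P j), ∀ x' ∈ blockK k (blkIter k x),
        |hT k M₀ i x' - hT k M₀ i x| ≤ 3 * D1 hprof * (P.d * P.L ^ k) / half P k M₀) := by
  have hh : (0 : ℝ) < half P k M₀ := by exact_mod_cast hC.pos_half
  have hD1 : 0 ≤ D1 hprof := D1_nonneg contDiff_hprof hasCompactSupport_hprof
  have one : ∀ (x y : Balaban1983to89.Site P j), Balaban1983to89.Site.tdist x y ≤ 1 → |hT k M₀ i x - hT k M₀ i y| ≤ 3 * D1 hprof / half P k M₀ :=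
    fun x y hxy => (abs_hT_sub_le hC i x y).trans ((div_le_div_iff_of_pos_right hh).2
      (mul_le_of_le_one_right (by positivity) (by exact_mod_cast hxy)))
  refine ⟨fun x μ => ⟨?_, ?_⟩, fun x x' hx' => ?_⟩
  · rw [abs_sub_comm]; exact one x _ (tdist_shift_le x μ)
  · refine one _ x ?_
    have h1 := tdist_shift_le (x.unshift μ) μ
    rwa [shift_unshift] at h1
  · refine (abs_hT_sub_le hC i _ _).trans ((div_le_div_iff_of_pos_right hh).2 (mul_le_mul_of_nonneg_left ?_ (by positivity)))
    have hb : blkIter k x' = blkIter k x := mem_blockK.1 hx'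
    have h1 := tdist_le_of_blkIter_eq hk hb
    have h2 : P.d * (P.L ^ k - 1) ≤ P.d * P.L ^ k := Nat.mul_le_mul_left _ (Nat.sub_le _ _)
    exact_mod_cast h1.trans h2

/-- kernel: `a/2 ≤ a_k` (r01's `a_k = a(1 − L⁻²)/(1 − L^{−2k})`, `L ≥ 2`, `k ≥ 1`). [cite: Balaban1982Higgs1, (2.15) p.609] -/
private theorem half_le_aSeq {a L : ℝ} (ha : 0 < a) (hL : 2 ≤ L) {k : ℕ} (hk : 1 ≤ k) : a / 2 ≤ B1.aSeq a L k := by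
  rw [B1.aSeq_eq]
  have hL2 : (4 : ℝ) ≤ L ^ 2 := by nlinarith
  have hq : (L ^ 2)⁻¹ ≤ 1 / 4 := by rw [inv_eq_one_div]; exact one_div_le_one_div_of_le (by norm_num) hL2
  have hq0 : 0 < (L ^ 2)⁻¹ := by positivity
  have hden1 : 1 - ((L ^ 2)⁻¹) ^ k ≤ 1 := by linarith [pow_pos hq0 k]
  have hden0 : 0 < 1 - ((L ^ 2)⁻¹) ^ k := by
    have : ((L ^ 2)⁻¹) ^ k < 1 := pow_lt_one₀ hq0.le (by linarith) (by omega)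
    linarith
  rw [le_div_iff₀ hden0]
  nlinarith

/-- **THE COERCIVITY CONSTANT FOR THE OPERATOR OF RECORD**: with `a = α_kL^{kd}` (`α_k = a_k(L^kε)⁻²`) and `c = ε⁻¹`,
`m₁ ≥ min(1, a/2)/(4(L^kε)²)` — so `m₁⁻¹ ≤ 4(L^kε)²/min(1,a/2)` and `m₁^{−1/2} ≤ 2(L^kε)/min(1,a/2)^{1/2}`, UNIFORMLY IN `k`.
[cite: BalabanImbrieJaffe1985, (7.3.2) p.326] -/
theorem inv_mOne_le (P : Params) {a : ℝ} (ha : 0 < a) {k : ℕ} (hk1 : 1 ≤ k) :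
    (mOne P (B1RG242Torus.α P a k * (P.L : ℝ) ^ (k * P.d)) P.eps⁻¹ k)⁻¹ ≤ 4 * P.spacing k ^ 2 / min 1 (a / 2)
      ∧ Real.sqrt ((mOne P (B1RG242Torus.α P a k * (P.L : ℝ) ^ (k * P.d)) P.eps⁻¹ k)⁻¹) ≤ 2 * P.spacing k / Real.sqrt (min 1 (a / 2)) := by
  have hLr : (2 : ℝ) ≤ P.L := by exact_mod_cast (show 2 ≤ P.L by have := P.hL.2; omega)
  have hs := P.spacing_pos k
  have hsp : P.spacing k = (P.L : ℝ) ^ k * P.eps := rfl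
  have hN : (0 : ℝ) < (P.L : ℝ) ^ (k * P.d) := pow_pos P.cast_L_pos _
  have hq : 0 < min (1 : ℝ) (a / 2) := lt_min one_pos (by positivity)
  have hak := half_le_aSeq ha hLr hk1
  -- `m₁ = min(1, a_k)/(4 s²) ≥ q/(4s²)`
  have hm : min (1 : ℝ) (a / 2) / (4 * P.spacing k ^ 2) ≤ mOne P (B1RG242Torus.α P a k * (P.L : ℝ) ^ (k * P.d)) P.eps⁻¹ k := by
    unfold mOne B1RG242Torus.α
    refine le_min ?_ ?_
    · rw [hsp, div_le_div_iff₀ (by positivity) (by positivity)]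
      have : min (1 : ℝ) (a / 2) ≤ 1 := min_le_left _ _
      have he : P.eps⁻¹ ^ 2 * (4 * (((P.L : ℝ) ^ k) * P.eps) ^ 2) = 4 * ((P.L : ℝ) ^ k) ^ 2 := by
        field_simp [P.eps_pos.ne']
      rw [he]; nlinarith [pow_pos (pow_pos P.cast_L_pos k) 2]
    · rw [div_le_div_iff₀ (by positivity) (by positivity)]
      have h2 : min (1 : ℝ) (a / 2) ≤ B1.aSeq a P.L k := (min_le_right _ _).trans hak
      have he : B1.aSeq a (P.L : ℝ) k * (P.spacing k ^ 2)⁻¹ * (P.L : ℝ) ^ (k * P.d) * (4 * P.spacing k ^ 2)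
          = B1.aSeq a P.L k * (4 * (P.L : ℝ) ^ (k * P.d)) := by field_simp
      rw [he]
      exact mul_le_mul_of_nonneg_right h2 (by positivity)
  have hm0 : 0 < min (1 : ℝ) (a / 2) / (4 * P.spacing k ^ 2) := by positivity
  have hinv : (mOne P (B1RG242Torus.α P a k * (P.L : ℝ) ^ (k * P.d)) P.eps⁻¹ k)⁻¹ ≤ 4 * P.spacing k ^ 2 / min 1 (a / 2) := by
    rw [show 4 * P.spacing k ^ 2 / min 1 (a / 2) = (min (1 : ℝ) (a / 2) / (4 * P.spacing k ^ 2))⁻¹ by rw [inv_div]]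
    exact inv_anti₀ hm0 hm
  refine ⟨hinv, ?_⟩
  calc Real.sqrt _ ≤ Real.sqrt (4 * P.spacing k ^ 2 / min 1 (a / 2)) := Real.sqrt_le_sqrt hinv
    _ = 2 * P.spacing k / Real.sqrt (min 1 (a / 2)) := by
        rw [Real.sqrt_div (by positivity), show (4 : ℝ) * P.spacing k ^ 2 = (2 * P.spacing k) ^ 2 by ring,
          Real.sqrt_sq (by positivity)]

open scoped Matrix.Norms.L2Operator

/-- **LEMMA 2.1 (2.15) AS AN OPERATOR BOUND: `‖G_k(Q,u)‖_{2→2} ≤ m₁⁻¹`** for every `k`-block union `Q` and every `U(1)` field small on `Q` in the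
coercivity sense (every level `j`, every `a > 0`, `c ≠ 0`). [cite: Balaban1983RegularityDecay, (2.15) p.577] -/
theorem norm_l2_gBox_le (hk : j + k ≤ P.m + P.K) {a c : ℝ} (hc : c ≠ 0) (ha : 0 < a) (U : GaugeField P j U1)
    {Q : Finset (Balaban1983to89.Site P j)} (hQ : IsBlockUnion k Q) {T δ : ℝ}
    (hInt : ∀ b ∈ starB Q, blkIter k b.src = blkIter k b.tgt → ‖toC (U b) - 1‖ ≤ T)
    (hTree : ∀ x ∈ Q, ‖holCK U k x - 1‖ ≤ δ)
    (hsmall : 2 * (((P.L : ℝ) ^ k - 1) * (P.L : ℝ) ^ k) * P.d * T ^ 2 + 2 * δ ^ 2 ≤ 1 / 2) :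
    ‖gBox a c U k Q‖ ≤ (mOne P a c k)⁻¹ :=
  l2_opNorm_le_of_l2n_le (inv_nonneg.2 (mOne_pos hc ha k).le) fun f => l2n_gBox_mulVec_le hk hc ha U hQ hInt hTree hsmall f

/-- **`‖G_k(Q,u)‖_{2→2} ≤ 4(L^kε)²/min(1,a/2)` FOR THE OPERATOR OF RECORD** (`a = α_kL^{kd}`, `c = ε⁻¹`, torus `T^{(0)}`), every `k`-block union `Q`,
`1 ≤ k`, small field on `Q` — the first letters `h_iG_k(Ω∩□_i,u)h_i` of (2.13) are bounded in `L₂`, uniformly in `k` after the natural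
scaling (Lemma 2.1's role in (2.12)). [cite: Balaban1983RegularityDecay, (2.15) p.577] -/
theorem norm_l2_gBox_le_spacing {k : ℕ} (hk1 : 1 ≤ k) (hk : 0 + k ≤ P.m + P.K) {a : ℝ} (ha : 0 < a) (U : GaugeField P 0 U1)
    {Q : Finset (Balaban1983to89.Site P 0)} (hQ : IsBlockUnion k Q) {T δ : ℝ}
    (hInt : ∀ b ∈ starB Q, blkIter k b.src = blkIter k b.tgt → ‖toC (U b) - 1‖ ≤ T)
    (hTree : ∀ x ∈ Q, ‖holCK U k x - 1‖ ≤ δ)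
    (hsmall : 2 * (((P.L : ℝ) ^ k - 1) * (P.L : ℝ) ^ k) * P.d * T ^ 2 + 2 * δ ^ 2 ≤ 1 / 2) :
    ‖gBox (B1RG242Torus.α P a k * (P.L : ℝ) ^ (k * P.d)) P.eps⁻¹ U k Q‖ ≤ 4 * P.spacing k ^ 2 / min 1 (a / 2) := by
  have hLr : (1 : ℝ) < P.L := B1RG242Torus.one_lt_cast_L P
  have ha' : 0 < B1RG242Torus.α P a k * (P.L : ℝ) ^ (k * P.d) := by
    have := B1.aSeq_pos ha hLr hk1; have := P.spacing_pos k; have := P.cast_L_pos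
    unfold B1RG242Torus.α; positivity
  have hc : P.eps⁻¹ ≠ 0 := inv_ne_zero P.eps_pos.ne'
  exact (norm_l2_gBox_le hk hc ha' U hQ hInt hTree hsmall).trans (inv_mOne_le P ha hk1).1

/-- **«‖K_{ω_i}G_k(□_{ω_i},A_{ω_i})h_{ω_i}‖_{2,2} ≦ c₂O(1)M⁻¹» FOR THE TORUS `G_k(Ω,u)` AND EVERY `M`-ALIGNED BLOCK UNION `Ω`**: there is
`C = C(d, a) > 0` such that for every torus of the series (`P.d = d`), every `1 ≤ k ≤ m + K`, every cube size `M = L^kM₀` of file 1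
(`CubeSize`), every `M`-aligned `k`-block union `Ω ⊆ T^{(0)}` and every `U(1)` field small ON `Ω` in the coercivity sense (in-block bond
variables `|u_b − 1| ≤ T` on `Ω*`, block transports `|u(Γ^{(k)}_{x_k,x}) − 1| ≤ δ` on `Ω`, `2(L^k−1)L^k·d·T² + 2δ² ≤ ½` — NO plaquette
condition), and every window `□_i`:  `‖K_iG_k(Ω ∩ □_i, u)‖_{2→2} ≤ C/M₀`, UNIFORMLY IN `k`, the torus, `Ω` and the field — the `‖·‖_{2,2}`
factors of (2.21) and the content of *"Lemma 2.1 implies that the L₂-norm of the operator R given by (2.11) is small for M large enough"*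
(p. 577) at the level of the single letters: the three terms of (2.10) in `L₂` (§3) with `δ₁ = 3D₁/M`, `|Δ^{η,N}h_i| ≤ c²d·3D₂/M²` (§2, the
`M`-alignment), `δ₃ = 3dD₁L^k/M`, fed with (2.15) (§1).  [cite: Balaban1983RegularityDecay, (2.21) p.578] -/
theorem norm_l2_letter_le (d : ℕ) {a : ℝ} (ha : 0 < a) :
    ∃ C : ℝ, 0 < C ∧ ∀ (P : Params), P.d = d → ∀ k : ℕ, 1 ≤ k → 0 + k ≤ P.m + P.K →
      ∀ M₀ : ℕ, CubeSize P 0 k M₀ → ∀ (Ω : Finset (Balaban1983to89.Site P 0)), IsMAligned k M₀ Ω →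
      ∀ (U : GaugeField P 0 U1) (T δ : ℝ),
        (∀ b ∈ starB Ω, blkIter k b.src = blkIter k b.tgt → ‖toC (U b) - 1‖ ≤ T) →
        (∀ y ∈ Ω, ‖holCK U k y - 1‖ ≤ δ) →
        2 * (((P.L : ℝ) ^ k - 1) * (P.L : ℝ) ^ k) * P.d * T ^ 2 + 2 * δ ^ 2 ≤ 1 / 2 →
      ∀ i : Lab P 0 k M₀,
        ‖kLet (B1RG242Torus.α P a k * (P.L : ℝ) ^ (k * P.d)) P.eps⁻¹ U k (fun l => Ω ∩ cube k M₀ l) (hT k M₀) i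
            * gBox (B1RG242Torus.α P a k * (P.L : ℝ) ^ (k * P.d)) P.eps⁻¹ U k (Ω ∩ cube k M₀ i)‖ ≤ C / M₀ := by
  have hD1 : 0 ≤ D1 hprof := D1_nonneg contDiff_hprof hasCompactSupport_hprof
  have hD2 : 0 ≤ D2 hprof := D2_nonneg contDiff_hprof hasCompactSupport_hprof
  set q : ℝ := min 1 (a / 2) with hqdef
  have hq : 0 < q := lt_min one_pos (by positivity)
  have hq1 : q ≤ 1 := min_le_left _ _
  set Cst : ℝ := 12 * (d : ℝ) * (D1 hprof / Real.sqrt q + D2 hprof / q + a * D1 hprof / q) + 1 with hCst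
  refine ⟨Cst, by positivity, ?_⟩
  intro P hPd k hk1 hk M₀ hC Ω hΩ U T δ hInt hTree hsmall i
  set a' : ℝ := B1RG242Torus.α P a k * (P.L : ℝ) ^ (k * P.d) with ha'
  set Q : Lab P 0 k M₀ → Finset (Balaban1983to89.Site P 0) := fun l => Ω ∩ cube k M₀ l with hQ
  have hLr : (1 : ℝ) < P.L := B1RG242Torus.one_lt_cast_L P
  have hLk : (0 : ℝ) < (P.L : ℝ) ^ k := pow_pos P.cast_L_pos _
  have hN : (0 : ℝ) < (P.L : ℝ) ^ (k * P.d) := pow_pos P.cast_L_pos _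
  have heps := P.eps_pos
  have hs := P.spacing_pos k
  have hsp : P.spacing k = (P.L : ℝ) ^ k * P.eps := rfl
  have hM3 := hC.three_le
  have hM0 : (0 : ℝ) < M₀ := by exact_mod_cast (show 0 < M₀ by omega)
  have hM1 : (1 : ℝ) ≤ M₀ := by exact_mod_cast (show 1 ≤ M₀ by omega)
  have hhalf : (half P k M₀ : ℝ) = (P.L : ℝ) ^ k * M₀ := by unfold half; push_cast; ring
  have hh : (0 : ℝ) < half P k M₀ := by exact_mod_cast hC.pos_half
  have haS : 0 < B1.aSeq a P.L k := B1.aSeq_pos ha hLr hk1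
  have haSle : B1.aSeq a P.L k ≤ a := B1.aSeq_le ha hLr k hk1
  have ha'eq : a' = B1.aSeq a P.L k * (P.spacing k ^ 2)⁻¹ * (P.L : ℝ) ^ (k * P.d) := rfl
  have ha'pos : 0 < a' := by rw [ha'eq]; positivity
  have hc : P.eps⁻¹ ≠ 0 := inv_ne_zero heps.ne'
  have hd' : (P.d : ℝ) = d := by rw [hPd]
  -- the region `Q_i` and the smallness on it
  have hQΩ : Q i ⊆ Ω := Finset.inter_subset_left
  have hΩb : IsBlockUnion k Ω := hΩ.isBlockUnion hk
  have hQb : IsBlockUnion k (Q i) := isBlockUnion_inter hΩb (isBlockUnion_cube hC hk i)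
  have hInt' : ∀ b ∈ starB (Q i), blkIter k b.src = blkIter k b.tgt → ‖toC (U b) - 1‖ ≤ T := fun b hb hbb =>
    hInt b ((mem_starB _ _).2 ⟨hQΩ ((mem_starB _ _).1 hb).1, hQΩ ((mem_starB _ _).1 hb).2⟩) hbb
  have hTree' : ∀ x ∈ Q i, ‖holCK U k x - 1‖ ≤ δ := fun x hx => hTree x (hQΩ hx)
  -- the sizes of `h_i`
  obtain ⟨h1, h3⟩ := hT_sizes hC hk i
  have h2 : ∀ x, |lapNh P.eps⁻¹ (Q i) (hT k M₀ i) x| ≤ P.eps⁻¹ ^ 2 * (P.d * (3 * D2 hprof / (half P k M₀ : ℝ) ^ 2)) :=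
    fun x => abs_lapNh_inter_cube_le hC hΩ P.eps⁻¹ i x
  -- the generic bound
  have key := fun f => l2n_kLet_gBox_mulVec_le hk hc ha'pos U Q (hT k M₀) i hQb hInt' hTree' hsmall
    (δ₁ := 3 * D1 hprof / half P k M₀) (Λ := P.eps⁻¹ ^ 2 * (P.d * (3 * D2 hprof / (half P k M₀ : ℝ) ^ 2)))
    (δ₃ := 3 * D1 hprof * (P.d * P.L ^ k) / half P k M₀) (by positivity) (by positivity) (by positivity) h1 h2 h3 f
  obtain ⟨hm1, hm2⟩ := inv_mOne_le P ha hk1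
  set B : ℝ := 2 * P.d * |P.eps⁻¹| * (3 * D1 hprof / half P k M₀) * Real.sqrt ((mOne P a' P.eps⁻¹ k)⁻¹)
      + (P.eps⁻¹ ^ 2 * (P.d * (3 * D2 hprof / (half P k M₀ : ℝ) ^ 2))
          + |a'| * (3 * D1 hprof * (P.d * P.L ^ k) / half P k M₀) * ((P.L : ℝ) ^ (k * P.d))⁻¹) * (mOne P a' P.eps⁻¹ k)⁻¹ with hB
  have hB0 : 0 ≤ B := by rw [hB]; have := mOne_pos (P := P) hc ha'pos k; positivity
  refine (l2_opNorm_le_of_l2n_le hB0 fun f => by rw [← mulVec_mulVec]; exact key f).trans ?_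
  -- arithmetic: `B ≤ C/M₀`
  have heinv : |P.eps⁻¹| = P.eps⁻¹ := abs_of_pos (inv_pos.2 heps)
  have ha'abs : |a'| = a' := abs_of_pos ha'pos
  have hsq : 0 < Real.sqrt q := Real.sqrt_pos.2 hq
  -- term 1: `2d·ε⁻¹·(3D₁/(L^kM₀))·2(L^kε)/√q = 12dD₁/(M₀√q)`
  have t1 : 2 * P.d * |P.eps⁻¹| * (3 * D1 hprof / half P k M₀) * Real.sqrt ((mOne P a' P.eps⁻¹ k)⁻¹)
      ≤ 12 * (d : ℝ) * (D1 hprof / Real.sqrt q) / M₀ := by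
    calc _ ≤ 2 * P.d * |P.eps⁻¹| * (3 * D1 hprof / half P k M₀) * (2 * P.spacing k / Real.sqrt q) :=
          mul_le_mul_of_nonneg_left hm2 (by positivity)
      _ = 12 * (d : ℝ) * (D1 hprof / Real.sqrt q) / M₀ := by
          rw [heinv, hsp, hhalf, hd']; field_simp; ring
  -- term 2: `ε⁻²·d·3D₂/(L^kM₀)²·4(L^kε)²/q = 12dD₂/(M₀²q) ≤ 12dD₂/(M₀q)`
  have t2 : P.eps⁻¹ ^ 2 * (P.d * (3 * D2 hprof / (half P k M₀ : ℝ) ^ 2)) * (mOne P a' P.eps⁻¹ k)⁻¹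
      ≤ 12 * (d : ℝ) * (D2 hprof / q) / M₀ := by
    calc _ ≤ P.eps⁻¹ ^ 2 * (P.d * (3 * D2 hprof / (half P k M₀ : ℝ) ^ 2)) * (4 * P.spacing k ^ 2 / q) :=
          mul_le_mul_of_nonneg_left hm1 (by positivity)
      _ = 12 * (d : ℝ) * (D2 hprof / q) / M₀ / M₀ := by rw [hsp, hhalf, hd']; field_simp; ring
      _ ≤ 12 * (d : ℝ) * (D2 hprof / q) / M₀ := div_le_self (by positivity) hM1
  -- term 3: `a_k(L^kε)⁻²L^{kd}·3dD₁L^k/(L^kM₀)·L^{−kd}·4(L^kε)²/q = 12 a_k dD₁/(M₀q) ≤ 12 a dD₁/(M₀q)`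
  have t3 : |a'| * (3 * D1 hprof * (P.d * P.L ^ k) / half P k M₀) * ((P.L : ℝ) ^ (k * P.d))⁻¹ * (mOne P a' P.eps⁻¹ k)⁻¹
      ≤ 12 * (d : ℝ) * (a * D1 hprof / q) / M₀ := by
    calc _ ≤ |a'| * (3 * D1 hprof * (P.d * P.L ^ k) / half P k M₀) * ((P.L : ℝ) ^ (k * P.d))⁻¹ * (4 * P.spacing k ^ 2 / q) :=
          mul_le_mul_of_nonneg_left hm1 (by positivity)
      _ = 12 * (d : ℝ) * (B1.aSeq a P.L k * D1 hprof / q) / M₀ := by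
          rw [ha'abs, ha'eq, hhalf, hd']; field_simp; ring
      _ ≤ 12 * (d : ℝ) * (a * D1 hprof / q) / M₀ := by gcongr
  have hsum : B ≤ 12 * (d : ℝ) * (D1 hprof / Real.sqrt q) / M₀ + (12 * (d : ℝ) * (D2 hprof / q) / M₀ + 12 * (d : ℝ) * (a * D1 hprof / q) / M₀) := by
    rw [hB, add_mul]
    exact add_le_add t1 (add_le_add t2 t3)
  calc B ≤ _ := hsum
    _ = (12 * (d : ℝ) * (D1 hprof / Real.sqrt q + D2 hprof / q + a * D1 hprof / q)) / M₀ := by ring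
    _ ≤ Cst / M₀ := div_le_div_of_nonneg_right (by rw [hCst]; linarith) hM0.le

end Letter

/-! ## §5 `‖R‖_{L²→L²}` IS SMALL, (2.12) `G_k(Ω,u) = Σ_n G₀Rⁿ` AND (2.13) CONVERGE — FOR EVERY `M`-ALIGNED BLOCK UNION `Ω` -/

section Assembly

open scoped Matrix.Norms.L2Operator

variable {k M₀ : ℕ}

/-- kernel: the cut-offs have `‖h_i‖_{2→2} ≤ 1` (`0 ≤ h_i ≤ 1`). [cite: Balaban1983RegularityDecay, (2.2) p.575] -/
theorem norm_l2_mulR_le_one {h₁ : Balaban1983to89.Site P j → ℝ} (hh : ∀ x, |h₁ x| ≤ 1) : ‖mulR h₁‖ ≤ 1 := by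
  unfold mulR
  exact l2_opNorm_diagonal_le zero_le_one fun x => by rw [Complex.norm_real, Real.norm_eq_abs]; exact hh x

/-- **`‖R‖_{L²→L²} ≤ m₀·β` FROM THE SINGLE LETTERS, UNIFORMLY IN THE VOLUME** (generic): if every site lies in at most `m₀` of the regions
`Q_i`, `Σ_i h_i² = 1`, and `‖K_iG_k(Q_i,u)‖_{2→2} ≤ β` for all `i`, then `R = Σ_i K_iG_k(Q_i,u)h_i` has `‖R‖_{2→2} ≤ m₀β` — rows of `K_i`
live in `Q_i` (row multiplicity, Cauchy–Schwarz) and `Σ_i‖h_if‖₂² = ‖f‖₂²` (the partition of unity absorbs the column sum exactly).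
[cite: Balaban1983RegularityDecay, (2.12) p.577] -/
theorem norm_l2_rOp_le {J : Type*} [Fintype J] [DecidableEq J] {a c : ℝ} (U : GaugeField P j U1)
    (Q : J → Finset (Balaban1983to89.Site P j)) (h : J → Balaban1983to89.Site P j → ℝ) {m₀ : ℕ}
    (hm : ∀ x, (Finset.univ.filter fun i => x ∈ Q i).card ≤ m₀) (hsq : ∀ x, ∑ i, h i x ^ 2 = 1) {β : ℝ} (hβ0 : 0 ≤ β)
    (hβ : ∀ i, ‖kLet a c U k Q h i * gBox a c U k (Q i)‖ ≤ β) : ‖rOp a c U k Q h‖ ≤ m₀ * β := by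
  classical
  refine l2_opNorm_le_of_l2n_le (by positivity) fun f => l2n_le_of_sq_le (by positivity) ?_
  -- `(Rf)(x) = Σ_{i : x ∈ Q_i} (b_if)(x)`
  have hrow : ∀ x, (rOp a c U k Q h *ᵥ f) x = ∑ i ∈ univ.filter (fun i => x ∈ Q i), (bLet a c U k Q h i *ᵥ f) x := by
    intro x
    unfold rOp
    rw [Matrix.sum_mulVec, Finset.sum_apply, ← Finset.sum_filter_add_sum_filter_not univ (fun i => x ∈ Q i)]
    rw [Finset.sum_eq_zero (s := univ.filter fun i => ¬ x ∈ Q i) fun i hi => ?_, add_zero]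
    have hx : x ∉ Q i := (mem_filter.1 hi).2
    unfold bLet
    rw [Matrix.mul_assoc, ← mulVec_mulVec]
    exact kLet_mulVec_eq_zero_of_not_mem a c U k Q h i _ hx
  -- each letter: `‖b_if‖₂ ≤ β‖h_if‖₂`
  have hb : ∀ i, l2n (bLet a c U k Q h i *ᵥ f) ≤ β * l2n (mulR (h i) *ᵥ f) := by
    intro i
    unfold bLet
    rw [← mulVec_mulVec]
    exact (l2n_mulVec_le _ _).trans (mul_le_mul_of_nonneg_right (hβ i) (l2n_nonneg _))
  have hb2 : ∀ i, ∑ x, ‖(bLet a c U k Q h i *ᵥ f) x‖ ^ 2 ≤ β ^ 2 * ∑ x, (h i x) ^ 2 * ‖f x‖ ^ 2 := by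
    intro i
    have e : ∑ x, (h i x) ^ 2 * ‖f x‖ ^ 2 = l2n (mulR (h i) *ᵥ f) ^ 2 := by
      rw [l2n_sq]
      exact Finset.sum_congr rfl fun x _ => by rw [mulR_mulVec, norm_mul, Complex.norm_real, Real.norm_eq_abs, mul_pow, sq_abs]
    rw [e, ← l2n_sq, ← mul_pow]
    exact pow_le_pow_left₀ (l2n_nonneg _) (hb i) 2
  calc ∑ x, ‖(rOp a c U k Q h *ᵥ f) x‖ ^ 2
      = ∑ x, ‖∑ i ∈ univ.filter (fun i => x ∈ Q i), (bLet a c U k Q h i *ᵥ f) x‖ ^ 2 := Finset.sum_congr rfl fun x _ => by rw [hrow]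
    _ ≤ ∑ x, (m₀ : ℝ) * ∑ i, ‖(bLet a c U k Q h i *ᵥ f) x‖ ^ 2 := Finset.sum_le_sum fun x _ => by
        refine (norm_sum_sq_le_card_mul _ _).trans ?_
        exact mul_le_mul (by exact_mod_cast hm x) (Finset.sum_le_sum_of_subset_of_nonneg (Finset.filter_subset _ _)
          fun _ _ _ => sq_nonneg _) (Finset.sum_nonneg fun _ _ => sq_nonneg _) (Nat.cast_nonneg _)
    _ = (m₀ : ℝ) * ∑ i, ∑ x, ‖(bLet a c U k Q h i *ᵥ f) x‖ ^ 2 := by rw [← Finset.mul_sum, Finset.sum_comm]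
    _ ≤ (m₀ : ℝ) * ∑ i, β ^ 2 * ∑ x, (h i x) ^ 2 * ‖f x‖ ^ 2 := mul_le_mul_of_nonneg_left (Finset.sum_le_sum fun i _ => hb2 i) (Nat.cast_nonneg _)
    _ = (m₀ : ℝ) * β ^ 2 * ∑ x, ‖f x‖ ^ 2 := by
        rw [← Finset.mul_sum, Finset.sum_comm, mul_assoc]
        congr 2
        exact Finset.sum_congr rfl fun x _ => by rw [← Finset.sum_mul, hsq x, one_mul]
    _ ≤ ((m₀ : ℝ) * β) ^ 2 * ∑ x, ‖f x‖ ^ 2 := by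
        refine mul_le_mul_of_nonneg_right ?_ (Finset.sum_nonneg fun _ _ => sq_nonneg _)
        rw [mul_pow]
        refine mul_le_mul_of_nonneg_right ?_ (sq_nonneg β)
        have : (m₀ : ℝ) ≤ (m₀ : ℝ) ^ 2 := by
          rcases Nat.eq_zero_or_pos m₀ with h0 | h0
          · simp [h0]
          · have : (1 : ℝ) ≤ m₀ := by exact_mod_cast h0
            nlinarith
        exact this

/-- **«THE L₂-NORM OF THE OPERATOR R GIVEN BY (2.11) IS SMALL FOR M LARGE ENOUGH»** (p. 577) FOR [6]'s CUBES ON THE TORUS AND EVERY `M`-ALIGNED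
BLOCK UNION `Ω`: with the constant `C(d,a)` of `norm_l2_letter_le`, `‖R‖_{2→2} ≤ 2^d·C/M₀` at small fields (row multiplicity `2^d` of the
regions `Ω ∩ □_i`, file 1; `Σ_i h_i² = 1` exactly). [cite: Balaban1983RegularityDecay, (2.12) p.577] -/
theorem norm_l2_rOp_cubes_le (d : ℕ) {a : ℝ} (ha : 0 < a) :
    ∃ C : ℝ, 0 < C ∧ ∀ (P : Params), P.d = d → ∀ k : ℕ, 1 ≤ k → 0 + k ≤ P.m + P.K →
      ∀ M₀ : ℕ, CubeSize P 0 k M₀ → ∀ (Ω : Finset (Balaban1983to89.Site P 0)), IsMAligned k M₀ Ω →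
      ∀ (U : GaugeField P 0 U1) (T δ : ℝ),
        (∀ b ∈ starB Ω, blkIter k b.src = blkIter k b.tgt → ‖toC (U b) - 1‖ ≤ T) →
        (∀ y ∈ Ω, ‖holCK U k y - 1‖ ≤ δ) →
        2 * (((P.L : ℝ) ^ k - 1) * (P.L : ℝ) ^ k) * P.d * T ^ 2 + 2 * δ ^ 2 ≤ 1 / 2 →
      ‖rOp (B1RG242Torus.α P a k * (P.L : ℝ) ^ (k * P.d)) P.eps⁻¹ U k (fun l : Lab P 0 k M₀ => Ω ∩ cube k M₀ l) (hT k M₀)‖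
        ≤ (2 ^ d : ℕ) * (C / M₀) := by
  obtain ⟨C, hC0, H⟩ := norm_l2_letter_le d ha
  refine ⟨C, hC0, ?_⟩
  intro P hPd k hk1 hk M₀ hC Ω hΩ U T δ hInt hTree hsmall
  have hM0 : (0 : ℝ) < M₀ := by exact_mod_cast (show 0 < M₀ by have := hC.three_le; omega)
  have hβ := H P hPd k hk1 hk M₀ hC Ω hΩ U T δ hInt hTree hsmall
  subst hPd
  exact norm_l2_rOp_le U (fun l : Lab P 0 k M₀ => Ω ∩ cube k M₀ l) (hT k M₀) (card_filter_mem_inter_cube_le hC Ω) (sum_hT_sq hC)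
    (by positivity) hβ

/-- **(2.12) IN THE `L₂`-NORM FOR EVERY `M`-ALIGNED BLOCK UNION: `G_k(Ω,u) = G₀(I − R)⁻¹ = Σ_{n≥0} G₀Rⁿ`** — *"so the series in the
representation (2.12) is convergent in this norm"* (p. 577): there is `M₁ = M₁(d, a)` such that for every torus of the series, every
`1 ≤ k ≤ m + K`, every cube size `M = L^kM₀` with `M₀ ≥ M₁`, every `M`-aligned `k`-block union `Ω ⊆ T^{(0)}` and every `U(1)` field small on `Ω`
in the coercivity sense, `‖R‖_{2→2} < 1` and the Neumann series converges to the region propagator of record (gen 25's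
`gBox_mul_one_sub_rOp` with file 1's localization datum; the HasSum is in the product topology of the kernels, the same proposition as gen 26's
`Ω = T` statement). [cite: Balaban1983RegularityDecay, (2.12) p.577] -/
theorem hasSum_gZero_mul_pow_l2 (d : ℕ) {a : ℝ} (ha : 0 < a) :
    ∃ M₁ : ℕ, ∀ (P : Params), P.d = d → ∀ k : ℕ, 1 ≤ k → 0 + k ≤ P.m + P.K →
      ∀ M₀ : ℕ, CubeSize P 0 k M₀ → M₁ ≤ M₀ → ∀ (Ω : Finset (Balaban1983to89.Site P 0)), IsMAligned k M₀ Ω →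
      ∀ (U : GaugeField P 0 U1) (T δ : ℝ),
        (∀ b ∈ starB Ω, blkIter k b.src = blkIter k b.tgt → ‖toC (U b) - 1‖ ≤ T) →
        (∀ y ∈ Ω, ‖holCK U k y - 1‖ ≤ δ) →
        2 * (((P.L : ℝ) ^ k - 1) * (P.L : ℝ) ^ k) * P.d * T ^ 2 + 2 * δ ^ 2 ≤ 1 / 2 →
      ‖rOp (B1RG242Torus.α P a k * (P.L : ℝ) ^ (k * P.d)) P.eps⁻¹ U k (fun l : Lab P 0 k M₀ => Ω ∩ cube k M₀ l) (hT k M₀)‖ < 1 ∧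
      HasSum (fun n : ℕ => gZero (B1RG242Torus.α P a k * (P.L : ℝ) ^ (k * P.d)) P.eps⁻¹ U k (fun l : Lab P 0 k M₀ => Ω ∩ cube k M₀ l) (hT k M₀)
          * rOp (B1RG242Torus.α P a k * (P.L : ℝ) ^ (k * P.d)) P.eps⁻¹ U k (fun l : Lab P 0 k M₀ => Ω ∩ cube k M₀ l) (hT k M₀) ^ n)
        (gBox (B1RG242Torus.α P a k * (P.L : ℝ) ^ (k * P.d)) P.eps⁻¹ U k Ω) := by
  obtain ⟨C, hC0, H⟩ := norm_l2_rOp_cubes_le d ha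
  refine ⟨⌈(2 : ℝ) ^ d * C⌉₊ + 1, ?_⟩
  intro P hPd k hk1 hk M₀ hC hM Ω hΩ U T δ hInt hTree hsmall
  have hLr : (1 : ℝ) < P.L := B1RG242Torus.one_lt_cast_L P
  have hM0 : (0 : ℝ) < M₀ := by exact_mod_cast (show 0 < M₀ by omega)
  have hc : P.eps⁻¹ ≠ 0 := inv_ne_zero P.eps_pos.ne'
  have ha' : 0 < B1RG242Torus.α P a k * (P.L : ℝ) ^ (k * P.d) := by
    have := B1.aSeq_pos ha hLr hk1; have := P.spacing_pos k; have := P.cast_L_pos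
    unfold B1RG242Torus.α; positivity
  have hR := H P hPd k hk1 hk M₀ hC Ω hΩ U T δ hInt hTree hsmall
  have hlt : ((2 ^ d : ℕ) : ℝ) * (C / M₀) < 1 := by
    have h1 := Nat.le_ceil ((2 : ℝ) ^ d * C)
    have h2 : ((⌈(2 : ℝ) ^ d * C⌉₊ : ℕ) : ℝ) + 1 ≤ M₀ := by exact_mod_cast hM
    push_cast
    rw [← mul_div_assoc, div_lt_one hM0]; linarith
  have hR1 := hR.trans_lt hlt
  have hΩb : IsBlockUnion k Ω := hΩ.isBlockUnion hk
  exact ⟨hR1, hasSum_of_norm_lt_one hR1 (gBox_mul_one_sub_rOp (isLocalization_cubes hC hk hΩb) hk hc ha' U hΩb)⟩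

/-- **(2.13) THE RANDOM WALK EXPANSION OF `G_k(Ω,u)` OVER [6]'s CUBES CONVERGES FOR EVERY `M`-ALIGNED BLOCK UNION `Ω`** (`M₀ ≥ M₁(d,a)`, small
field on `Ω` in the coercivity sense): `G_k(Ω,u) = Σ_ω h_{ω₀}G_k(Ω∩□_{ω₀},u)h_{ω₀}K_{ω₁}G_k(Ω∩□_{ω₁},u)h_{ω₁}⋯` as an unconditional `HasSum` over all
walks — p13's `hasSum_walkTerm` in the complete normed ring `(kernels, ‖·‖_{2→2})` with the letter bounds `‖a_i‖ ≤ 4(L^kε)²/min(1,a/2)`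
(§4), `‖b_i‖ ≤ C/M₀` (`norm_l2_letter_le`), degree `3^d` and the «obvious fact» (file 1), `‖R‖ < 1` (above); gen 26's `hasSum_piece_torus` is
the case `Ω = T` in the sup norm under plaquette smallness. [cite: Balaban1983RegularityDecay, (2.13) p.577] -/
theorem hasSum_piece_l2 (d : ℕ) {a : ℝ} (ha : 0 < a) :
    ∃ M₁ : ℕ, ∀ (P : Params), P.d = d → ∀ k : ℕ, 1 ≤ k → 0 + k ≤ P.m + P.K →
      ∀ M₀ : ℕ, CubeSize P 0 k M₀ → M₁ ≤ M₀ → ∀ (Ω : Finset (Balaban1983to89.Site P 0)), IsMAligned k M₀ Ω →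
      ∀ (U : GaugeField P 0 U1) (T δ : ℝ),
        (∀ b ∈ starB Ω, blkIter k b.src = blkIter k b.tgt → ‖toC (U b) - 1‖ ≤ T) →
        (∀ y ∈ Ω, ‖holCK U k y - 1‖ ≤ δ) →
        2 * (((P.L : ℝ) ^ k - 1) * (P.L : ℝ) ^ k) * P.d * T ^ 2 + 2 * δ ^ 2 ≤ 1 / 2 →
      HasSum (piece (B1RG242Torus.α P a k * (P.L : ℝ) ^ (k * P.d)) P.eps⁻¹ U k (fun l : Lab P 0 k M₀ => Ω ∩ cube k M₀ l) (hT k M₀))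
        (gBox (B1RG242Torus.α P a k * (P.L : ℝ) ^ (k * P.d)) P.eps⁻¹ U k Ω) := by
  obtain ⟨C, hC0, H⟩ := norm_l2_letter_le d ha
  obtain ⟨M₂, H2⟩ := hasSum_gZero_mul_pow_l2 d ha
  refine ⟨max M₂ (⌈(3 : ℝ) ^ d * C⌉₊ + 1), ?_⟩
  intro P hPd k hk1 hk M₀ hC hM Ω hΩ U T δ hInt hTree hsmall
  have hM2 : M₂ ≤ M₀ := le_trans (le_max_left _ _) hM
  have hM3 : ⌈(3 : ℝ) ^ d * C⌉₊ + 1 ≤ M₀ := le_trans (le_max_right _ _) hM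
  have hLr : (1 : ℝ) < P.L := B1RG242Torus.one_lt_cast_L P
  have hM0 : (0 : ℝ) < M₀ := by exact_mod_cast (show 0 < M₀ by omega)
  have hc : P.eps⁻¹ ≠ 0 := inv_ne_zero P.eps_pos.ne'
  have ha' : 0 < B1RG242Torus.α P a k * (P.L : ℝ) ^ (k * P.d) := by
    have := B1.aSeq_pos ha hLr hk1; have := P.spacing_pos k; have := P.cast_L_pos
    unfold B1RG242Torus.α; positivity
  have hΩb : IsBlockUnion k Ω := hΩ.isBlockUnion hk
  obtain ⟨hR1, -⟩ := H2 P hPd k hk1 hk M₀ hC hM2 Ω hΩ U T δ hInt hTree hsmall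
  have hβ := H P hPd k hk1 hk M₀ hC Ω hΩ U T δ hInt hTree hsmall
  have hDβ : ((3 ^ P.d : ℕ) : ℝ) * (C / M₀) < 1 := by
    have h1 := Nat.le_ceil ((3 : ℝ) ^ d * C)
    have h2 : ((⌈(3 : ℝ) ^ d * C⌉₊ : ℕ) : ℝ) + 1 ≤ M₀ := by exact_mod_cast hM3
    rw [hPd]; push_cast
    rw [← mul_div_assoc, div_lt_one hM0]; linarith
  -- the letter bounds in `‖·‖_{2→2}`
  set a' := B1RG242Torus.α P a k * (P.L : ℝ) ^ (k * P.d) with ha'def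
  set Q : Lab P 0 k M₀ → Finset (Balaban1983to89.Site P 0) := fun l => Ω ∩ cube k M₀ l with hQ
  have hQb : ∀ i, IsBlockUnion k (Q i) := fun i => isBlockUnion_inter hΩb (isBlockUnion_cube hC hk i)
  have hQΩ : ∀ i, Q i ⊆ Ω := fun i => Finset.inter_subset_left
  have hα : ∀ i, ‖aLet a' P.eps⁻¹ U k Q (hT k M₀) i‖ ≤ 4 * P.spacing k ^ 2 / min 1 (a / 2) := by
    intro i
    have hG := norm_l2_gBox_le_spacing hk1 hk ha U (hQb i)
      (fun b hb hbb => hInt b ((mem_starB _ _).2 ⟨hQΩ i ((mem_starB _ _).1 hb).1, hQΩ i ((mem_starB _ _).1 hb).2⟩) hbb)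
      (fun x hx => hTree x (hQΩ i hx)) hsmall
    have h1 := norm_l2_mulR_le_one (abs_hT_le_one hC i)
    unfold aLet
    calc ‖mulR (hT k M₀ i) * gBox a' P.eps⁻¹ U k (Q i) * mulR (hT k M₀ i)‖
        ≤ ‖mulR (hT k M₀ i)‖ * ‖gBox a' P.eps⁻¹ U k (Q i)‖ * ‖mulR (hT k M₀ i)‖ :=
          (norm_mul_le _ _).trans (mul_le_mul_of_nonneg_right (norm_mul_le _ _) (norm_nonneg _))
      _ ≤ 1 * (4 * P.spacing k ^ 2 / min 1 (a / 2)) * 1 :=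
          mul_le_mul (mul_le_mul h1 hG (norm_nonneg _) zero_le_one) h1 (norm_nonneg _) (by positivity)
      _ = _ := by ring
  have hβ' : ∀ i, ‖bLet a' P.eps⁻¹ U k Q (hT k M₀) i‖ ≤ C / M₀ := by
    intro i
    unfold bLet
    calc ‖kLet a' P.eps⁻¹ U k Q (hT k M₀) i * gBox a' P.eps⁻¹ U k (Q i) * mulR (hT k M₀ i)‖
        ≤ ‖kLet a' P.eps⁻¹ U k Q (hT k M₀) i * gBox a' P.eps⁻¹ U k (Q i)‖ * ‖mulR (hT k M₀ i)‖ := norm_mul_le _ _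
      _ ≤ C / M₀ * 1 := mul_le_mul (hβ i) (norm_l2_mulR_le_one (abs_hT_le_one hC i)) (norm_nonneg _) (by positivity)
      _ = C / M₀ := mul_one _
  have h := hasSum_walkTerm LabAdj
    (fun _ _ hil => (letters_mul_eq_zero_of_not_labAdj hC hk a' P.eps⁻¹ U Q hil).1)
    (fun _ _ hil => (letters_mul_eq_zero_of_not_labAdj hC hk a' P.eps⁻¹ U Q hil).2)
    hα hβ' (card_filter_labAdj_le hC) hDβ hR1 (gBox_mul_one_sub_rOp (isLocalization_cubes hC hk hΩb) hk hc ha' U hΩb)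
  exact h

end Assembly

/-! ## §6 (v1.1, append-only) Lemma 2.1 (2.15) members two to four as operator bounds, the whole-torus corollary of (2.13) in gen 26's
shape, and more `M`-aligned regions (windows, intersections) -/

section Riders

open scoped Matrix.Norms.L2Operator

variable {k M₀ : ℕ}

/-- kernel: the `L² → L²` norm of a RECTANGULAR kernel from a bound `‖Af‖₂ ≤ C‖f‖₂` (bond-indexed rows: `χ_QD_u`).
[cite: Balaban1983RegularityDecay, (2.15) p.577] -/
theorem l2_opNorm_rect_le_of_l2n_le {m n : Type*} [Fintype m] [Fintype n] [DecidableEq n] {A : Matrix m n ℂ} {C : ℝ} (hC : 0 ≤ C)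
    (h : ∀ f : n → ℂ, l2n (A *ᵥ f) ≤ C * l2n f) : ‖A‖ ≤ C := by
  rw [l2_opNorm_def]
  refine ContinuousLinearMap.opNorm_le_bound _ hC fun v => ?_
  have h1 := h (WithLp.ofLp v)
  unfold l2n at h1
  exact h1

/-- **LEMMA 2.1 (2.15), SECOND MEMBER AS AN OPERATOR BOUND: `‖(χ_QD_u)G_k(Q,u)‖_{2→2} ≤ m₁^{−1/2}`** — printed `‖D^η_{A,μ}G_k(□,A)f‖₂ ≦ c₂‖f‖₂`,
all bonds of `Q*` at once, for every `k`-block union `Q` and every `U(1)` field small on `Q` in the coercivity sense.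
[cite: Balaban1983RegularityDecay, (2.15) p.577] -/
theorem norm_l2_dN_gBox_le (hk : j + k ≤ P.m + P.K) {a c : ℝ} (hc : c ≠ 0) (ha : 0 < a) (U : GaugeField P j U1)
    {Q : Finset (Balaban1983to89.Site P j)} (hQ : IsBlockUnion k Q) {T δ : ℝ}
    (hInt : ∀ b ∈ starB Q, blkIter k b.src = blkIter k b.tgt → ‖toC (U b) - 1‖ ≤ T)
    (hTree : ∀ x ∈ Q, ‖holCK U k x - 1‖ ≤ δ)
    (hsmall : 2 * (((P.L : ℝ) ^ k - 1) * (P.L : ℝ) ^ k) * P.d * T ^ 2 + 2 * δ ^ 2 ≤ 1 / 2) :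
    ‖dN c U Q * gBox a c U k Q‖ ≤ Real.sqrt ((mOne P a c k)⁻¹) := by
  classical
  refine l2_opNorm_rect_le_of_l2n_le (Real.sqrt_nonneg _) fun f => ?_
  rw [← mulVec_mulVec]
  have hE := sqrt_energy_gBox_le hk hc ha U hQ hInt hTree hsmall f
  refine le_trans (le_of_eq ?_) hE
  rw [l2n_eq_sqrt]
  congr 1
  -- `Σ_b |(χ_QD_u φ)(b)|² = Σ_{b∈Q*} |(D_uφ)(b)|²`
  rw [← Finset.sum_filter_add_sum_filter_not univ (fun b => b ∈ starB Q)]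
  have hS : univ.filter (fun b : PBond P j => b ∈ starB Q) = starB Q := by ext b; simp
  rw [hS, Finset.sum_eq_zero (s := univ.filter fun b : PBond P j => ¬ b ∈ starB Q) fun b hb => ?_, add_zero]
  · exact Finset.sum_congr rfl fun b hb => by rw [dN_mulVec, if_pos hb]
  · rw [dN_mulVec, if_neg (mem_filter.1 hb).2, norm_zero]; simp

/-- **LEMMA 2.1 (2.15), THIRD MEMBER AS AN OPERATOR BOUND: `‖G_k(Q,u)(χ_QD_u)ᴴ‖_{2→2} ≤ m₁^{−1/2}`** — printed `‖G_k(□,A)D^{η*}_{A,μ}f‖₂ ≦ c₂‖f‖₂`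
(by duality: `G_k(Q,u)` is Hermitian, `‖Bᴴ‖ = ‖B‖`). [cite: Balaban1983RegularityDecay, (2.15) p.577] -/
theorem norm_l2_gBox_dN_conjTranspose_le (hk : j + k ≤ P.m + P.K) {a c : ℝ} (hc : c ≠ 0) (ha : 0 < a) (U : GaugeField P j U1)
    {Q : Finset (Balaban1983to89.Site P j)} (hQ : IsBlockUnion k Q) {T δ : ℝ}
    (hInt : ∀ b ∈ starB Q, blkIter k b.src = blkIter k b.tgt → ‖toC (U b) - 1‖ ≤ T)
    (hTree : ∀ x ∈ Q, ‖holCK U k x - 1‖ ≤ δ)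
    (hsmall : 2 * (((P.L : ℝ) ^ k - 1) * (P.L : ℝ) ^ k) * P.d * T ^ 2 + 2 * δ ^ 2 ≤ 1 / 2) :
    ‖gBox a c U k Q * (dN c U Q)ᴴ‖ ≤ Real.sqrt ((mOne P a c k)⁻¹) := by
  classical
  have hN := isUnit_nPad hk hc ha U hQ
  have e : gBox a c U k Q * (dN c U Q)ᴴ = (dN c U Q * gBox a c U k Q)ᴴ := by
    rw [conjTranspose_mul, gBox_conjTranspose hN]
  rw [e, l2_opNorm_conjTranspose]
  exact norm_l2_dN_gBox_le hk hc ha U hQ hInt hTree hsmall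

/-- **LEMMA 2.1 (2.15), FOURTH MEMBER AS AN OPERATOR BOUND: `‖(χ_QD_u)G_k(Q,u)(χ_QD_u)ᴴ‖_{2→2} ≤ 1`** — printed
`‖D^η_{A,μ}G_k(□,A)D^{η*}_{A,ν}f‖₂ ≦ c₂‖f‖₂`, for EVERY `U(1)` field (no smallness needed): with `B = DGDᴴ`, `G = GHG` and `H = DᴴD + aQᴴQ` give
`⟨g, Bg⟩ = ‖Bg‖² + a‖QGDᴴg‖² ≥ ‖Bg‖²`, and `⟨g,Bg⟩ ≤ ‖g‖‖Bg‖`. [cite: Balaban1983RegularityDecay, (2.15) p.577] -/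
theorem norm_l2_dN_gBox_dN_conjTranspose_le (hk : j + k ≤ P.m + P.K) {a c : ℝ} (hc : c ≠ 0) (ha : 0 < a) (U : GaugeField P j U1)
    {Q : Finset (Balaban1983to89.Site P j)} (hQ : IsBlockUnion k Q) : ‖dN c U Q * gBox a c U k Q * (dN c U Q)ᴴ‖ ≤ 1 := by
  classical
  have hN := isUnit_nPad hk hc ha U hQ
  set D := dN c U Q with hD
  set G := gBox a c U k Q with hG
  set B := D * G * Dᴴ with hB
  have hGh : Gᴴ = G := gBox_conjTranspose hN
  have hBh : Bᴴ = B := by rw [hB, conjTranspose_mul, conjTranspose_mul, conjTranspose_conjTranspose, hGh, Matrix.mul_assoc]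
  -- `B = BᴴB + a·(QGDᴴ)ᴴ(QGDᴴ)` from `GHG = G`, `H = DᴴD + aQᴴQ`
  have hGHG : G * nOp a c U k Q * G = G := by rw [hG, gBox_mul_nOp hN, proj_mul_gBox hN]
  have hsplit : B = Bᴴ * B + (a : ℂ) • ((qMatK U k Q * G * Dᴴ)ᴴ * (qMatK U k Q * G * Dᴴ)) := by
    have e1 : Bᴴ * B = D * G * (Dᴴ * D) * G * Dᴴ := by
      rw [hBh, hB]; simp only [Matrix.mul_assoc]
    have e2 : (qMatK U k Q * G * Dᴴ)ᴴ * (qMatK U k Q * G * Dᴴ) = D * G * ((qMatK U k Q)ᴴ * qMatK U k Q) * G * Dᴴ := by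
      rw [conjTranspose_mul, conjTranspose_mul, conjTranspose_conjTranspose, hGh]; simp only [Matrix.mul_assoc]
    rw [e1, e2]
    calc B = D * (G * nOp a c U k Q * G) * Dᴴ := by rw [hGHG]
      _ = D * G * ((Dᴴ * D) + (a : ℂ) • ((qMatK U k Q)ᴴ * qMatK U k Q)) * G * Dᴴ := by
          rw [nOp_eq]; simp only [Matrix.mul_assoc, hD]
      _ = _ := by rw [Matrix.mul_add, Matrix.add_mul, Matrix.add_mul, Matrix.mul_smul, Matrix.smul_mul, Matrix.smul_mul]
  refine l2_opNorm_le_of_l2n_le zero_le_one fun g => ?_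
  rw [one_mul]
  -- `‖Bg‖₂² ≤ Re⟨g, Bg⟩ ≤ ‖g‖₂‖Bg‖₂`
  have hform : l2n (B *ᵥ g) ^ 2 ≤ (star g ⬝ᵥ (B *ᵥ g)).re := by
    conv_rhs => rw [hsplit]
    rw [Matrix.add_mulVec, dotProduct_add, Complex.add_re, Matrix.smul_mulVec, dotProduct_smul, smul_eq_mul,
      BIJ88NeumannPropagatorSmallFieldRegion.star_dotProduct_gram_mulVec, BIJ88NeumannPropagatorSmallFieldRegion.star_dotProduct_gram_mulVec]
    have h1 : (star (B *ᵥ g) ⬝ᵥ (B *ᵥ g)).re = l2n (B *ᵥ g) ^ 2 := by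
      rw [l2n_sq]
      simp only [dotProduct, Pi.star_apply, Complex.re_sum]
      exact Finset.sum_congr rfl fun x _ => by rw [Complex.star_def, Complex.conj_mul', ← Complex.ofReal_pow, Complex.ofReal_re]
    have h2 : 0 ≤ ((a : ℂ) * (star ((qMatK U k Q * G * Dᴴ) *ᵥ g) ⬝ᵥ ((qMatK U k Q * G * Dᴴ) *ᵥ g))).re := by
      rw [Complex.re_ofReal_mul]
      refine mul_nonneg ha.le ?_
      simp only [dotProduct, Pi.star_apply, Complex.re_sum]
      exact Finset.sum_nonneg fun x _ => by rw [Complex.star_def, Complex.conj_mul', ← Complex.ofReal_pow, Complex.ofReal_re]; positivity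
    linarith
  have hcs : (star g ⬝ᵥ (B *ᵥ g)).re ≤ l2n g * l2n (B *ᵥ g) := (Complex.re_le_norm _).trans (norm_star_dotProduct_le _ _)
  by_cases h0 : l2n (B *ᵥ g) = 0
  · rw [h0]; exact l2n_nonneg g
  · have hpos : 0 < l2n (B *ᵥ g) := lt_of_le_of_ne (l2n_nonneg _) (Ne.symm h0)
    have h1 : l2n (B *ᵥ g) * l2n (B *ᵥ g) ≤ l2n g * l2n (B *ᵥ g) := by nlinarith
    exact le_of_mul_le_mul_right h1 hpos

/-- kernel: intersections of `M`-aligned regions are `M`-aligned. [cite: Balaban1983RegularityDecay, §2 p.575] -/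
theorem IsMAligned.inter {Ω₁ Ω₂ : Finset (Balaban1983to89.Site P j)} (h₁ : IsMAligned k M₀ Ω₁) (h₂ : IsMAligned k M₀ Ω₂) :
    IsMAligned k M₀ (Ω₁ ∩ Ω₂) := by
  intro x hx y hy
  exact mem_inter.2 ⟨h₁ x (mem_inter.1 hx).1 y hy, h₂ x (mem_inter.1 hx).2 y hy⟩

/-- **THE WINDOWS `□_i` ARE `M`-ALIGNED** (each is the union of `2^d` grid blocks: «□_j = Ω ∩ {a sum of large blocks for which the point Mj is
one of the vertices}», p. 575), hence so is every union / intersection of windows with `M`-aligned regions (`IsMAligned.union`, `.inter`).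
[cite: Balaban1983RegularityDecay, §2 p.575] -/
theorem isMAligned_cube (hC : CubeSize P j k M₀) (i : Lab P j k M₀) : IsMAligned k M₀ (cube k M₀ i) := by
  intro x hx y hy
  rw [mem_cube] at hx ⊢
  intro μ
  obtain ⟨z, hz, ex⟩ := hx μ
  rw [Finset.mem_Ico] at hz
  have hh : 0 < half P k M₀ := hC.pos_half
  set M : ℕ := half P k M₀ with hMdef
  set v : ℕ := (x μ).val with hv
  set w : ℕ := (y μ).val with hw
  -- `w − v = (w mod M) − (v mod M)` (same grid block)
  have hq : w / M = v / M := hy μ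
  have h1 := Nat.div_add_mod v M
  have h2 := Nat.div_add_mod w M
  rw [hq] at h2
  have hrv := Nat.mod_lt v hh
  have hrw := Nat.mod_lt w hh
  -- `z ≡ v (mod M)`: from `x_μ = Mi_μ + z (mod NM)`
  have hS := nLab_mul_half hC
  have exv : (((v : ℕ) : ℤ) : ZMod (P.sitesPerDir j)) = x μ := by rw [hv, Int.cast_natCast, ZMod.natCast_zmod_val]
  have hdvdS : (P.sitesPerDir j : ℤ) ∣ (ctr k M₀ i μ + z) - (v : ℕ) := by
    rw [← ZMod.intCast_eq_intCast_iff_dvd_sub, exv, ex]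
  have hdvdM : (M : ℤ) ∣ z - (v : ℕ) := by
    have hMS : (M : ℤ) ∣ (P.sitesPerDir j : ℤ) := ⟨nLab P j k M₀, by rw [← hS]; push_cast; ring⟩
    have h3 : (M : ℤ) ∣ (ctr k M₀ i μ + z) - (v : ℕ) := hMS.trans hdvdS
    have h4 : (M : ℤ) ∣ ctr k M₀ i μ := ⟨(i μ : ℕ), by unfold ctr; rfl⟩
    have h5 : z - (v : ℕ) = ((ctr k M₀ i μ + z) - (v : ℕ)) - ctr k M₀ i μ := by ring
    rw [h5]; exact dvd_sub h3 h4
  have hmod : z % (M : ℤ) = ((v % M : ℕ) : ℤ) := by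
    rw [Int.natCast_mod]
    exact (Int.modEq_iff_dvd.2 hdvdM).symm
  -- `z = v mod M` or `z = v mod M − M`
  have hzval : z = ((v % M : ℕ) : ℤ) ∨ z = ((v % M : ℕ) : ℤ) - M := by
    by_cases h0 : 0 ≤ z
    · left; rw [← hmod, Int.emod_eq_of_lt h0 hz.2]
    · right
      have h6 : (z + M) % (M : ℤ) = z % (M : ℤ) := by simp
      have h7 : (z + M) % (M : ℤ) = z + M := Int.emod_eq_of_lt (by omega) (by omega)
      rw [hmod] at h6; omega
  refine ⟨z + ((w : ℕ) : ℤ) - (v : ℕ), ?_, ?_⟩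
  · rw [Finset.mem_Ico]
    zify at h1 h2 hrv hrw
    rcases hzval with hz1 | hz1 <;> constructor <;> omega
  · have exw : (((w : ℕ) : ℤ) : ZMod (P.sitesPerDir j)) = y μ := by rw [hw, Int.cast_natCast, ZMod.natCast_zmod_val]
    rw [← exw]
    push_cast
    rw [← exv] at ex
    have ex' : (((v : ℕ) : ℤ) : ZMod (P.sitesPerDir j)) = ((ctr k M₀ i μ : ℤ) : ZMod (P.sitesPerDir j)) + (z : ZMod (P.sitesPerDir j)) := by
      rw [ex]; push_cast; ring
    push_cast at ex'
    linear_combination ex'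

/-- **(2.13) FOR `G_k(u) = G_k(T^{(0)},u)` IN GEN 26's SHAPE, UNDER COERCIVITY SMALLNESS ONLY**: for every torus of the series (any `d`, any `L`),
every `1 ≤ k ≤ m + K`, every cube size of file 1 with `M₀ ≥ M₁(d,a)` and every `U(1)` field with in-block bond variables `|u_b − 1| ≤ T`, block
transports `|u(Γ^{(k)}) − 1| ≤ δ`, `2(L^k−1)L^k·d·T² + 2δ² ≤ ½` (no plaquette condition, no `d ≤ 2`),
`HasSum (piece … (fun i => □_i) h) (G_k(T^{(0)},u))` — the same proposition as gen 26's `BIJ88NeumannRandomWalkSmallFieldTorus.hasSum_piece_torus`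
conclusion (`Ω = T` is `M`-aligned, `T ∩ □_i = □_i`). [cite: Balaban1983RegularityDecay, (2.13) p.577] -/
theorem hasSum_piece_univ_l2 (d : ℕ) {a : ℝ} (ha : 0 < a) :
    ∃ M₁ : ℕ, ∀ (P : Params), P.d = d → ∀ k : ℕ, 1 ≤ k → 0 + k ≤ P.m + P.K →
      ∀ M₀ : ℕ, CubeSize P 0 k M₀ → M₁ ≤ M₀ →
      ∀ (U : GaugeField P 0 U1) (T δ : ℝ),
        (∀ b : PBond P 0, blkIter k b.src = blkIter k b.tgt → ‖toC (U b) - 1‖ ≤ T) →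
        (∀ y : Balaban1983to89.Site P 0, ‖holCK U k y - 1‖ ≤ δ) →
        2 * (((P.L : ℝ) ^ k - 1) * (P.L : ℝ) ^ k) * P.d * T ^ 2 + 2 * δ ^ 2 ≤ 1 / 2 →
      HasSum (piece (B1RG242Torus.α P a k * (P.L : ℝ) ^ (k * P.d)) P.eps⁻¹ U k (fun i : Lab P 0 k M₀ => cube k M₀ i) (hT k M₀))
        (gBox (B1RG242Torus.α P a k * (P.L : ℝ) ^ (k * P.d)) P.eps⁻¹ U k univ) := by
  obtain ⟨M₁, H⟩ := hasSum_piece_l2 d ha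
  refine ⟨M₁, ?_⟩
  intro P hPd k hk1 hk M₀ hC hM U T δ hInt hTree hsmall
  have h := H P hPd k hk1 hk M₀ hC hM univ isMAligned_univ U T δ (fun b _ hb => hInt b hb) (fun y _ => hTree y) hsmall
  simp only [Finset.univ_inter] at h
  exact h

end Riders

/-! ## §7 (v1.1, append-only) THE SAME CONCLUSIONS UNDER THE PRINTED SMALL-PLAQUETTE HYPOTHESIS, WITH NO GAUGE CONDITION

[6]'s hypothesis on the field in Lemma 2.1 and (2.12)/(2.13) is the regularity condition (1.7) on `A` (*"let A be as in the theorem"*);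
in the `U(1)` lattice language of [BalabanImbrieJaffe1985] §7.3 it is (7.3.1), small plaquette variables `|u(∂p) − 1| ≤ θ`, and *"by
change of gauge u_k can be transformed in a local region Λ into a configuration of the form exp[ie_kηA], where A is smooth and small"*
(p. 326).  Two tree devices make the translation free of any gauge condition: (a) every operator of the expansion transforms by the
unitary conjugation `X ↦ M_gXM_gᴴ` under `u ↦ u^g` ([BalabanImbrieJaffe1988] p. 265 — gen 25 §5 `kLet_gaugeAct`, `rOp_gaugeAct`,
`gZero_mul_pow_rOp_gaugeAct`, `piece_gaugeAct`; gen 15 `gBox_gaugeAct`), and the `L₂ → L₂` norm is INVARIANT under it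
(`norm_l2_mulOp_sandwich`); (b) p34's BLOCKWISE centred axial gauge (`BIJ88NeumannPropagatorSmallPlaquetteRegion.smallField_blockGauge`,
p27 gen 34's device) turns `|u(∂p) − 1| ≤ θ` on the torus into the coercivity hypotheses of §4–§5 for `u^g`, with `T ≥ (d−1)(L^k−1)θ` and
`δ = d(L^k−1)T`, as soon as `2(L^k−1) + 4 < |T^{(0)}|`.  Hence (2.15), §4's letter bound, §5's bound on `‖R‖_{2→2}`, (2.12) and (2.13)
hold FOR `u` ITSELF, for every `M`-aligned `Ω`, under `|u(∂p) − 1| ≤ θ` and the displayed smallness — a threshold on `θ` depending on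
`(d, L^k)` only, the hypothesis list of p34's `decay_kernel_smallPlaquette_region_uniform` verbatim. -/

section Plaquette

open scoped Matrix.Norms.L2Operator
open BIJ88DeltaLoc234Torus (mulOp conjTranspose_mul_mulOp gBox_gaugeAct)
open GaugeField (gaugeAct plaqHol)
open BIJ85CentredAxialGauge (centredGauge)
open BIJ88NeumannPropagatorSmallPlaquetteRegion (smallField_blockGauge)

variable {k M₀ : ℕ}

/-- kernel: `‖M_g‖_{2→2} ≤ 1` (`|g(x)| = 1`). [cite: BalabanImbrieJaffe1988, p.265] -/
theorem norm_l2_mulOp_le_one (g : GaugeTransf P j U1) : ‖mulOp g‖ ≤ 1 := by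
  unfold mulOp
  exact l2_opNorm_diagonal_le zero_le_one fun x => (norm_toC (g x)).le

/-- kernel: `M_gᴴ(M_gXM_gᴴ)M_g = X` (`M_gᴴM_g = 1`). [cite: BalabanImbrieJaffe1988, p.265] -/
theorem mulOp_unsandwich (g : GaugeTransf P j U1) (X : Matrix (Balaban1983to89.Site P j) (Balaban1983to89.Site P j) ℂ) :
    (mulOp g)ᴴ * (mulOp g * X * (mulOp g)ᴴ) * mulOp g = X := by
  calc (mulOp g)ᴴ * (mulOp g * X * (mulOp g)ᴴ) * mulOp g = (mulOp g)ᴴ * mulOp g * X * ((mulOp g)ᴴ * mulOp g) := by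
        simp only [Matrix.mul_assoc]
    _ = X := by rw [conjTranspose_mul_mulOp, Matrix.one_mul, Matrix.mul_one]

/-- kernel: `(M_gXM_gᴴ)(M_gYM_gᴴ) = M_g(XY)M_gᴴ`. [cite: BalabanImbrieJaffe1988, p.265] -/
theorem mulOp_sandwich_mul_sandwich (g : GaugeTransf P j U1) (X Y : Matrix (Balaban1983to89.Site P j) (Balaban1983to89.Site P j) ℂ) :
    mulOp g * X * (mulOp g)ᴴ * (mulOp g * Y * (mulOp g)ᴴ) = mulOp g * (X * Y) * (mulOp g)ᴴ := by
  calc mulOp g * X * (mulOp g)ᴴ * (mulOp g * Y * (mulOp g)ᴴ) = mulOp g * X * ((mulOp g)ᴴ * mulOp g) * Y * (mulOp g)ᴴ := by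
        simp only [Matrix.mul_assoc]
    _ = mulOp g * (X * Y) * (mulOp g)ᴴ := by rw [conjTranspose_mul_mulOp, Matrix.mul_one]; simp only [Matrix.mul_assoc]

/-- **THE `L₂ → L₂` NORM IS GAUGE INVARIANT: `‖M_gXM_gᴴ‖_{2→2} = ‖X‖_{2→2}`** (`M_g` unitary). [cite: BalabanImbrieJaffe1988, p.265] -/
theorem norm_l2_mulOp_sandwich (g : GaugeTransf P j U1) (X : Matrix (Balaban1983to89.Site P j) (Balaban1983to89.Site P j) ℂ) :
    ‖mulOp g * X * (mulOp g)ᴴ‖ = ‖X‖ := by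
  have h1 : ‖mulOp g‖ ≤ 1 := norm_l2_mulOp_le_one g
  have h2 : ‖(mulOp g)ᴴ‖ ≤ 1 := by rw [l2_opNorm_conjTranspose]; exact h1
  have key : ∀ (A B Y : Matrix (Balaban1983to89.Site P j) (Balaban1983to89.Site P j) ℂ), ‖A‖ ≤ 1 → ‖B‖ ≤ 1 → ‖A * Y * B‖ ≤ ‖Y‖ :=
    fun A B Y hA hB =>
    calc ‖A * Y * B‖ ≤ ‖A * Y‖ * ‖B‖ := norm_mul_le _ _
      _ ≤ ‖A‖ * ‖Y‖ * ‖B‖ := mul_le_mul_of_nonneg_right (norm_mul_le _ _) (norm_nonneg _)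
      _ ≤ 1 * ‖Y‖ * 1 := mul_le_mul (mul_le_mul_of_nonneg_right hA (norm_nonneg _)) hB (norm_nonneg _) (by positivity)
      _ = ‖Y‖ := by ring
  refine le_antisymm (key _ _ _ h1 h2) ?_
  calc ‖X‖ = ‖(mulOp g)ᴴ * (mulOp g * X * (mulOp g)ᴴ) * mulOp g‖ := by rw [mulOp_unsandwich]
    _ ≤ ‖mulOp g * X * (mulOp g)ᴴ‖ := key _ _ _ h2 h1

/-- kernel: an unconditional sum of conjugated kernels un-conjugates (the sum is in the product topology; multiplication is continuous).
[cite: BalabanImbrieJaffe1988, p.265] -/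
theorem hasSum_of_hasSum_mulOp_sandwich {ι : Type*} (g : GaugeTransf P j U1)
    {f : ι → Matrix (Balaban1983to89.Site P j) (Balaban1983to89.Site P j) ℂ} {A : Matrix (Balaban1983to89.Site P j) (Balaban1983to89.Site P j) ℂ}
    (h : HasSum (fun i => mulOp g * f i * (mulOp g)ᴴ) (mulOp g * A * (mulOp g)ᴴ)) : HasSum f A := by
  have h2 := (h.mul_left (mulOp g)ᴴ).mul_right (mulOp g)
  simp only [mulOp_unsandwich] at h2
  exact h2

/-- **LEMMA 2.1 (2.15) UNDER (7.3.1): `‖G_k(Q,u)‖_{2→2} ≤ 4(L^kε)²/min(1,a/2)`** for the operator of record, EVERY `k`-block union `Q ⊆ T^{(0)}`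
and every `U(1)` field with `|u(∂p) − 1| ≤ θ` for all plaquettes, `θ` small as displayed, `2(L^k−1) + 4 < |T^{(0)}|` — no gauge condition
(`G_k(Q,u^g) = M_gG_k(Q,u)M_gᴴ`, gen 15; the blockwise gauge, p34). [cite: Balaban1983RegularityDecay, (2.15) p.577] -/
theorem norm_l2_gBox_le_smallPlaquette {k : ℕ} (hk1 : 1 ≤ k) (hk : 0 + k ≤ P.m + P.K) (hR : 2 * (P.L ^ k - 1) + 4 < P.sitesPerDir 0)
    {a : ℝ} (ha : 0 < a) (U : GaugeField P 0 U1) {θ : ℝ} (hθ : 0 ≤ θ)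
    (hplaq : ∀ p : Balaban1983to89.Plaq P 0, ‖toC (plaqHol U p) - 1‖ ≤ θ) {T : ℝ}
    (hTθ : ((P.d - 1 : ℕ) : ℝ) * ((P.L : ℝ) ^ k - 1) * θ ≤ T)
    (hsmall : 2 * (((P.L : ℝ) ^ k - 1) * (P.L : ℝ) ^ k) * P.d * T ^ 2 + 2 * (P.d * ((P.L : ℝ) ^ k - 1) * T) ^ 2 ≤ 1 / 2)
    {Q : Finset (Balaban1983to89.Site P 0)} (hQ : IsBlockUnion k Q) :
    ‖gBox (B1RG242Torus.α P a k * (P.L : ℝ) ^ (k * P.d)) P.eps⁻¹ U k Q‖ ≤ 4 * P.spacing k ^ 2 / min 1 (a / 2) := by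
  have hLr : (1 : ℝ) < P.L := B1RG242Torus.one_lt_cast_L P
  have ha' : 0 < B1RG242Torus.α P a k * (P.L : ℝ) ^ (k * P.d) := by
    have := B1.aSeq_pos ha hLr hk1; have := P.spacing_pos k; have := P.cast_L_pos
    unfold B1RG242Torus.α; positivity
  have hc : P.eps⁻¹ ≠ 0 := inv_ne_zero P.eps_pos.ne'
  obtain ⟨hbond, htree⟩ := smallField_blockGauge hk U hθ hplaq hR hTθ
  set g : GaugeTransf P 0 U1 := fun z => centredGauge U (cornerIter k (blkIter k z)) (P.L ^ k - 1) z with hg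
  have h1 := norm_l2_gBox_le_spacing hk1 hk ha (gaugeAct g U) hQ (fun b _ hb => hbond b hb) (fun x _ => htree x) hsmall
  rwa [gBox_gaugeAct hk hc ha' g U hQ, norm_l2_mulOp_sandwich] at h1

/-- **THE LETTER BOUND OF §4 UNDER (7.3.1)**: with the constant `C(d,a)` of `norm_l2_letter_le`, for every torus of the series, every
`1 ≤ k ≤ m + K` with `2(L^k−1) + 4 < |T^{(0)}|`, every cube size, every `M`-aligned `k`-block union `Ω`, every `U(1)` field with
`|u(∂p) − 1| ≤ θ` for all plaquettes (`θ` small as displayed) and every window: `‖K_iG_k(Ω∩□_i,u)‖_{2→2} ≤ C/M₀` — no gauge condition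
(`K_i[u^g]G_k(Q_i,u^g) = M_g(K_i[u]G_k(Q_i,u))M_gᴴ`). [cite: Balaban1983RegularityDecay, (2.21) p.578] -/
theorem norm_l2_letter_le_smallPlaquette (d : ℕ) {a : ℝ} (ha : 0 < a) :
    ∃ C : ℝ, 0 < C ∧ ∀ (P : Params), P.d = d → ∀ k : ℕ, 1 ≤ k → 0 + k ≤ P.m + P.K → 2 * (P.L ^ k - 1) + 4 < P.sitesPerDir 0 →
      ∀ M₀ : ℕ, CubeSize P 0 k M₀ → ∀ (Ω : Finset (Balaban1983to89.Site P 0)), IsMAligned k M₀ Ω →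
      ∀ (U : GaugeField P 0 U1) (θ : ℝ), 0 ≤ θ → (∀ p : Balaban1983to89.Plaq P 0, ‖toC (plaqHol U p) - 1‖ ≤ θ) →
        ∀ (T : ℝ), ((P.d - 1 : ℕ) : ℝ) * ((P.L : ℝ) ^ k - 1) * θ ≤ T →
          2 * (((P.L : ℝ) ^ k - 1) * (P.L : ℝ) ^ k) * P.d * T ^ 2 + 2 * (P.d * ((P.L : ℝ) ^ k - 1) * T) ^ 2 ≤ 1 / 2 →
      ∀ i : Lab P 0 k M₀,
        ‖kLet (B1RG242Torus.α P a k * (P.L : ℝ) ^ (k * P.d)) P.eps⁻¹ U k (fun l => Ω ∩ cube k M₀ l) (hT k M₀) i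
            * gBox (B1RG242Torus.α P a k * (P.L : ℝ) ^ (k * P.d)) P.eps⁻¹ U k (Ω ∩ cube k M₀ i)‖ ≤ C / M₀ := by
  obtain ⟨C, hC0, H⟩ := norm_l2_letter_le d ha
  refine ⟨C, hC0, ?_⟩
  intro P hPd k hk1 hk hR M₀ hC Ω hΩ U θ hθ hplaq T hTθ hsmall i
  have hLr : (1 : ℝ) < P.L := B1RG242Torus.one_lt_cast_L P
  have ha' : 0 < B1RG242Torus.α P a k * (P.L : ℝ) ^ (k * P.d) := by
    have := B1.aSeq_pos ha hLr hk1; have := P.spacing_pos k; have := P.cast_L_pos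
    unfold B1RG242Torus.α; positivity
  have hc : P.eps⁻¹ ≠ 0 := inv_ne_zero P.eps_pos.ne'
  have hΩb : IsBlockUnion k Ω := hΩ.isBlockUnion hk
  have hQb : ∀ l : Lab P 0 k M₀, IsBlockUnion k (Ω ∩ cube k M₀ l) := fun l => isBlockUnion_inter hΩb (isBlockUnion_cube hC hk l)
  obtain ⟨hbond, htree⟩ := smallField_blockGauge hk U hθ hplaq hR hTθ
  set g : GaugeTransf P 0 U1 := fun z => centredGauge U (cornerIter k (blkIter k z)) (P.L ^ k - 1) z with hg
  have h1 := H P hPd k hk1 hk M₀ hC Ω hΩ (gaugeAct g U) T (P.d * ((P.L : ℝ) ^ k - 1) * T) (fun b _ hb => hbond b hb) (fun y _ => htree y)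
    hsmall i
  rwa [kLet_gaugeAct (fun l : Lab P 0 k M₀ => Ω ∩ cube k M₀ l) (hT k M₀) g U hk, gBox_gaugeAct hk hc ha' g U (hQb i),
    mulOp_sandwich_mul_sandwich, norm_l2_mulOp_sandwich] at h1

/-- **«THE L₂-NORM OF THE OPERATOR R … IS SMALL FOR M LARGE ENOUGH» UNDER (7.3.1)**: with the constant `C(d,a)` of `norm_l2_letter_le`,
`‖R‖_{2→2} ≤ 2^d·C/M₀` for every `M`-aligned `Ω` and every field with small plaquette variables as displayed — no gauge condition
(`R[u^g] = M_gR[u]M_gᴴ`, gen 25). [cite: Balaban1983RegularityDecay, (2.12) p.577] -/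
theorem norm_l2_rOp_cubes_le_smallPlaquette (d : ℕ) {a : ℝ} (ha : 0 < a) :
    ∃ C : ℝ, 0 < C ∧ ∀ (P : Params), P.d = d → ∀ k : ℕ, 1 ≤ k → 0 + k ≤ P.m + P.K → 2 * (P.L ^ k - 1) + 4 < P.sitesPerDir 0 →
      ∀ M₀ : ℕ, CubeSize P 0 k M₀ → ∀ (Ω : Finset (Balaban1983to89.Site P 0)), IsMAligned k M₀ Ω →
      ∀ (U : GaugeField P 0 U1) (θ : ℝ), 0 ≤ θ → (∀ p : Balaban1983to89.Plaq P 0, ‖toC (plaqHol U p) - 1‖ ≤ θ) →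
        ∀ (T : ℝ), ((P.d - 1 : ℕ) : ℝ) * ((P.L : ℝ) ^ k - 1) * θ ≤ T →
          2 * (((P.L : ℝ) ^ k - 1) * (P.L : ℝ) ^ k) * P.d * T ^ 2 + 2 * (P.d * ((P.L : ℝ) ^ k - 1) * T) ^ 2 ≤ 1 / 2 →
      ‖rOp (B1RG242Torus.α P a k * (P.L : ℝ) ^ (k * P.d)) P.eps⁻¹ U k (fun l : Lab P 0 k M₀ => Ω ∩ cube k M₀ l) (hT k M₀)‖
        ≤ (2 ^ d : ℕ) * (C / M₀) := by
  obtain ⟨C, hC0, H⟩ := norm_l2_rOp_cubes_le d ha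
  refine ⟨C, hC0, ?_⟩
  intro P hPd k hk1 hk hR M₀ hC Ω hΩ U θ hθ hplaq T hTθ hsmall
  have hLr : (1 : ℝ) < P.L := B1RG242Torus.one_lt_cast_L P
  have ha' : 0 < B1RG242Torus.α P a k * (P.L : ℝ) ^ (k * P.d) := by
    have := B1.aSeq_pos ha hLr hk1; have := P.spacing_pos k; have := P.cast_L_pos
    unfold B1RG242Torus.α; positivity
  have hc : P.eps⁻¹ ≠ 0 := inv_ne_zero P.eps_pos.ne'
  have hΩb : IsBlockUnion k Ω := hΩ.isBlockUnion hk
  have hQb : ∀ l : Lab P 0 k M₀, IsBlockUnion k (Ω ∩ cube k M₀ l) := fun l => isBlockUnion_inter hΩb (isBlockUnion_cube hC hk l)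
  obtain ⟨hbond, htree⟩ := smallField_blockGauge hk U hθ hplaq hR hTθ
  set g : GaugeTransf P 0 U1 := fun z => centredGauge U (cornerIter k (blkIter k z)) (P.L ^ k - 1) z with hg
  have h1 := H P hPd k hk1 hk M₀ hC Ω hΩ (gaugeAct g U) T (P.d * ((P.L : ℝ) ^ k - 1) * T) (fun b _ hb => hbond b hb) (fun y _ => htree y)
    hsmall
  rwa [rOp_gaugeAct (fun l : Lab P 0 k M₀ => Ω ∩ cube k M₀ l) (hT k M₀) g U hk hc ha' hQb, norm_l2_mulOp_sandwich] at h1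

/-- **(2.12) IN THE `L₂`-NORM UNDER (7.3.1), EVERY `M`-ALIGNED BLOCK UNION**: with the threshold `M₁(d,a)` of `hasSum_gZero_mul_pow_l2`, for
every field with `|u(∂p) − 1| ≤ θ` for all plaquettes (`θ` small as displayed, `2(L^k−1) + 4 < |T^{(0)}|`) and `M₀ ≥ M₁`: `‖R‖_{2→2} < 1` and
`Σ_n G₀Rⁿ = G_k(Ω,u)` — no gauge condition (`G₀[u^g]R[u^g]ⁿ = M_g(G₀Rⁿ)M_gᴴ`, `G_k(Ω,u^g) = M_gG_k(Ω,u)M_gᴴ`, and `M_g` is unitary).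
[cite: Balaban1983RegularityDecay, (2.12) p.577] -/
theorem hasSum_gZero_mul_pow_l2_smallPlaquette (d : ℕ) {a : ℝ} (ha : 0 < a) :
    ∃ M₁ : ℕ, ∀ (P : Params), P.d = d → ∀ k : ℕ, 1 ≤ k → 0 + k ≤ P.m + P.K → 2 * (P.L ^ k - 1) + 4 < P.sitesPerDir 0 →
      ∀ M₀ : ℕ, CubeSize P 0 k M₀ → M₁ ≤ M₀ → ∀ (Ω : Finset (Balaban1983to89.Site P 0)), IsMAligned k M₀ Ω →
      ∀ (U : GaugeField P 0 U1) (θ : ℝ), 0 ≤ θ → (∀ p : Balaban1983to89.Plaq P 0, ‖toC (plaqHol U p) - 1‖ ≤ θ) →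
        ∀ (T : ℝ), ((P.d - 1 : ℕ) : ℝ) * ((P.L : ℝ) ^ k - 1) * θ ≤ T →
          2 * (((P.L : ℝ) ^ k - 1) * (P.L : ℝ) ^ k) * P.d * T ^ 2 + 2 * (P.d * ((P.L : ℝ) ^ k - 1) * T) ^ 2 ≤ 1 / 2 →
      ‖rOp (B1RG242Torus.α P a k * (P.L : ℝ) ^ (k * P.d)) P.eps⁻¹ U k (fun l : Lab P 0 k M₀ => Ω ∩ cube k M₀ l) (hT k M₀)‖ < 1 ∧
      HasSum (fun n : ℕ => gZero (B1RG242Torus.α P a k * (P.L : ℝ) ^ (k * P.d)) P.eps⁻¹ U k (fun l : Lab P 0 k M₀ => Ω ∩ cube k M₀ l) (hT k M₀)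
          * rOp (B1RG242Torus.α P a k * (P.L : ℝ) ^ (k * P.d)) P.eps⁻¹ U k (fun l : Lab P 0 k M₀ => Ω ∩ cube k M₀ l) (hT k M₀) ^ n)
        (gBox (B1RG242Torus.α P a k * (P.L : ℝ) ^ (k * P.d)) P.eps⁻¹ U k Ω) := by
  obtain ⟨M₁, H⟩ := hasSum_gZero_mul_pow_l2 d ha
  refine ⟨M₁, ?_⟩
  intro P hPd k hk1 hk hR M₀ hC hM Ω hΩ U θ hθ hplaq T hTθ hsmall
  have hLr : (1 : ℝ) < P.L := B1RG242Torus.one_lt_cast_L P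
  have ha' : 0 < B1RG242Torus.α P a k * (P.L : ℝ) ^ (k * P.d) := by
    have := B1.aSeq_pos ha hLr hk1; have := P.spacing_pos k; have := P.cast_L_pos
    unfold B1RG242Torus.α; positivity
  have hc : P.eps⁻¹ ≠ 0 := inv_ne_zero P.eps_pos.ne'
  have hΩb : IsBlockUnion k Ω := hΩ.isBlockUnion hk
  have hQb : ∀ l : Lab P 0 k M₀, IsBlockUnion k (Ω ∩ cube k M₀ l) := fun l => isBlockUnion_inter hΩb (isBlockUnion_cube hC hk l)
  obtain ⟨hbond, htree⟩ := smallField_blockGauge hk U hθ hplaq hR hTθ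
  set g : GaugeTransf P 0 U1 := fun z => centredGauge U (cornerIter k (blkIter k z)) (P.L ^ k - 1) z with hg
  obtain ⟨h1, h2⟩ := H P hPd k hk1 hk M₀ hC hM Ω hΩ (gaugeAct g U) T (P.d * ((P.L : ℝ) ^ k - 1) * T) (fun b _ hb => hbond b hb)
    (fun y _ => htree y) hsmall
  rw [rOp_gaugeAct (fun l : Lab P 0 k M₀ => Ω ∩ cube k M₀ l) (hT k M₀) g U hk hc ha' hQb, norm_l2_mulOp_sandwich] at h1
  refine ⟨h1, hasSum_of_hasSum_mulOp_sandwich g ?_⟩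
  have e : (fun n : ℕ => gZero (B1RG242Torus.α P a k * (P.L : ℝ) ^ (k * P.d)) P.eps⁻¹ (gaugeAct g U) k
        (fun l : Lab P 0 k M₀ => Ω ∩ cube k M₀ l) (hT k M₀)
          * rOp (B1RG242Torus.α P a k * (P.L : ℝ) ^ (k * P.d)) P.eps⁻¹ (gaugeAct g U) k (fun l : Lab P 0 k M₀ => Ω ∩ cube k M₀ l) (hT k M₀) ^ n)
      = fun n : ℕ => mulOp g * (gZero (B1RG242Torus.α P a k * (P.L : ℝ) ^ (k * P.d)) P.eps⁻¹ U k
        (fun l : Lab P 0 k M₀ => Ω ∩ cube k M₀ l) (hT k M₀)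
          * rOp (B1RG242Torus.α P a k * (P.L : ℝ) ^ (k * P.d)) P.eps⁻¹ U k (fun l : Lab P 0 k M₀ => Ω ∩ cube k M₀ l) (hT k M₀) ^ n) * (mulOp g)ᴴ :=
    funext fun n => gZero_mul_pow_rOp_gaugeAct _ _ g U hk hc ha' hQb n
  rwa [e, gBox_gaugeAct hk hc ha' g U hΩb] at h2

/-- **(2.13) THE RANDOM WALK EXPANSION OF `G_k(Ω,u)` OVER [6]'s CUBES CONVERGES UNDER (7.3.1), EVERY `M`-ALIGNED BLOCK UNION `Ω`**: with the
threshold `M₁(d,a)` of `hasSum_piece_l2`, for every field with `|u(∂p) − 1| ≤ θ` for all plaquettes (`θ` small as displayed,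
`2(L^k−1) + 4 < |T^{(0)}|`) and `M₀ ≥ M₁`, `G_k(Ω,u) = Σ_ω T_ω[u]` unconditionally — no gauge condition (`T_ω[u^g] = M_gT_ω[u]M_gᴴ`, gen 25
`piece_gaugeAct`). [cite: Balaban1983RegularityDecay, (2.13) p.577] -/
theorem hasSum_piece_l2_smallPlaquette (d : ℕ) {a : ℝ} (ha : 0 < a) :
    ∃ M₁ : ℕ, ∀ (P : Params), P.d = d → ∀ k : ℕ, 1 ≤ k → 0 + k ≤ P.m + P.K → 2 * (P.L ^ k - 1) + 4 < P.sitesPerDir 0 →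
      ∀ M₀ : ℕ, CubeSize P 0 k M₀ → M₁ ≤ M₀ → ∀ (Ω : Finset (Balaban1983to89.Site P 0)), IsMAligned k M₀ Ω →
      ∀ (U : GaugeField P 0 U1) (θ : ℝ), 0 ≤ θ → (∀ p : Balaban1983to89.Plaq P 0, ‖toC (plaqHol U p) - 1‖ ≤ θ) →
        ∀ (T : ℝ), ((P.d - 1 : ℕ) : ℝ) * ((P.L : ℝ) ^ k - 1) * θ ≤ T →
          2 * (((P.L : ℝ) ^ k - 1) * (P.L : ℝ) ^ k) * P.d * T ^ 2 + 2 * (P.d * ((P.L : ℝ) ^ k - 1) * T) ^ 2 ≤ 1 / 2 →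
      HasSum (piece (B1RG242Torus.α P a k * (P.L : ℝ) ^ (k * P.d)) P.eps⁻¹ U k (fun l : Lab P 0 k M₀ => Ω ∩ cube k M₀ l) (hT k M₀))
        (gBox (B1RG242Torus.α P a k * (P.L : ℝ) ^ (k * P.d)) P.eps⁻¹ U k Ω) := by
  obtain ⟨M₁, H⟩ := hasSum_piece_l2 d ha
  refine ⟨M₁, ?_⟩
  intro P hPd k hk1 hk hR M₀ hC hM Ω hΩ U θ hθ hplaq T hTθ hsmall
  have hLr : (1 : ℝ) < P.L := B1RG242Torus.one_lt_cast_L P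
  have ha' : 0 < B1RG242Torus.α P a k * (P.L : ℝ) ^ (k * P.d) := by
    have := B1.aSeq_pos ha hLr hk1; have := P.spacing_pos k; have := P.cast_L_pos
    unfold B1RG242Torus.α; positivity
  have hc : P.eps⁻¹ ≠ 0 := inv_ne_zero P.eps_pos.ne'
  have hΩb : IsBlockUnion k Ω := hΩ.isBlockUnion hk
  have hQb : ∀ l : Lab P 0 k M₀, IsBlockUnion k (Ω ∩ cube k M₀ l) := fun l => isBlockUnion_inter hΩb (isBlockUnion_cube hC hk l)
  obtain ⟨hbond, htree⟩ := smallField_blockGauge hk U hθ hplaq hR hTθ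
  set g : GaugeTransf P 0 U1 := fun z => centredGauge U (cornerIter k (blkIter k z)) (P.L ^ k - 1) z with hg
  have h1 := H P hPd k hk1 hk M₀ hC hM Ω hΩ (gaugeAct g U) T (P.d * ((P.L : ℝ) ^ k - 1) * T) (fun b _ hb => hbond b hb)
    (fun y _ => htree y) hsmall
  have e : piece (B1RG242Torus.α P a k * (P.L : ℝ) ^ (k * P.d)) P.eps⁻¹ (gaugeAct g U) k (fun l : Lab P 0 k M₀ => Ω ∩ cube k M₀ l) (hT k M₀)
      = fun ω => mulOp g * piece (B1RG242Torus.α P a k * (P.L : ℝ) ^ (k * P.d)) P.eps⁻¹ U k (fun l : Lab P 0 k M₀ => Ω ∩ cube k M₀ l)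
          (hT k M₀) ω * (mulOp g)ᴴ :=
    funext fun ω => piece_gaugeAct _ _ g U hk hc ha' hQb ω
  rw [e, gBox_gaugeAct hk hc ha' g U hΩb] at h1
  exact hasSum_of_hasSum_mulOp_sandwich g h1

/-- **(2.13) FOR `G_k(u) = G_k(T^{(0)},u)` IN GEN 26's SHAPE UNDER (7.3.1) ALONE** — every `d`, every `L`, every `1 ≤ k ≤ m + K` with
`2(L^k−1) + 4 < |T^{(0)}|`, every cube size with `M₀ ≥ M₁(d,a)`, every `U(1)` field with `|u(∂p) − 1| ≤ θ` for all plaquettes and `θ` small as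
displayed: `HasSum (piece … (fun i => □_i) h) (G_k(T^{(0)},u))` — the conclusion of gen 26's `BIJ88NeumannRandomWalkSmallFieldTorus.hasSum_piece_torus`
(there: `d ≤ 2`, `L` odd, plaquette AND coercivity hypotheses) from the plaquette hypothesis only. [cite: Balaban1983RegularityDecay, (2.13) p.577] -/
theorem hasSum_piece_univ_l2_smallPlaquette (d : ℕ) {a : ℝ} (ha : 0 < a) :
    ∃ M₁ : ℕ, ∀ (P : Params), P.d = d → ∀ k : ℕ, 1 ≤ k → 0 + k ≤ P.m + P.K → 2 * (P.L ^ k - 1) + 4 < P.sitesPerDir 0 →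
      ∀ M₀ : ℕ, CubeSize P 0 k M₀ → M₁ ≤ M₀ →
      ∀ (U : GaugeField P 0 U1) (θ : ℝ), 0 ≤ θ → (∀ p : Balaban1983to89.Plaq P 0, ‖toC (plaqHol U p) - 1‖ ≤ θ) →
        ∀ (T : ℝ), ((P.d - 1 : ℕ) : ℝ) * ((P.L : ℝ) ^ k - 1) * θ ≤ T →
          2 * (((P.L : ℝ) ^ k - 1) * (P.L : ℝ) ^ k) * P.d * T ^ 2 + 2 * (P.d * ((P.L : ℝ) ^ k - 1) * T) ^ 2 ≤ 1 / 2 →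
      HasSum (piece (B1RG242Torus.α P a k * (P.L : ℝ) ^ (k * P.d)) P.eps⁻¹ U k (fun i : Lab P 0 k M₀ => cube k M₀ i) (hT k M₀))
        (gBox (B1RG242Torus.α P a k * (P.L : ℝ) ^ (k * P.d)) P.eps⁻¹ U k univ) := by
  obtain ⟨M₁, H⟩ := hasSum_piece_l2_smallPlaquette d ha
  refine ⟨M₁, ?_⟩
  intro P hPd k hk1 hk hR M₀ hC hM U θ hθ hplaq T hTθ hsmall
  have h := H P hPd k hk1 hk hR M₀ hC hM univ isMAligned_univ U θ hθ hplaq T hTθ hsmall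
  simp only [Finset.univ_inter] at h
  exact h

end Plaquette

/-! ## §8 (v1.1, append-only) [BalabanImbrieJaffe1988] p. 264 «THE CONVERGENCE AND LOCALITY PROPERTIES OF THE RANDOM WALK EXPANSION»:
EVERY WALK TERM `T_ω[u]` OF (2.13) DEPENDS ON `u` ONLY THROUGH THE BONDS OF THE REGIONS `Q_i` IT VISITS

The convergence half is §5/§7; this is the locality half for the CONCRETE torus operators of gen 25 (p. 262 *"To localize the dependence on
u, we interpolate in a smooth fashion between operators with Neumann boundary conditions on small cubes"*; p. 264 *"the convergence and
locality properties of the random walk expansion imply the following facts about these operators. The local part … depends only on u in an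
O(r(e_k)) neighborhood of x₁, x₂ … The operator C_X(u) depends only on u in X"*).  The letters `a_i = h_iG_k(Q_i,u)h_i`,
`K_i = [h_i, H_{Q_i}(u)]`, `b_i = K_iG_k(Q_i,u)h_i` depend on `u` only through `Q_i*` (p34's `gBox_congr`, `nOp_congr`), hence `T_ω[u]` only
through `⋃_{i ∈ ω} Q_i*` — for [6]'s cubes, the bonds of `Ω` inside the windows `□_{ω₀}, …, □_{ω_n}`. -/

section Locality

open BIJ88NeumannPropagatorSmallPlaquetteRegion (nOp_congr gBox_congr)

variable {J : Type*} {k : ℕ} (Q : J → Finset (Balaban1983to89.Site P j)) (h : J → Balaban1983to89.Site P j → ℝ)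
  {U U' : GaugeField P j U1}

/-- **`a_i[u]` depends on `u` only through `Q_i*`**. [cite: BalabanImbrieJaffe1988, (2.27) p.263] -/
theorem aLet_congr (hk : j + k ≤ P.m + P.K) (a c : ℝ) {i : J} (hU : ∀ b ∈ starB (Q i), U b = U' b) :
    aLet a c U k Q h i = aLet a c U' k Q h i := by
  unfold aLet; rw [gBox_congr hk a c hU]

/-- **`K_i[u]` depends on `u` only through `Q_i*`**. [cite: BalabanImbrieJaffe1988, (2.27) p.263] -/
theorem kLet_congr (hk : j + k ≤ P.m + P.K) (a c : ℝ) {i : J} (hU : ∀ b ∈ starB (Q i), U b = U' b) :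
    kLet a c U k Q h i = kLet a c U' k Q h i := by
  unfold kLet; rw [nOp_congr hk a c hU]

/-- **`b_i[u]` depends on `u` only through `Q_i*`**. [cite: BalabanImbrieJaffe1988, (2.27) p.263] -/
theorem bLet_congr (hk : j + k ≤ P.m + P.K) (a c : ℝ) {i : J} (hU : ∀ b ∈ starB (Q i), U b = U' b) :
    bLet a c U k Q h i = bLet a c U' k Q h i := by
  unfold bLet; rw [kLet_congr Q h hk a c hU, gBox_congr hk a c hU]

/-- kernel: the ordered products `b_{ω₁}⋯b_{ω_n}` depend on `u` only through `⋃_t Q_{ω_t}*`. [cite: BalabanImbrieJaffe1988, p.264] -/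
theorem bprod_bLet_congr (hk : j + k ≤ P.m + P.K) (a c : ℝ) :
    ∀ (n : ℕ) (ys : Fin n → J), (∀ t, ∀ b ∈ starB (Q (ys t)), U b = U' b) →
      bprod (bLet a c U k Q h) n ys = bprod (bLet a c U' k Q h) n ys
  | 0, ys, _ => by rw [B4RandomWalk213.bprod_zero, B4RandomWalk213.bprod_zero]
  | n + 1, ys, hU => by
      rw [B4RandomWalk213.bprod_succ, B4RandomWalk213.bprod_succ, bLet_congr Q h hk a c (hU 0), bprod_bLet_congr hk a c n (Fin.tail ys) fun t => hU t.succ]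

/-- **LOCALITY OF THE WALK TERMS: `T_ω[u] = T_ω[u′]` whenever `u = u′` on `Q_{ω₀}* ∪ Q_{ω₁}* ∪ ⋯ ∪ Q_{ω_n}*`** — every term of (2.13) depends on
the field only through the bonds of the regions the walk visits (any level `j`, any `k` with `j + k ≤ m + K`, any localization datum, any field).
[cite: BalabanImbrieJaffe1988, p.264] -/
theorem piece_congr (hk : j + k ≤ P.m + P.K) (a c : ℝ) (ω : Walk J) (h0 : ∀ b ∈ starB (Q ω.start), U b = U' b)
    (hs : ∀ t, ∀ b ∈ starB (Q (ω.steps t)), U b = U' b) : piece a c U k Q h ω = piece a c U' k Q h ω := by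
  unfold piece; rw [aLet_congr Q h hk a c h0, bprod_bLet_congr Q h hk a c ω.len ω.steps hs]

/-- **LOCALITY FOR [6]'s CUBES ON THE TORUS**: the walk term of `ω = (ω₀; ω₁, …, ω_n)` in the expansion of `G_k(Ω,u)` over the windows `□_i`
(`Q_i = Ω ∩ □_i`) is unchanged when `u` is modified off the bonds with both ends in `Ω ∩ (□_{ω₀} ∪ ⋯ ∪ □_{ω_n})`.
[cite: BalabanImbrieJaffe1988, p.264] -/
theorem piece_cubes_congr {M₀ : ℕ} (hk : j + k ≤ P.m + P.K) (a c : ℝ) (Ω : Finset (Balaban1983to89.Site P j)) (ω : Walk (Lab P j k M₀))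
    (hU : ∀ b : PBond P j, b.src ∈ Ω → b.tgt ∈ Ω →
      (∃ i, (i = ω.start ∨ ∃ t, i = ω.steps t) ∧ b.src ∈ cube k M₀ i ∧ b.tgt ∈ cube k M₀ i) → U b = U' b) :
    piece a c U k (fun l : Lab P j k M₀ => Ω ∩ cube k M₀ l) (hT k M₀) ω
      = piece a c U' k (fun l : Lab P j k M₀ => Ω ∩ cube k M₀ l) (hT k M₀) ω := by
  refine piece_congr _ _ hk a c ω (fun b hb => ?_) (fun t b hb => ?_)
  · rw [mem_starB] at hb
    simp only [Finset.mem_inter] at hb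
    exact hU b hb.1.1 hb.2.1 ⟨ω.start, Or.inl rfl, hb.1.2, hb.2.2⟩
  · rw [mem_starB] at hb
    simp only [Finset.mem_inter] at hb
    exact hU b hb.1.1 hb.2.1 ⟨ω.steps t, Or.inr ⟨t, rfl⟩, hb.1.2, hb.2.2⟩

end Locality

end

end Literature.MathematicalPhysics.QuantumFieldTheory.BalabanImbrieJaffe1984to88.BIJ88NeumannRandomWalkL2Torus
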